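import Literature.Geometry.DiscreteGeometry.KissingNumberFour
import Mathlib.Analysis.InnerProductSpace.GramMatrix
import Mathlib.Analysis.Matrix.PosDef

/-!
# Uniqueness of the `24`-point kissing configuration in `ℝ⁴`: the classification step, proved

de Laat–Leijenhorst–de Muinck Keizer 2024 (arXiv:2404.18794, §5.1) prove **Theorem 5.3** — "the
`D₄` root system is the unique optimal kissing configuration in `ℝ⁴` up to isometry", vendored in
`KissingNumberFour.lean` as the named fact `dlldmk2024_kissing_four_unique` — in two steps:

1. **Lemma 5.1** (rigidity): if `C ⊆ 𝕊³` has `24` points and minimal angle `≥ π/3` then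
   `⟪x, y⟫ ∈ {-1, -1/2, 0, 1/2}` for all distinct `x, y ∈ C`. This is read off an *exact optimal
   solution of the second level of the Lasserre hierarchy* (`d₁ = 14`, `d₂ = δ = 16`; rational
   matrices rounded from a 40-digit SDP solution, positive semidefiniteness checked by Cholesky in
   ball arithmetic, `p₂` has roots `-1, ±1/2, 0` on `[-1, 1/2]` by Sturm sequences; data and Julia/Nemo
   verification scripts at doi:10.4121/74ce1c25-6fca-4680-8a36-e9c18e7e9594). It is a certified
   computation resting on §2–§4 of the paper and is NOT formalised here.
2. **Theorem 5.3 from Lemma 5.1**: `C` is closed under the reflections `s_α β = β - 2⟪α, β⟫α`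
   ("`β'` must be in `C` by optimality", i.e. by `k(4) = 24`, Musin 2008), hence a simply-laced root
   system of rank `4` with `24` roots, hence `D₄` (classification of root systems, or Calderbank et
   al.).

This file PROVES step 2 (`dlldmk2024_kissing_four_unique_of_rigidity`): assuming Lemma 5.1 (as an
explicit hypothesis, stated verbatim for `24`-point configurations) and `musin2008_kissing_four`,
the fact `dlldmk2024_kissing_four_unique` follows. Mathlib has no classification of root systems,
so the root-system step is replaced by an elementary argument designed for formalisation:

* closure: `-x ∈ C`, and `β - α ∈ C` whenever `⟪α, β⟫ = 1/2` (`d4u_neg_mem`, `d4u_sub_mem`);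
* counting: for `β ∈ C` at most `8` members have `⟪β, x⟫ = 1/2` (`d4u_card_half_le`: the class
  minus two points injects into the orthogonal class);
* the frame-potential inequality `4 Σ_{x,y} ⟪x, y⟫² ≥ |C|²` (`d4u_frame_potential`, folklore) then
  forces the `D₄` parameters: `8` members at `1/2`, `8` at `-1/2`, `6` orthogonal, for every `β`
  (`d4u_card_classes_eq`);
* the `6` members orthogonal to `β` form `±` an orthogonal `3`-frame (`d4u_orth_no_half`, a
  three-way count), so `C` contains an orthonormal basis `e` (`d4u_exists_basis`);
* every other member has all four `e`-coordinates `±1/2` and all `16` sign patterns occur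
  (`d4u_coords`, `d4u_halfvec_all`), i.e. `C = {±eᵢ} ∪ {(±1/2)⁴}`;
* the orthonormal basis `c` with `e₀ = (c₀+c₁)/√2, e₁ = (c₀-c₁)/√2, e₂ = (c₂+c₃)/√2,
  e₃ = (c₂-c₃)/√2` carries `d4Roots = {(±uᵢ ± uⱼ)/√2}` onto `C` (`dlldmk2024_kissing_four_unique_of_rigidity`).

All statements about `C` are proved for a general real inner product space `F` (dimension `4`
entering as an orthonormal basis indexed by `Fin 4`); only the assembly is in
`EuclideanSpace ℝ (Fin 4)`. No new definitions, no new named facts.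

### Lemma 5.1 alone suffices (section `RigidityAlone`)

The hypothesis `k(4) = 24` is itself a consequence of the *statement* of Lemma 5.1: any two
members of a kissing configuration with `≥ 24` members lie in a common `24`-point
sub-configuration, so all its inner products are in `{-1, -1/2, 0, 1/2}`; in such a *rigid*
configuration every member `x` has at most `8` members at inner product `1/2`
(`d4u_card_half_le_eight`: the vectors `y - x/2` lie in `x^⊥ ≅ ℝ³`, where at most `4` lines are
pairwise at angle `arccos (1/3)` — proved by a weighted frame-potential bound,
`d4u_frame_potential_weighted`, with no maximality hypothesis), hence `Σ_y ⟪x, y⟫² ≤ 6`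
(`d4u_sum_sq_inner_le_six`) and the frame-potential inequality gives `|C| ≤ 24`
(`d4u_card_le_of_rigid`). Consequently: `musin2008_kissing_four_of_rigidity` (Lemma 5.1 ⇒
`k(4) ≤ 24`, i.e. `musin2008_kissing_four`), `dlldmk2024_kissing_four_unique_of_lemma51`
(Lemma 5.1 ⇒ the fact), `dlldmk2024_kissing_four_unique_iff_lemma51` (the fact ⇔ Lemma 5.1) and
`musin2008_kissing_four_of_kissing_four_unique` (the fact ⇒ Musin's fact). The unformalised
residue of `dlldmk2024_kissing_four_unique` is therefore exactly the paper's SDP-certified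
Lemma 5.1 (in the source, `k(4) ≤ 24` is likewise read off the certificate: "any feasible
solution `K` provides an upper bound on `k(n)`", §1).

### Theorem 5.2 and `k(4) ≥ 24` (section `OptimalCode`)

`d4Roots` is a `24`-point kissing configuration (`d4Roots_ncard`, `d4Roots_inner_cases`,
`d4Roots_kissing`: the `24` integer roots are counted by `decide`, distinct roots have inner
product in `{-1, -1/2, 0, 1/2}`), and **Theorem 5.2** of the source ("the `D₄` root system is an
optimal spherical code": every `24` unit vectors of `ℝ⁴` contain two distinct ones at inner product
`≥ 1/2 = t_max(D₄)`) follows from Lemma 5.1 (`dlldmk2024_theorem52_of_lemma51`), hence from the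
fact (`dlldmk2024_theorem52_of_kissing_four_unique`, `dlldmk2024_theorem52_dist_form`) — here by the
exact class count (`8` members at inner product `1/2` from every member) rather than the source's
perturbation argument.

### The proof of Lemma 5.1: weak duality of the second Lasserre level

(Sections `LasserreDuality`, `LasserrePositivity`, `LasserreDualityE4`.)

The source proves Lemma 5.1 from its exact certificate `K` by the weak-duality chain of the
second level of the Lasserre hierarchy of de Laat–Vallentin (program (1) of §1 with `t = 2`):
"`0 ≤ Σ_{J₁,J₂ ∈ I₂, J₁,J₂ ⊆ C} K(J₁,J₂) = Σ_{Q ∈ I₄, Q ⊆ C} A₂K(Q) ≤ K(∅,∅) - |C|`; since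
`|C| = K(∅,∅) = 24`, equality holds throughout, so `A₂K(Q) = 0` for all `Q ⊆ C` with `|Q| ≤ 4`",
and `A₂K({x,y}) = p₂(⟪x,y⟫)` vanishes on `[-1, 1/2]` exactly at `-1, ±1/2, 0` (Sturm sequences).
This chain is PROVED here for an arbitrary kernel `K` on finite sets, with
`A₂K(Q) = Σ_{J₁ ∪ J₂ = Q, |Jᵢ| ≤ 2} K(J₁,J₂)` written out as a double sum over the subsets of `Q`:
the regrouping identity (`lasserre2_sum_pairs_eq_sum_union`), the explicit one- and two-point
constraints (`lasserre2_union_sum_singleton`, `lasserre2_union_sum_pair`), "any feasible `K`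
bounds `k(n)` by `K(∅,∅)`" (`lasserre2_card_le`, `lasserre2_code_card_le`,
`musin2008_kissing_four_of_lasserre2_certificate`), complementary slackness at a sharp bound
(`lasserre2_union_sum_eq_zero_of_sharp`), Lemma 5.1 from the properties of the certificate
(`dlldmk2024_lemma51_of_lasserre2_certificate`) and hence the fact
(`dlldmk2024_kissing_four_unique_of_lasserre2_certificate`). Positivity of `K` enters only through
the nonnegativity of its double sum over the `≤ 2`-element sub-configurations of a code
(`lasserre2_sum_pairs_nonneg_of_posSemidef` records that positive semidefinite kernels have it),
and kernels of the certificate's shape `Σ_{a,b} (BᵀB)_{ab} ⟪ψ_a(J₁), ψ_b(J₂)⟫` — `K̂ = BᵀB ⪰ 0`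
paired with a Gram ("zonal") matrix of feature maps `ψ_a` — are positive semidefinite
(`lasserre2_posSemidef_of_factor_gram`, section `LasserrePositivity`), so that positivity of the
paper's `K` rests exactly on the identification of its explicit polynomial zonal matrices `Z_λ`
with the Gram matrices of the equivariant maps `ψ_{λ,(i,j,k)}` of §2 (representation theory of
`O(4)`, §2–§3).
What is NOT formalised is the existence of the certificate itself: the rational matrices
`K̂_λ ⪰ 0` (`|λ| ≤ 14`), the zonal matrices `Z_λ` of §2–§3 making `K = Σ_λ ⟨K̂_λ, Z_λ⟩` a positive
kernel, the sums-of-squares identities of §4 for `p₁, …, p₄` (degree `16`), and the Sturm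
computation for `p₂` (data and Julia/Nemo scripts:
doi:10.4121/74ce1c25-6fca-4680-8a36-e9c18e7e9594).
### The semidefinite program of §4 (sections `SemialgebraicConstraints`, `SemialgebraicE4`)

§4 replaces the constraints of program (1) by polynomial constraints: `A₂K` on codes of sizes
`1, 2, 3, 4` is given by polynomials `p₁`, `p₂(u)`, `p₃(u₁,u₂,u₃)`, `p₄(u₁,…,u₆)` in the inner
products, and program (pr:semialgebraic) asks `p₁ ≤ -1`, `p₂ ≤ 0` on `[-1, cos θ]`, `p₃ ≤ 0` on `Δ₃`,
`p₄ ≤ 0` on `Δ₄` (`Δᵢ`: `(u_j + 1)(cos θ - u_j) ≥ 0` and all principal minors of size `≥ 3` of the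
matrix `Gᵢ` nonnegative), the inequalities being certified by sums of squares
(`pᵢ + Σ_k r_k g_k ≡ 0`). PROVED here: such certificates imply the inequalities on `Δᵢ`
(`lasserre2_nonpos_of_sos_certificate`, `lasserre2_sos_nonneg_of_posSemidef`); the inner products
of every code lie in `[-1, cos θ]` and its Gram minors are nonnegative (`d4u_box_nonneg`,
`d4u_det_gram_three_nonneg`, `d4u_det_gram_four_nonneg`, via Mathlib's `Matrix.posSemidef_gram`),
so the polynomial constraints give the constraints `A₂K(Q) ≤ 0` of program (1)
(`lasserre2_union_sum_nonpos_of_polynomials`) and the code bound `|C| ≤ K(∅, ∅)` in any dimension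
(`lasserre2_code_card_le_of_polynomials`); for `n = 4`, `cos θ = 1/2`, objective `≤ 24` this yields
`musin2008_kissing_four_of_semialgebraic_certificate` and — adding the root condition on `p₂` —
`dlldmk2024_kissing_four_unique_of_semialgebraic_certificate`. The unformalised residue of the fact
is thereby reduced to the rational data of the certificate (the matrices `K̂_λ ⪰ 0`, the
polynomials `p₁, …, p₄` with their sums-of-squares identities, the roots of `p₂` on `[-1, 1/2]`)
and the positivity of `K = Σ_λ ⟨K̂_λ, Z_λ⟩` (the zonal matrices `Z_λ` of §2–§3 as Gram matrices).

(The moment-side Lasserre hierarchy for stable sets of *finite* graphs, Laurent 2003, is formalised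
independently in `Literature.Combinatorics.SimpleGraph.LasserreStableBound`; it is not used here.)

## References

* D. de Laat, N. Leijenhorst, W. H. H. de Muinck Keizer, *Optimality and uniqueness of the `D₄`
  root system*, arXiv:2404.18794 (2024): §1 (the `D₄` root system; program (1), the second level of
  the Lasserre hierarchy), §4 (`p₁, …, p₄`, program (pr:semialgebraic), `Δ₃`, `Δ₄`, sums of
  squares), §5.1, Lemma 5.1 and its proof, Theorem 5.2, Theorem 5.3
  and its proof (incl. the alternative proof via three orthonormal bases).
  [`DeLaatLeijenhorstDeMuinckKeizer2024`]
* O. R. Musin, *The kissing number in four dimensions*, Ann. of Math. 168 (2008) 1–32. [`Musin2008`]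
-/

noncomputable section

open scoped RealInnerProductSpace

namespace Literature.Geometry.DiscreteGeometry

variable {F : Type*} [NormedAddCommGroup F] [InnerProductSpace ℝ F]

/-! ### Rigid configurations: inner products in `{-1, -1/2, 0, 1/2}` and maximality -/

/-- In a configuration of unit vectors whose distinct members have inner products in
`{-1, -1/2, 0, 1/2}`, any two members (equal or not) have inner product in `{1, -1, -1/2, 0, 1/2}`.
[folklore] -/
theorem d4u_inner_cases {C : Finset F} (hC1 : ∀ x ∈ C, ‖x‖ = 1)
    (hv : ∀ x ∈ C, ∀ y ∈ C, x ≠ y →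
      (⟪x, y⟫ = -1 ∨ ⟪x, y⟫ = -1 / 2 ∨ ⟪x, y⟫ = 0 ∨ ⟪x, y⟫ = 1 / 2))
    {x y : F} (hx : x ∈ C) (hy : y ∈ C) :
    ⟪x, y⟫ = 1 ∨ ⟪x, y⟫ = -1 ∨ ⟪x, y⟫ = -1 / 2 ∨ ⟪x, y⟫ = 0 ∨ ⟪x, y⟫ = 1 / 2 := by
  by_cases hxy : x = y
  · subst hxy
    left
    rw [real_inner_self_eq_norm_sq, hC1 x hx, one_pow]
  · right
    exact hv x hx y hy hxy

/-- Unit vectors with inner product `1` are equal (equality case of Cauchy–Schwarz). [folklore] -/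
theorem d4u_eq_of_inner_eq_one {x y : F} (hx : ‖x‖ = 1) (hy : ‖y‖ = 1) (h : ⟪x, y⟫ = 1) :
    x = y :=
  (inner_eq_one_iff_of_norm_eq_one hx hy).1 h

/-- Unit vectors with inner product `-1` are antipodal. [folklore] -/
theorem d4u_eq_neg_of_inner_eq_neg_one {x y : F} (hx : ‖x‖ = 1) (hy : ‖y‖ = 1)
    (h : ⟪x, y⟫ = -1) : x = -y :=
  (inner_eq_neg_one_iff_of_norm_eq_one hx hy).1 h

/-- **Antipodality.** A maximal rigid configuration is closed under `x ↦ -x` (the reflection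
`s_x x = -x`; de Laat–Leijenhorst–de Muinck Keizer 2024, proof of Thm 5.3, "the only scalar
multiples of `α ∈ C` can be `α` and `-α`" together with the reflection step).
[cite: DeLaatLeijenhorstDeMuinckKeizer2024, proof of Theorem 5.3] -/
theorem d4u_neg_mem {C : Finset F} (hC1 : ∀ x ∈ C, ‖x‖ = 1)
    (hv : ∀ x ∈ C, ∀ y ∈ C, x ≠ y →
      (⟪x, y⟫ = -1 ∨ ⟪x, y⟫ = -1 / 2 ∨ ⟪x, y⟫ = 0 ∨ ⟪x, y⟫ = 1 / 2))
    (hmax : ∀ v : F, ‖v‖ = 1 → (∀ x ∈ C, x ≠ v → ⟪v, x⟫ ≤ 1 / 2) → v ∈ C)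
    {x : F} (hx : x ∈ C) : -x ∈ C := by
  refine hmax (-x) (by rw [norm_neg, hC1 x hx]) fun y hy hyx => ?_
  rw [inner_neg_left]
  rcases d4u_inner_cases hC1 hv hx hy with h | h | h | h | h
  · rw [h]; norm_num
  · exact absurd (d4u_eq_neg_of_inner_eq_neg_one (hC1 x hx) (hC1 y hy) h)
      (fun hxy => hyx (by rw [hxy, neg_neg]))
  all_goals rw [h]; norm_num

/-- **Closure under reflections, the `⟪α, β⟫ = 1/2` case**: if `α, β ∈ C` with `⟪α, β⟫ = 1/2` then
the reflection `s_α β = β - α` of `β` in the hyperplane orthogonal to `α` belongs to `C`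
("`β'` must be in `C` by optimality of `C`", de Laat–Leijenhorst–de Muinck Keizer 2024, proof of
Theorem 5.3). [cite: DeLaatLeijenhorstDeMuinckKeizer2024, proof of Theorem 5.3] -/
theorem d4u_sub_mem {C : Finset F} (hC1 : ∀ x ∈ C, ‖x‖ = 1)
    (hv : ∀ x ∈ C, ∀ y ∈ C, x ≠ y →
      (⟪x, y⟫ = -1 ∨ ⟪x, y⟫ = -1 / 2 ∨ ⟪x, y⟫ = 0 ∨ ⟪x, y⟫ = 1 / 2))
    (hmax : ∀ v : F, ‖v‖ = 1 → (∀ x ∈ C, x ≠ v → ⟪v, x⟫ ≤ 1 / 2) → v ∈ C)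
    {a b : F} (ha : a ∈ C) (hb : b ∈ C) (hab : ⟪a, b⟫ = 1 / 2) : b - a ∈ C := by
  have ha1 := hC1 a ha
  have hb1 := hC1 b hb
  have hn2 : ‖b - a‖ ^ 2 = 1 := by
    rw [norm_sub_sq_real b a, real_inner_comm a b, hab, ha1, hb1]; norm_num
  have hn : ‖b - a‖ = 1 := by
    have h0 : 0 ≤ ‖b - a‖ := norm_nonneg _
    nlinarith [hn2, h0]
  refine hmax (b - a) hn fun y hy hyne => ?_
  have hy1 := hC1 y hy
  -- the reflected vector has inner product `≠ 1` with `y` since `y ≠ b - a`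
  have key : ⟪b - a, y⟫ ≠ 1 := fun h1 =>
    hyne (d4u_eq_of_inner_eq_one hn hy1 h1).symm
  rw [inner_sub_left] at key ⊢
  by_cases hya : y = a
  · subst hya
    rw [real_inner_comm y b, hab, real_inner_self_eq_norm_sq, ha1]; norm_num
  by_cases hya' : y = -a
  · subst hya'
    rw [inner_neg_right, inner_neg_right, real_inner_comm a b, hab, real_inner_self_eq_norm_sq,
      ha1]
    norm_num
  by_cases hyb : y = b
  · subst hyb
    rw [real_inner_self_eq_norm_sq, hb1, hab]; norm_num
  rcases hv a ha y hy (Ne.symm hya) with h | h | h | h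
  · exact absurd (d4u_eq_neg_of_inner_eq_neg_one ha1 hy1 h) fun h' => hya' (by rw [h', neg_neg])
  all_goals
    rcases hv b hb y hy (Ne.symm hyb) with h' | h' | h' | h' <;>
      (rw [h, h'] at key ⊢; revert key; norm_num)

/-- **Closure under reflections, the `⟪α, β⟫ = -1/2` case**: `β + α ∈ C`.
[cite: DeLaatLeijenhorstDeMuinckKeizer2024, proof of Theorem 5.3] -/
theorem d4u_add_mem {C : Finset F} (hC1 : ∀ x ∈ C, ‖x‖ = 1)
    (hv : ∀ x ∈ C, ∀ y ∈ C, x ≠ y →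
      (⟪x, y⟫ = -1 ∨ ⟪x, y⟫ = -1 / 2 ∨ ⟪x, y⟫ = 0 ∨ ⟪x, y⟫ = 1 / 2))
    (hmax : ∀ v : F, ‖v‖ = 1 → (∀ x ∈ C, x ≠ v → ⟪v, x⟫ ≤ 1 / 2) → v ∈ C)
    {a b : F} (ha : a ∈ C) (hb : b ∈ C) (hab : ⟪a, b⟫ = -1 / 2) : b + a ∈ C := by
  have hna : -a ∈ C := d4u_neg_mem hC1 hv hmax ha
  have h : ⟪-a, b⟫ = 1 / 2 := by rw [inner_neg_left, hab]; norm_num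
  simpa [sub_neg_eq_add] using d4u_sub_mem hC1 hv hmax hna hb h


/-! ### The five classes of a member `β`: `⟪β, x⟫ ∈ {1, -1, 1/2, -1/2, 0}` -/

/-- Numerical helper: the indicator sum of the five classes is `1`. [folklore] -/
theorem d4u_indicator_sum {t : ℝ} (h : t = 1 ∨ t = -1 ∨ t = -1 / 2 ∨ t = 0 ∨ t = 1 / 2) :
    ((if t = 1 then 1 else 0) + (if t = -1 then 1 else 0) + (if t = 1 / 2 then 1 else 0)
      + (if t = -1 / 2 then 1 else 0) + (if t = 0 then 1 else 0) : ℕ) = 1 := by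
  rcases h with rfl | rfl | rfl | rfl | rfl <;> norm_num

/-- **Class sizes.** For `β` in a maximal rigid `24`-point configuration `C`, the members of `C`
other than `±β` split into the classes `⟪β, x⟫ = 1/2`, `⟪β, x⟫ = -1/2`, `⟪β, x⟫ = 0`, of total
size `22`. [cite: DeLaatLeijenhorstDeMuinckKeizer2024, Lemma 5.1 and proof of Theorem 5.3] -/
theorem d4u_card_classes {C : Finset F} (hC1 : ∀ x ∈ C, ‖x‖ = 1)
    (hv : ∀ x ∈ C, ∀ y ∈ C, x ≠ y →
      (⟪x, y⟫ = -1 ∨ ⟪x, y⟫ = -1 / 2 ∨ ⟪x, y⟫ = 0 ∨ ⟪x, y⟫ = 1 / 2))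
    (hmax : ∀ v : F, ‖v‖ = 1 → (∀ x ∈ C, x ≠ v → ⟪v, x⟫ ≤ 1 / 2) → v ∈ C)
    (hcard : C.card = 24) {β : F} (hβ : β ∈ C) :
    (C.filter fun x => ⟪β, x⟫ = 1 / 2).card + (C.filter fun x => ⟪β, x⟫ = -1 / 2).card
      + (C.filter fun x => ⟪β, x⟫ = 0).card = 22 := by
  have hβ1 := hC1 β hβ
  -- the classes `⟪β, x⟫ = 1` and `⟪β, x⟫ = -1` are the singletons `{β}` and `{-β}`
  have h1 : (C.filter fun x => ⟪β, x⟫ = 1).card = 1 := by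
    rw [Finset.card_eq_one]
    refine ⟨β, Finset.ext fun y => ?_⟩
    simp only [Finset.mem_filter, Finset.mem_singleton]
    constructor
    · rintro ⟨hy, h⟩; exact (d4u_eq_of_inner_eq_one hβ1 (hC1 y hy) h).symm
    · rintro rfl; exact ⟨hβ, by rw [real_inner_self_eq_norm_sq, hβ1, one_pow]⟩
  have h2 : (C.filter fun x => ⟪β, x⟫ = -1).card = 1 := by
    rw [Finset.card_eq_one]
    refine ⟨-β, Finset.ext fun y => ?_⟩
    simp only [Finset.mem_filter, Finset.mem_singleton]
    constructor
    · rintro ⟨hy, h⟩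
      rw [d4u_eq_neg_of_inner_eq_neg_one hβ1 (hC1 y hy) h, neg_neg]
    · rintro rfl
      exact ⟨d4u_neg_mem hC1 hv hmax hβ, by
        rw [inner_neg_right, real_inner_self_eq_norm_sq, hβ1]; norm_num⟩
  -- the five class sizes add up to `|C|`
  have hsum : (C.filter fun x => ⟪β, x⟫ = 1).card + (C.filter fun x => ⟪β, x⟫ = -1).card
      + (C.filter fun x => ⟪β, x⟫ = 1 / 2).card + (C.filter fun x => ⟪β, x⟫ = -1 / 2).card
      + (C.filter fun x => ⟪β, x⟫ = 0).card = C.card := by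
    simp only [Finset.card_filter]
    rw [← Finset.sum_add_distrib, ← Finset.sum_add_distrib, ← Finset.sum_add_distrib,
      ← Finset.sum_add_distrib, Finset.card_eq_sum_ones]
    refine Finset.sum_congr rfl fun x hx => ?_
    exact d4u_indicator_sum (d4u_inner_cases hC1 hv hβ hx)
  omega

/-- **At most `8` members at inner product `1/2`.** For `β` in a maximal rigid `24`-point
configuration `C`, at most `8` members `x` of `C` have `⟪β, x⟫ = 1/2`. (The class is closed under
`x ↦ β - x`; a member `y` of the class other than `x₀, β - x₀` has `⟪x₀, y⟫ ∈ {0, 1/2}` and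
`x₀ - y`, resp. `β - x₀ - y`, is a member orthogonal to `β`; this injects the class minus two
points into the orthogonal class, whence `3 · #class ≤ 24`.) An elementary replacement for the
root-system classification used in the source.
[cite: DeLaatLeijenhorstDeMuinckKeizer2024, proof of Theorem 5.3] -/
theorem d4u_card_half_le {C : Finset F} (hC1 : ∀ x ∈ C, ‖x‖ = 1)
    (hv : ∀ x ∈ C, ∀ y ∈ C, x ≠ y →
      (⟪x, y⟫ = -1 ∨ ⟪x, y⟫ = -1 / 2 ∨ ⟪x, y⟫ = 0 ∨ ⟪x, y⟫ = 1 / 2))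
    (hmax : ∀ v : F, ‖v‖ = 1 → (∀ x ∈ C, x ≠ v → ⟪v, x⟫ ≤ 1 / 2) → v ∈ C)
    (hcard : C.card = 24) {β : F} (hβ : β ∈ C) :
    (C.filter fun x => ⟪β, x⟫ = 1 / 2).card ≤ 8 := by
  classical
  have hβ1 := hC1 β hβ
  have hcls := d4u_card_classes hC1 hv hmax hcard hβ
  set P := C.filter fun x => ⟪β, x⟫ = 1 / 2 with hP
  set N := C.filter fun x => ⟪β, x⟫ = -1 / 2 with hN
  set Z := C.filter fun x => ⟪β, x⟫ = 0 with hZ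
  have memP : ∀ {y}, y ∈ P ↔ y ∈ C ∧ ⟪β, y⟫ = 1 / 2 := fun {y} => Finset.mem_filter
  have memN : ∀ {y}, y ∈ N ↔ y ∈ C ∧ ⟪β, y⟫ = -1 / 2 := fun {y} => Finset.mem_filter
  have memZ : ∀ {y}, y ∈ Z ↔ y ∈ C ∧ ⟪β, y⟫ = 0 := fun {y} => Finset.mem_filter
  -- `|P| ≤ |N|` via `y ↦ -y`
  have hPN : P.card ≤ N.card := by
    refine Finset.card_le_card_of_injOn (fun y => -y) (fun y hy => ?_)
      (fun y _ y' _ h => neg_injective h)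
    rw [Finset.mem_coe, memP] at hy
    rw [Finset.mem_coe, memN]
    exact ⟨d4u_neg_mem hC1 hv hmax hy.1, by rw [inner_neg_right, hy.2]; norm_num⟩
  -- trivial if `P` is empty
  rcases P.eq_empty_or_nonempty with hPe | ⟨x₀, hx₀⟩
  · rw [hPe]; simp
  obtain ⟨hx₀C, hx₀β⟩ := memP.1 hx₀
  have hx₀1 := hC1 x₀ hx₀C
  -- the partner `x₁ = β - x₀`
  set x₁ := β - x₀ with hx₁
  have hx₁C : x₁ ∈ C :=
    d4u_sub_mem hC1 hv hmax hx₀C hβ (by rw [real_inner_comm β x₀]; exact hx₀β)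
  have hx₀x₁ : ⟪x₀, x₁⟫ = -1 / 2 := by
    rw [hx₁, inner_sub_right, real_inner_comm β x₀, hx₀β, real_inner_self_eq_norm_sq, hx₀1]
    norm_num
  -- members of `P` other than `x₀, x₁` have inner product `0` or `1/2` with `x₀`
  have hval : ∀ y ∈ P, y ≠ x₀ → y ≠ x₁ → (⟪x₀, y⟫ = 0 ∨ ⟪x₀, y⟫ = 1 / 2) := by
    intro y hy hy0 hy1
    obtain ⟨hyC, hyβ⟩ := memP.1 hy
    have hy1' := hC1 y hyC
    rcases hv x₀ hx₀C y hyC (Ne.symm hy0) with h | h | h | h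
    · -- `y = -x₀` is not in the class
      have : x₀ = -y := d4u_eq_neg_of_inner_eq_neg_one hx₀1 hy1' h
      have hy' : y = -x₀ := by rw [this, neg_neg]
      rw [hy', inner_neg_right, hx₀β] at hyβ
      norm_num at hyβ
    · -- `⟪x₁, y⟫ = 1`, so `y = x₁`
      exfalso
      refine hy1 (d4u_eq_of_inner_eq_one (hC1 x₁ hx₁C) hy1' ?_).symm
      rw [hx₁, inner_sub_left, hyβ, h]; norm_num
    · exact Or.inl h
    · exact Or.inr h
  -- the injection into `Z`
  set P' := P.filter fun y => ⟪x₀, y⟫ = 0 ∨ ⟪x₀, y⟫ = 1 / 2 with hP'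
  have hmaps : Set.MapsTo (fun y => if ⟪x₀, y⟫ = 1 / 2 then x₀ - y else x₁ - y) P' Z := by
    intro y hy
    rw [Finset.mem_coe, hP', Finset.mem_filter, memP] at hy
    obtain ⟨⟨hyC, hyβ⟩, hy0⟩ := hy
    rw [Finset.mem_coe, memZ]
    dsimp only
    split_ifs with h
    · refine ⟨d4u_sub_mem hC1 hv hmax hyC hx₀C (by rw [real_inner_comm x₀ y]; exact h), ?_⟩
      rw [inner_sub_right, hx₀β, hyβ]; norm_num
    · have h0 : ⟪x₀, y⟫ = 0 := hy0.resolve_right h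
      refine ⟨d4u_sub_mem hC1 hv hmax hyC hx₁C ?_, ?_⟩
      · rw [hx₁, inner_sub_right, real_inner_comm β y, hyβ, real_inner_comm x₀ y, h0]; norm_num
      · rw [hx₁, inner_sub_right, inner_sub_right, real_inner_self_eq_norm_sq, hβ1, hx₀β, hyβ]
        norm_num
  have hinj : Set.InjOn (fun y => if ⟪x₀, y⟫ = 1 / 2 then x₀ - y else x₁ - y) P' := by
    intro y hy y' hy' hyy
    rw [Finset.mem_coe, hP', Finset.mem_filter] at hy hy'
    simp only at hyy
    split_ifs at hyy with h h' h'
    · exact sub_right_injective hyy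
    · exfalso
      have h0 : ⟪x₀, y'⟫ = 0 := hy'.2.resolve_right h'
      have := congrArg (fun v => ⟪x₀, v⟫) hyy
      simp only [inner_sub_right, real_inner_self_eq_norm_sq, hx₀1, h, hx₀x₁, h0] at this
      norm_num at this
    · exfalso
      have h0 : ⟪x₀, y⟫ = 0 := hy.2.resolve_right h
      have := congrArg (fun v => ⟪x₀, v⟫) hyy
      simp only [inner_sub_right, real_inner_self_eq_norm_sq, hx₀1, h', hx₀x₁, h0] at this
      norm_num at this
    · exact sub_right_injective hyy
  have hP'Z : P'.card ≤ Z.card := Finset.card_le_card_of_injOn _ hmaps hinj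
  -- `P ⊆ P' ∪ {x₀, x₁}`
  have hPP' : P.card ≤ P'.card + 2 := by
    have hsplit := Finset.card_filter_add_card_filter_not
      (s := P) (fun y => ⟪x₀, y⟫ = 0 ∨ ⟪x₀, y⟫ = 1 / 2)
    have hrest : (P.filter fun y => ¬(⟪x₀, y⟫ = 0 ∨ ⟪x₀, y⟫ = 1 / 2)).card ≤ 2 := by
      calc (P.filter fun y => ¬(⟪x₀, y⟫ = 0 ∨ ⟪x₀, y⟫ = 1 / 2)).card
          ≤ ({x₀, x₁} : Finset F).card := by
            refine Finset.card_le_card fun y hy => ?_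
            rw [Finset.mem_filter] at hy
            rw [Finset.mem_insert, Finset.mem_singleton]
            by_contra hne
            rw [not_or] at hne
            exact hy.2 (hval y hy.1 hne.1 hne.2)
        _ ≤ 2 := Finset.card_le_two
    rw [← hP'] at hsplit
    omega
  omega


/-! ### The frame-potential inequality -/

/-- Reordering a fourfold sum (two sums over `univ`, two over a finset). [folklore] -/
theorem d4u_sum4_comm {ι : Type*} [Fintype ι] {α : Type*} (s : Finset α)
    (f : ι → ι → α → α → ℝ) :
    ∑ i, ∑ j, ∑ x ∈ s, ∑ y ∈ s, f i j x y = ∑ x ∈ s, ∑ y ∈ s, ∑ i, ∑ j, f i j x y := by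
  calc ∑ i, ∑ j, ∑ x ∈ s, ∑ y ∈ s, f i j x y
      = ∑ i, ∑ x ∈ s, ∑ j, ∑ y ∈ s, f i j x y :=
        Finset.sum_congr rfl fun i _ => Finset.sum_comm
    _ = ∑ x ∈ s, ∑ i, ∑ j, ∑ y ∈ s, f i j x y := Finset.sum_comm
    _ = ∑ x ∈ s, ∑ i, ∑ y ∈ s, ∑ j, f i j x y :=
        Finset.sum_congr rfl fun x _ => Finset.sum_congr rfl fun i _ => Finset.sum_comm
    _ = ∑ x ∈ s, ∑ y ∈ s, ∑ i, ∑ j, f i j x y :=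
        Finset.sum_congr rfl fun x _ => Finset.sum_comm

/-- **Frame-potential bound** (folklore linear algebra; Sidelnikov, Benedetto–Fickus): for a finite
family `C` of unit vectors in a real inner product space with an orthonormal basis indexed by `ι`,
`|C|² ≤ card ι · Σ_{x, y ∈ C} ⟪x, y⟫²`. With `S i j = Σ_x ⟪x, bᵢ⟫ ⟪x, bⱼ⟫` one has
`Σ_{x,y} ⟪x, y⟫² = Σ_{i,j} S_{ij}² ≥ Σ_i S_{ii}² ≥ (Σ_i S_{ii})² / card ι = |C|² / card ι`. [folklore] -/
theorem d4u_frame_potential {ι : Type*} [Fintype ι] (b : OrthonormalBasis ι ℝ F) (C : Finset F)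
    (hC1 : ∀ x ∈ C, ‖x‖ = 1) :
    (C.card : ℝ) ^ 2 ≤ Fintype.card ι * ∑ x ∈ C, ∑ y ∈ C, ⟪x, y⟫ ^ 2 := by
  obtain ⟨S, hS⟩ : ∃ S : ι → ι → ℝ, ∀ i j, S i j = ∑ x ∈ C, ⟪x, b i⟫ * ⟪x, b j⟫ :=
    ⟨_, fun _ _ => rfl⟩
  -- trace of `S`
  have htr : ∑ i, S i i = C.card := by
    simp only [hS]
    rw [Finset.sum_comm, Finset.card_eq_sum_ones, Nat.cast_sum, Nat.cast_one]
    refine Finset.sum_congr rfl fun x hx => ?_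
    have h := b.sum_inner_mul_inner x x
    rw [real_inner_self_eq_norm_sq, hC1 x hx, one_pow] at h
    rw [← h]
    refine Finset.sum_congr rfl fun i _ => ?_
    rw [real_inner_comm x (b i)]
  -- the sum of squares of the entries of `S` is the frame potential
  have hSS : ∑ i, ∑ j, S i j ^ 2 = ∑ x ∈ C, ∑ y ∈ C, ⟪x, y⟫ ^ 2 := by
    have hL : ∑ i, ∑ j, S i j ^ 2 =
        ∑ i, ∑ j, ∑ x ∈ C, ∑ y ∈ C, ⟪x, b i⟫ * ⟪x, b j⟫ * (⟪y, b i⟫ * ⟪y, b j⟫) := by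
      refine Finset.sum_congr rfl fun i _ => Finset.sum_congr rfl fun j _ => ?_
      rw [sq, hS, Finset.sum_mul_sum]
    have hR : ∑ x ∈ C, ∑ y ∈ C, ⟪x, y⟫ ^ 2 =
        ∑ x ∈ C, ∑ y ∈ C, ∑ i, ∑ j, ⟪x, b i⟫ * ⟪x, b j⟫ * (⟪y, b i⟫ * ⟪y, b j⟫) := by
      refine Finset.sum_congr rfl fun x _ => Finset.sum_congr rfl fun y _ => ?_
      rw [← b.sum_inner_mul_inner x y, sq, Finset.sum_mul_sum]
      refine Finset.sum_congr rfl fun i _ => Finset.sum_congr rfl fun j _ => ?_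
      rw [real_inner_comm y (b i), real_inner_comm y (b j)]
      ring
    rw [hL, hR, d4u_sum4_comm]
  -- diagonal part and Cauchy–Schwarz
  have hdiag : ∑ i, S i i ^ 2 ≤ ∑ i, ∑ j, S i j ^ 2 :=
    Finset.sum_le_sum fun i _ =>
      Finset.single_le_sum (f := fun j => S i j ^ 2) (fun j _ => sq_nonneg _) (Finset.mem_univ i)
  have hcs : (∑ i, S i i) ^ 2 ≤ Fintype.card ι * ∑ i, S i i ^ 2 := by
    have h := Finset.sum_mul_sq_le_sq_mul_sq Finset.univ (fun i => S i i) (fun _ => (1 : ℝ))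
    simp only [mul_one, one_pow, Finset.sum_const, nsmul_eq_mul, Finset.card_univ] at h
    linarith [h]
  have hd : (0 : ℝ) ≤ Fintype.card ι := Nat.cast_nonneg _
  calc (C.card : ℝ) ^ 2 = (∑ i, S i i) ^ 2 := by rw [htr]
    _ ≤ Fintype.card ι * ∑ i, S i i ^ 2 := hcs
    _ ≤ Fintype.card ι * ∑ i, ∑ j, S i j ^ 2 := mul_le_mul_of_nonneg_left hdiag hd
    _ = Fintype.card ι * ∑ x ∈ C, ∑ y ∈ C, ⟪x, y⟫ ^ 2 := by rw [hSS]


/-! ### Exact class sizes: `8`, `8` and `6` -/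

/-- The class `⟪β, x⟫ = 1` of a member `β` is `{β}`. [folklore] -/
theorem d4u_card_one {C : Finset F} (hC1 : ∀ x ∈ C, ‖x‖ = 1) {β : F} (hβ : β ∈ C) :
    (C.filter fun x => ⟪β, x⟫ = 1).card = 1 := by
  have hβ1 := hC1 β hβ
  rw [Finset.card_eq_one]
  refine ⟨β, Finset.ext fun y => ?_⟩
  simp only [Finset.mem_filter, Finset.mem_singleton]
  constructor
  · rintro ⟨hy, h⟩; exact (d4u_eq_of_inner_eq_one hβ1 (hC1 y hy) h).symm
  · rintro rfl; exact ⟨hβ, by rw [real_inner_self_eq_norm_sq, hβ1, one_pow]⟩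

/-- The class `⟪β, x⟫ = -1` of a member `β` of an antipodal configuration is `{-β}`. [folklore] -/
theorem d4u_card_neg_one {C : Finset F} (hC1 : ∀ x ∈ C, ‖x‖ = 1)
    (hv : ∀ x ∈ C, ∀ y ∈ C, x ≠ y →
      (⟪x, y⟫ = -1 ∨ ⟪x, y⟫ = -1 / 2 ∨ ⟪x, y⟫ = 0 ∨ ⟪x, y⟫ = 1 / 2))
    (hmax : ∀ v : F, ‖v‖ = 1 → (∀ x ∈ C, x ≠ v → ⟪v, x⟫ ≤ 1 / 2) → v ∈ C)
    {β : F} (hβ : β ∈ C) :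
    (C.filter fun x => ⟪β, x⟫ = -1).card = 1 := by
  have hβ1 := hC1 β hβ
  rw [Finset.card_eq_one]
  refine ⟨-β, Finset.ext fun y => ?_⟩
  simp only [Finset.mem_filter, Finset.mem_singleton]
  constructor
  · rintro ⟨hy, h⟩
    rw [d4u_eq_neg_of_inner_eq_neg_one hβ1 (hC1 y hy) h, neg_neg]
  · rintro rfl
    exact ⟨d4u_neg_mem hC1 hv hmax hβ, by
      rw [inner_neg_right, real_inner_self_eq_norm_sq, hβ1]; norm_num⟩

/-- Numerical helper: `t²` on the five classes. [folklore] -/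
theorem d4u_sq_indicator {t : ℝ} (h : t = 1 ∨ t = -1 ∨ t = -1 / 2 ∨ t = 0 ∨ t = 1 / 2) :
    t ^ 2 = (if t = 1 then 1 else 0) + (if t = -1 then 1 else 0)
      + (if t = 1 / 2 then 1 else 0) / 4 + (if t = -1 / 2 then 1 else 0) / 4 := by
  rcases h with rfl | rfl | rfl | rfl | rfl <;> norm_num

/-- **Second moment of a member.** `Σ_{x ∈ C} ⟪β, x⟫² = 2 + (#{⟪β,x⟫ = 1/2} + #{⟪β,x⟫ = -1/2})/4`.
[cite: DeLaatLeijenhorstDeMuinckKeizer2024, Lemma 5.1 and proof of Theorem 5.3] -/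
theorem d4u_sum_sq_inner {C : Finset F} (hC1 : ∀ x ∈ C, ‖x‖ = 1)
    (hv : ∀ x ∈ C, ∀ y ∈ C, x ≠ y →
      (⟪x, y⟫ = -1 ∨ ⟪x, y⟫ = -1 / 2 ∨ ⟪x, y⟫ = 0 ∨ ⟪x, y⟫ = 1 / 2))
    (hmax : ∀ v : F, ‖v‖ = 1 → (∀ x ∈ C, x ≠ v → ⟪v, x⟫ ≤ 1 / 2) → v ∈ C)
    {β : F} (hβ : β ∈ C) :
    ∑ x ∈ C, ⟪β, x⟫ ^ 2 = 2 + ((C.filter fun x => ⟪β, x⟫ = 1 / 2).card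
      + (C.filter fun x => ⟪β, x⟫ = -1 / 2).card : ℝ) / 4 := by
  rw [Finset.sum_congr rfl fun x hx => d4u_sq_indicator (d4u_inner_cases hC1 hv hβ hx)]
  rw [Finset.sum_add_distrib, Finset.sum_add_distrib, Finset.sum_add_distrib, ← Finset.sum_div,
    ← Finset.sum_div, Finset.sum_boole, Finset.sum_boole, Finset.sum_boole, Finset.sum_boole,
    d4u_card_one hC1 hβ, d4u_card_neg_one hC1 hv hmax hβ]
  push_cast
  ring

/-- The class `⟪β, x⟫ = -1/2` of `β` is the class `⟪-β, x⟫ = 1/2` of `-β`. [folklore] -/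
theorem d4u_filter_neg_half {C : Finset F} (β : F) :
    (C.filter fun x => ⟪β, x⟫ = -1 / 2) = (C.filter fun x => ⟪-β, x⟫ = 1 / 2) := by
  refine Finset.filter_congr fun x _ => ?_
  rw [inner_neg_left]
  constructor <;> intro h <;> linarith

/-- **Exact class sizes** in a maximal rigid `24`-point configuration in dimension `4` (witnessed
by an orthonormal basis indexed by `Fin 4`): every member `β` has exactly `8` members at inner
product `1/2`, `8` at `-1/2` and `6` orthogonal ones — the parameters of the `D₄` root system.
(From the frame-potential inequality `Σ_{β,x} ⟪β, x⟫² ≥ 24²/4` and the per-member bounds.)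
[cite: DeLaatLeijenhorstDeMuinckKeizer2024, proof of Theorem 5.3] -/
theorem d4u_card_classes_eq {C : Finset F} (hC1 : ∀ x ∈ C, ‖x‖ = 1)
    (hv : ∀ x ∈ C, ∀ y ∈ C, x ≠ y →
      (⟪x, y⟫ = -1 ∨ ⟪x, y⟫ = -1 / 2 ∨ ⟪x, y⟫ = 0 ∨ ⟪x, y⟫ = 1 / 2))
    (hmax : ∀ v : F, ‖v‖ = 1 → (∀ x ∈ C, x ≠ v → ⟪v, x⟫ ≤ 1 / 2) → v ∈ C)
    (hcard : C.card = 24) (b : OrthonormalBasis (Fin 4) ℝ F) {β : F} (hβ : β ∈ C) :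
    (C.filter fun x => ⟪β, x⟫ = 1 / 2).card = 8 ∧ (C.filter fun x => ⟪β, x⟫ = -1 / 2).card = 8
      ∧ (C.filter fun x => ⟪β, x⟫ = 0).card = 6 := by
  -- the per-member quantity `g γ = #{1/2} + #{-1/2} ≤ 16`
  have hle : ∀ γ ∈ C, ((C.filter fun x => ⟪γ, x⟫ = 1 / 2).card
      + (C.filter fun x => ⟪γ, x⟫ = -1 / 2).card : ℝ) ≤ 16 := by
    intro γ hγ
    have h1 := d4u_card_half_le hC1 hv hmax hcard hγ
    have h2 := d4u_card_half_le hC1 hv hmax hcard (d4u_neg_mem hC1 hv hmax hγ)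
    rw [← d4u_filter_neg_half] at h2
    exact_mod_cast Nat.add_le_add h1 h2
  have hpot := d4u_frame_potential b C hC1
  rw [hcard, Fintype.card_fin] at hpot
  have hsumeq : ∑ γ ∈ C, ∑ x ∈ C, ⟪γ, x⟫ ^ 2 = ∑ γ ∈ C, (2 + ((C.filter fun x => ⟪γ, x⟫ = 1 / 2).card
      + (C.filter fun x => ⟪γ, x⟫ = -1 / 2).card : ℝ) / 4) :=
    Finset.sum_congr rfl fun γ hγ => d4u_sum_sq_inner hC1 hv hmax hγ
  have hg : ((C.filter fun x => ⟪β, x⟫ = 1 / 2).card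
      + (C.filter fun x => ⟪β, x⟫ = -1 / 2).card : ℝ) = 16 := by
    by_contra hne
    have hlt := lt_of_le_of_ne (hle β hβ) hne
    have hsum_lt : ∑ γ ∈ C, (2 + ((C.filter fun x => ⟪γ, x⟫ = 1 / 2).card
        + (C.filter fun x => ⟪γ, x⟫ = -1 / 2).card : ℝ) / 4) < ∑ γ ∈ C, (6 : ℝ) :=
      Finset.sum_lt_sum (fun γ hγ => by linarith [hle γ hγ]) ⟨β, hβ, by linarith⟩
    rw [Finset.sum_const, hcard, ← hsumeq] at hsum_lt
    norm_num at hsum_lt hpot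
    linarith
  have h1 := d4u_card_half_le hC1 hv hmax hcard hβ
  have h2 := d4u_card_half_le hC1 hv hmax hcard (d4u_neg_mem hC1 hv hmax hβ)
  rw [← d4u_filter_neg_half] at h2
  have hcls := d4u_card_classes hC1 hv hmax hcard hβ
  have hg' : (C.filter fun x => ⟪β, x⟫ = 1 / 2).card
      + (C.filter fun x => ⟪β, x⟫ = -1 / 2).card = 16 := by exact_mod_cast hg
  omega


/-! ### The orthogonal class of a member is an orthogonal `3`-frame (with signs) -/

/-- Inner products of a member `u ⟂ β` with the members at `⟪β, x⟫ = ±1/2` lie in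
`{-1/2, 0, 1/2}`. [folklore] -/
theorem d4u_inner_cases_orth {C : Finset F} (hC1 : ∀ x ∈ C, ‖x‖ = 1)
    (hv : ∀ x ∈ C, ∀ y ∈ C, x ≠ y →
      (⟪x, y⟫ = -1 ∨ ⟪x, y⟫ = -1 / 2 ∨ ⟪x, y⟫ = 0 ∨ ⟪x, y⟫ = 1 / 2))
    {β u x : F} (hu : u ∈ C) (hβu : ⟪β, u⟫ = 0) (hx : x ∈ C)
    (hβx : ⟪β, x⟫ = 1 / 2 ∨ ⟪β, x⟫ = -1 / 2) :
    ⟪u, x⟫ = -1 / 2 ∨ ⟪u, x⟫ = 0 ∨ ⟪u, x⟫ = 1 / 2 := by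
  rcases d4u_inner_cases hC1 hv hu hx with h | h | h | h | h
  · have := d4u_eq_of_inner_eq_one (hC1 u hu) (hC1 x hx) h
    subst this
    rw [hβu] at hβx; norm_num at hβx
  · have := d4u_eq_neg_of_inner_eq_neg_one (hC1 u hu) (hC1 x hx) h
    rw [this, inner_neg_right, neg_eq_zero] at hβu
    rw [hβu] at hβx; norm_num at hβx
  all_goals tauto

/-- **No `A₂` orthogonal to a member.** In a maximal rigid `24`-point configuration in dimension
`4`, two members orthogonal to a member `β` never have inner product `1/2`. (Otherwise, with
`w = z - z'`, each of the `16` members `x` at `⟪β, x⟫ = ±1/2` is orthogonal to at least one of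
`z, z', w`, while each of `z, z', w` is orthogonal to only `6 - 2 = 4` of them.) An elementary
replacement for the root-system classification used in the source.
[cite: DeLaatLeijenhorstDeMuinckKeizer2024, proof of Theorem 5.3] -/
theorem d4u_orth_no_half {C : Finset F} (hC1 : ∀ x ∈ C, ‖x‖ = 1)
    (hv : ∀ x ∈ C, ∀ y ∈ C, x ≠ y →
      (⟪x, y⟫ = -1 ∨ ⟪x, y⟫ = -1 / 2 ∨ ⟪x, y⟫ = 0 ∨ ⟪x, y⟫ = 1 / 2))
    (hmax : ∀ v : F, ‖v‖ = 1 → (∀ x ∈ C, x ≠ v → ⟪v, x⟫ ≤ 1 / 2) → v ∈ C)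
    (hcard : C.card = 24) (b : OrthonormalBasis (Fin 4) ℝ F) {β z z' : F} (hβ : β ∈ C)
    (hz : z ∈ C) (hz' : z' ∈ C) (hβz : ⟪β, z⟫ = 0) (hβz' : ⟪β, z'⟫ = 0) :
    ⟪z, z'⟫ ≠ 1 / 2 := by
  classical
  intro hzz'
  have hβ1 := hC1 β hβ
  -- the third root `w = z - z'` of the `A₂`
  have hw : z - z' ∈ C := d4u_sub_mem hC1 hv hmax hz' hz (by rw [real_inner_comm z z']; exact hzz')
  have hβw : ⟪β, z - z'⟫ = 0 := by rw [inner_sub_right, hβz, hβz', sub_zero]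
  -- the `16` members at `⟪β, x⟫ = ±1/2`
  set M := C.filter fun x => ⟪β, x⟫ = 1 / 2 ∨ ⟪β, x⟫ = -1 / 2 with hM
  clear_value M
  have hMcard : M.card = 16 := by
    obtain ⟨hP, hN, -⟩ := d4u_card_classes_eq hC1 hv hmax hcard b hβ
    have : M.card = (C.filter fun x => ⟪β, x⟫ = 1 / 2).card
        + (C.filter fun x => ⟪β, x⟫ = -1 / 2).card := by
      rw [hM, Finset.card_filter, Finset.card_filter, Finset.card_filter, ← Finset.sum_add_distrib]
      refine Finset.sum_congr rfl fun x _ => ?_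
      by_cases h : ⟪β, x⟫ = 1 / 2
      · simp only [h]; norm_num
      · simp only [h, false_or]; norm_num
    rw [this, hP, hN]
  -- each `u ∈ {z, z', w}` is orthogonal to at most `4` members of `M`
  have hfour : ∀ u ∈ C, ⟪β, u⟫ = 0 → (M.filter fun x => ⟪u, x⟫ = 0).card ≤ 4 := by
    intro u hu hβu
    obtain ⟨-, -, hZu⟩ := d4u_card_classes_eq hC1 hv hmax hcard b hu
    -- split the orthogonal class of `u` according to membership in `M`
    have hsplit := Finset.card_filter_add_card_filter_not
      (s := C.filter fun x => ⟪u, x⟫ = 0) (fun x => ⟪β, x⟫ = 1 / 2 ∨ ⟪β, x⟫ = -1 / 2)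
    rw [hZu] at hsplit
    have hsub : (M.filter fun x => ⟪u, x⟫ = 0)
        ⊆ (C.filter fun x => ⟪u, x⟫ = 0).filter fun x => ⟪β, x⟫ = 1 / 2 ∨ ⟪β, x⟫ = -1 / 2 := by
      intro x hx
      simp only [hM, Finset.mem_filter] at hx ⊢
      exact ⟨⟨hx.1.1, hx.2⟩, hx.1.2⟩
    have htwo : 2 ≤ ((C.filter fun x => ⟪u, x⟫ = 0).filter
        fun x => ¬(⟪β, x⟫ = 1 / 2 ∨ ⟪β, x⟫ = -1 / 2)).card := by
      have hne : β ≠ -β := fun h => by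
        have : ⟪β, β⟫ = ⟪β, -β⟫ := by rw [← h]
        rw [inner_neg_right, real_inner_self_eq_norm_sq, hβ1] at this
        norm_num at this
      rw [← Finset.card_pair hne]
      refine Finset.card_le_card fun x hx => ?_
      rw [Finset.mem_insert, Finset.mem_singleton] at hx
      simp only [Finset.mem_filter]
      rcases hx with rfl | rfl
      · refine ⟨⟨hβ, by rw [real_inner_comm x u]; exact hβu⟩, ?_⟩
        rw [real_inner_self_eq_norm_sq, hβ1]; norm_num
      · refine ⟨⟨d4u_neg_mem hC1 hv hmax hβ, by rw [inner_neg_right, real_inner_comm β u, hβu,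
          neg_zero]⟩, ?_⟩
        rw [inner_neg_right, real_inner_self_eq_norm_sq, hβ1]; norm_num
    have := Finset.card_le_card hsub
    omega
  -- every member of `M` is orthogonal to at least one of `z, z', w`
  have hone : ∀ x ∈ M, (1 : ℕ) ≤ (if ⟪z, x⟫ = 0 then 1 else 0) + (if ⟪z', x⟫ = 0 then 1 else 0)
      + (if ⟪z - z', x⟫ = 0 then 1 else 0) := by
    intro x hx
    rw [hM, Finset.mem_filter] at hx
    have hp := d4u_inner_cases_orth hC1 hv hz hβz hx.1 hx.2
    have hq := d4u_inner_cases_orth hC1 hv hz' hβz' hx.1 hx.2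
    have hr := d4u_inner_cases_orth hC1 hv hw hβw hx.1 hx.2
    rw [inner_sub_left] at hr ⊢
    rcases hp with hp | hp | hp <;> rcases hq with hq | hq | hq <;> rw [hp, hq] at hr ⊢ <;>
      revert hr <;> norm_num
  -- count
  have hsum : M.card ≤ (M.filter fun x => ⟪z, x⟫ = 0).card + (M.filter fun x => ⟪z', x⟫ = 0).card
      + (M.filter fun x => ⟪z - z', x⟫ = 0).card := by
    calc M.card = ∑ x ∈ M, 1 := Finset.card_eq_sum_ones M
      _ ≤ ∑ x ∈ M, ((if ⟪z, x⟫ = 0 then 1 else 0) + (if ⟪z', x⟫ = 0 then 1 else 0)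
          + (if ⟪z - z', x⟫ = 0 then 1 else 0)) := Finset.sum_le_sum hone
      _ = _ := by
        rw [Finset.sum_add_distrib, Finset.sum_add_distrib, Finset.card_filter, Finset.card_filter,
          Finset.card_filter]
  have h1 := hfour z hz hβz
  have h2 := hfour z' hz' hβz'
  have h3 := hfour (z - z') hw hβw
  omega

/-- Two members of the orthogonal class of `β` are equal, antipodal or orthogonal. [folklore] -/
theorem d4u_orth_class_inner {C : Finset F} (hC1 : ∀ x ∈ C, ‖x‖ = 1)
    (hv : ∀ x ∈ C, ∀ y ∈ C, x ≠ y →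
      (⟪x, y⟫ = -1 ∨ ⟪x, y⟫ = -1 / 2 ∨ ⟪x, y⟫ = 0 ∨ ⟪x, y⟫ = 1 / 2))
    (hmax : ∀ v : F, ‖v‖ = 1 → (∀ x ∈ C, x ≠ v → ⟪v, x⟫ ≤ 1 / 2) → v ∈ C)
    (hcard : C.card = 24) (b : OrthonormalBasis (Fin 4) ℝ F) {β z x : F} (hβ : β ∈ C)
    (hz : z ∈ C) (hx : x ∈ C) (hβz : ⟪β, z⟫ = 0) (hβx : ⟪β, x⟫ = 0) (hxz : x ≠ z)
    (hxz' : x ≠ -z) : ⟪z, x⟫ = 0 := by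
  rcases d4u_inner_cases hC1 hv hz hx with h | h | h | h | h
  · exact absurd (d4u_eq_of_inner_eq_one (hC1 z hz) (hC1 x hx) h).symm hxz
  · exfalso
    refine hxz' ?_
    rw [d4u_eq_neg_of_inner_eq_neg_one (hC1 z hz) (hC1 x hx) h, neg_neg]
  · exfalso
    refine d4u_orth_no_half hC1 hv hmax hcard b hβ hz (d4u_neg_mem hC1 hv hmax hx) hβz
      (by rw [inner_neg_right, hβx, neg_zero]) ?_
    rw [inner_neg_right, h]; norm_num
  · exact h
  · exact absurd h (d4u_orth_no_half hC1 hv hmax hcard b hβ hz hx hβz hβx)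

/-- **An orthonormal `4`-frame inside `C`.** Every member `β` of a maximal rigid `24`-point
configuration in dimension `4` is part of an orthonormal frame `β, z₁, z₂, z₃` of members.
[cite: DeLaatLeijenhorstDeMuinckKeizer2024, proof of Theorem 5.3 (alternative proof: three
orthonormal bases)] -/
theorem d4u_exists_frame {C : Finset F} (hC1 : ∀ x ∈ C, ‖x‖ = 1)
    (hv : ∀ x ∈ C, ∀ y ∈ C, x ≠ y →
      (⟪x, y⟫ = -1 ∨ ⟪x, y⟫ = -1 / 2 ∨ ⟪x, y⟫ = 0 ∨ ⟪x, y⟫ = 1 / 2))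
    (hmax : ∀ v : F, ‖v‖ = 1 → (∀ x ∈ C, x ≠ v → ⟪v, x⟫ ≤ 1 / 2) → v ∈ C)
    (hcard : C.card = 24) (b : OrthonormalBasis (Fin 4) ℝ F) {β : F} (hβ : β ∈ C) :
    ∃ z₁ ∈ C, ∃ z₂ ∈ C, ∃ z₃ ∈ C, ⟪β, z₁⟫ = 0 ∧ ⟪β, z₂⟫ = 0 ∧ ⟪β, z₃⟫ = 0 ∧
      ⟪z₁, z₂⟫ = 0 ∧ ⟪z₁, z₃⟫ = 0 ∧ ⟪z₂, z₃⟫ = 0 := by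
  classical
  obtain ⟨-, -, hZ⟩ := d4u_card_classes_eq hC1 hv hmax hcard b hβ
  set Z := C.filter fun x => ⟪β, x⟫ = 0 with hZdef
  have memZ : ∀ {y}, y ∈ Z ↔ y ∈ C ∧ ⟪β, y⟫ = 0 := fun {y} => Finset.mem_filter
  -- removing `±z` from a subset of `Z` costs at most two elements, the rest is orthogonal to `z`
  have step : ∀ (T : Finset F), T ⊆ Z → ∀ z ∈ T,
      T.card ≤ (T.filter fun x => ⟪z, x⟫ = 0).card + 2 ∧
        ∀ x ∈ (T.filter fun x => ⟪z, x⟫ = 0), ⟪z, x⟫ = 0 := by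
    intro T hT z hz
    refine ⟨?_, fun x hx => (Finset.mem_filter.1 hx).2⟩
    have hsplit := Finset.card_filter_add_card_filter_not (s := T) (fun x => ⟪z, x⟫ = 0)
    have hzZ := memZ.1 (hT hz)
    have hrest : (T.filter fun x => ¬⟪z, x⟫ = 0).card ≤ 2 := by
      calc (T.filter fun x => ¬⟪z, x⟫ = 0).card ≤ ({z, -z} : Finset F).card := by
            refine Finset.card_le_card fun x hx => ?_
            rw [Finset.mem_filter] at hx
            have hxZ := memZ.1 (hT hx.1)
            rw [Finset.mem_insert, Finset.mem_singleton]
            by_contra hne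
            rw [not_or] at hne
            exact hx.2 (d4u_orth_class_inner hC1 hv hmax hcard b hβ hzZ.1 hxZ.1 hzZ.2 hxZ.2
              hne.1 hne.2)
        _ ≤ 2 := Finset.card_le_two
    omega
  -- pick `z₁ ∈ Z`, `z₂ ∈ Z ∩ z₁^⊥`, `z₃ ∈ Z ∩ z₁^⊥ ∩ z₂^⊥`
  have hZpos : 0 < Z.card := by rw [hZ]; norm_num
  obtain ⟨z₁, hz₁⟩ := Finset.card_pos.1 hZpos
  obtain ⟨h1, horth1⟩ := step Z (subset_refl Z) z₁ hz₁
  set Z₁ := Z.filter fun x => ⟪z₁, x⟫ = 0 with hZ₁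
  have hZ₁pos : 0 < Z₁.card := by omega
  obtain ⟨z₂, hz₂⟩ := Finset.card_pos.1 hZ₁pos
  have hZ₁sub : Z₁ ⊆ Z := Finset.filter_subset _ _
  obtain ⟨h2, horth2⟩ := step Z₁ hZ₁sub z₂ hz₂
  set Z₂ := Z₁.filter fun x => ⟪z₂, x⟫ = 0 with hZ₂
  have hZ₂pos : 0 < Z₂.card := by omega
  obtain ⟨z₃, hz₃⟩ := Finset.card_pos.1 hZ₂pos
  have hZ₂sub : Z₂ ⊆ Z₁ := Finset.filter_subset _ _
  have hz₁Z := memZ.1 hz₁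
  have hz₂Z := memZ.1 (hZ₁sub hz₂)
  have hz₃Z := memZ.1 (hZ₁sub (hZ₂sub hz₃))
  exact ⟨z₁, hz₁Z.1, z₂, hz₂Z.1, z₃, hz₃Z.1, hz₁Z.2, hz₂Z.2, hz₃Z.2, horth1 z₂ hz₂,
    horth1 z₃ (hZ₂sub hz₃), horth2 z₃ hz₃⟩


/-! ### Coordinates in the frame: `C = ±frame ∪ {all (±1/2, ±1/2, ±1/2, ±1/2)}` -/

/-- In dimension `4` (an orthonormal basis indexed by `Fin 4` exists) the frame of
`d4u_exists_frame` is an orthonormal basis consisting of members of `C`.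
[cite: DeLaatLeijenhorstDeMuinckKeizer2024, proof of Theorem 5.3] -/
theorem d4u_exists_basis {C : Finset F} (hC1 : ∀ x ∈ C, ‖x‖ = 1)
    (hv : ∀ x ∈ C, ∀ y ∈ C, x ≠ y →
      (⟪x, y⟫ = -1 ∨ ⟪x, y⟫ = -1 / 2 ∨ ⟪x, y⟫ = 0 ∨ ⟪x, y⟫ = 1 / 2))
    (hmax : ∀ v : F, ‖v‖ = 1 → (∀ x ∈ C, x ≠ v → ⟪v, x⟫ ≤ 1 / 2) → v ∈ C)
    (hcard : C.card = 24) (b : OrthonormalBasis (Fin 4) ℝ F) :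
    ∃ e : OrthonormalBasis (Fin 4) ℝ F, ∀ i, e i ∈ C := by
  have hpos : 0 < C.card := by rw [hcard]; norm_num
  obtain ⟨β, hβ⟩ := Finset.card_pos.1 hpos
  obtain ⟨z₁, hz₁, z₂, hz₂, z₃, hz₃, h01, h02, h03, h12, h13, h23⟩ :=
    d4u_exists_frame hC1 hv hmax hcard b hβ
  have h00 := hC1 β hβ
  have h11 := hC1 z₁ hz₁
  have h22 := hC1 z₂ hz₂
  have h33 := hC1 z₃ hz₃
  have h10 : ⟪z₁, β⟫ = 0 := by rw [real_inner_comm β z₁]; exact h01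
  have h20 : ⟪z₂, β⟫ = 0 := by rw [real_inner_comm β z₂]; exact h02
  have h30 : ⟪z₃, β⟫ = 0 := by rw [real_inner_comm β z₃]; exact h03
  have h21 : ⟪z₂, z₁⟫ = 0 := by rw [real_inner_comm z₁ z₂]; exact h12
  have h31 : ⟪z₃, z₁⟫ = 0 := by rw [real_inner_comm z₁ z₃]; exact h13
  have h32 : ⟪z₃, z₂⟫ = 0 := by rw [real_inner_comm z₂ z₃]; exact h23
  have hon : Orthonormal ℝ ![β, z₁, z₂, z₃] := by
    rw [orthonormal_iff_ite]
    intro i j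
    fin_cases i <;> fin_cases j <;> simp [h00, h11, h22, h33, h01, h02, h03, h12, h13, h23,
      h10, h20, h30, h21, h31, h32]
  have hrank : Module.finrank ℝ F = 4 := by
    rw [Module.finrank_eq_card_basis b.toBasis, Fintype.card_fin]
  refine ⟨OrthonormalBasis.mk hon
    (by rw [hon.linearIndependent.span_eq_top_of_card_eq_finrank (by simp [hrank])]), fun i => ?_⟩
  rw [OrthonormalBasis.coe_mk]
  fin_cases i
  · exact hβ
  · exact hz₁
  · exact hz₂
  · exact hz₃

/-- **Coordinates of a member.** If an orthonormal basis `e` consists of members of a maximal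
rigid `24`-point configuration `C`, then every member of `C` is `±eᵢ` or has all four
coordinates `±1/2` ("the remaining 16 must have `±1/2` in every coordinate", de Laat–Leijenhorst–
de Muinck Keizer 2024, alternative proof of Theorem 5.3).
[cite: DeLaatLeijenhorstDeMuinckKeizer2024, proof of Theorem 5.3] -/
theorem d4u_coords {C : Finset F} (hC1 : ∀ x ∈ C, ‖x‖ = 1)
    (hv : ∀ x ∈ C, ∀ y ∈ C, x ≠ y →
      (⟪x, y⟫ = -1 ∨ ⟪x, y⟫ = -1 / 2 ∨ ⟪x, y⟫ = 0 ∨ ⟪x, y⟫ = 1 / 2))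
    (e : OrthonormalBasis (Fin 4) ℝ F) (he : ∀ i, e i ∈ C) {x : F} (hx : x ∈ C) :
    (∃ i, x = e i ∨ x = -e i) ∨
      ∃ w : Fin 4 → ℤ, (∀ i, w i = 1 ∨ w i = -1) ∧ x = ∑ i, ((w i : ℝ) / 2) • e i := by
  by_cases hfr : ∃ i, x = e i ∨ x = -e i
  · exact Or.inl hfr
  right
  have hx1 := hC1 x hx
  -- each coordinate is `-1/2, 0` or `1/2`
  have hc : ∀ i, ⟪e i, x⟫ = -1 / 2 ∨ ⟪e i, x⟫ = 0 ∨ ⟪e i, x⟫ = 1 / 2 := by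
    intro i
    have he1 : ‖e i‖ = 1 := e.orthonormal.1 i
    rcases d4u_inner_cases hC1 hv (he i) hx with h | h | h | h | h
    · exact absurd ⟨i, Or.inl (d4u_eq_of_inner_eq_one he1 hx1 h).symm⟩ hfr
    · refine absurd ⟨i, Or.inr ?_⟩ hfr
      rw [d4u_eq_neg_of_inner_eq_neg_one he1 hx1 h, neg_neg]
    all_goals tauto
  -- Parseval: the squares of the coordinates add up to `1`
  have hpars : ∑ i, ⟪e i, x⟫ ^ 2 = 1 := by
    have h := e.sum_inner_mul_inner x x
    rw [real_inner_self_eq_norm_sq, hx1, one_pow] at h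
    rw [← h]
    refine Finset.sum_congr rfl fun i _ => ?_
    rw [real_inner_comm x (e i), sq]
  have hsq : ∀ i, ⟪e i, x⟫ ^ 2 ≤ 1 / 4 := by
    intro i; rcases hc i with h | h | h <;> rw [h] <;> norm_num
  -- hence no coordinate vanishes
  have hc' : ∀ i, ⟪e i, x⟫ = 1 / 2 ∨ ⟪e i, x⟫ = -1 / 2 := by
    intro i
    rcases hc i with h | h | h
    · exact Or.inr h
    · exfalso
      have hsplit := Finset.sum_erase_add Finset.univ (fun j => ⟪e j, x⟫ ^ 2) (Finset.mem_univ i)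
      have hrest : ∑ j ∈ Finset.univ.erase i, ⟪e j, x⟫ ^ 2 ≤ (Finset.univ.erase i).card • (1 / 4 : ℝ) :=
        Finset.sum_le_card_nsmul _ _ _ fun j _ => hsq j
      rw [Finset.card_erase_of_mem (Finset.mem_univ i), Finset.card_univ, Fintype.card_fin] at hrest
      rw [hpars, h] at hsplit
      norm_num at hrest hsplit
      linarith
    · exact Or.inl h
  -- the sign vector
  have hw : ∀ i, ∃ m : ℤ, (m = 1 ∨ m = -1) ∧ ⟪e i, x⟫ = (m : ℝ) / 2 := by
    intro i
    rcases hc' i with h | h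
    · exact ⟨1, Or.inl rfl, by rw [h]; norm_num⟩
    · exact ⟨-1, Or.inr rfl, by rw [h]; norm_num⟩
  choose w hw1 hw2 using hw
  refine ⟨w, hw1, ?_⟩
  conv_lhs => rw [← e.sum_repr x]
  refine Finset.sum_congr rfl fun i _ => ?_
  rw [e.repr_apply_apply, hw2 i]

/-- Inner product of a basis vector with a coordinate combination. [folklore] -/
theorem d4u_inner_basis_sum {ι : Type*} [Fintype ι] (e : OrthonormalBasis ι ℝ F) (c : ι → ℝ)
    (k : ι) : ⟪e k, ∑ i, c i • e i⟫ = c k := by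
  classical
  rw [inner_sum]
  simp_rw [real_inner_smul_right, orthonormal_iff_ite.1 e.orthonormal, mul_ite, mul_one, mul_zero]
  rw [Finset.sum_ite_eq]
  simp

/-- **Sign flips.** If the half-vector `Σ (wᵢ/2) eᵢ` (`wᵢ = ±1`) is a member, so is the vector with
the `k`-th sign flipped: it is the reflection in the hyperplane orthogonal to `e_k`.
[cite: DeLaatLeijenhorstDeMuinckKeizer2024, proof of Theorem 5.3] -/
theorem d4u_halfvec_flip {C : Finset F} (hC1 : ∀ x ∈ C, ‖x‖ = 1)
    (hv : ∀ x ∈ C, ∀ y ∈ C, x ≠ y →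
      (⟪x, y⟫ = -1 ∨ ⟪x, y⟫ = -1 / 2 ∨ ⟪x, y⟫ = 0 ∨ ⟪x, y⟫ = 1 / 2))
    (hmax : ∀ v : F, ‖v‖ = 1 → (∀ x ∈ C, x ≠ v → ⟪v, x⟫ ≤ 1 / 2) → v ∈ C)
    (e : OrthonormalBasis (Fin 4) ℝ F) (he : ∀ i, e i ∈ C) {w : Fin 4 → ℤ}
    (hw : ∀ i, w i = 1 ∨ w i = -1) (hx : ∑ i, ((w i : ℝ) / 2) • e i ∈ C) (k : Fin 4) :
    ∑ i, ((Function.update w k (-w k) i : ℝ) / 2) • e i ∈ C := by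
  have hk : ⟪e k, ∑ i, ((w i : ℝ) / 2) • e i⟫ = (w k : ℝ) / 2 :=
    d4u_inner_basis_sum e (fun i => (w i : ℝ) / 2) k
  have hupd : ∀ i, ((Function.update w k (-w k) i : ℝ)) / 2
      = (w i : ℝ) / 2 - (if i = k then (w k : ℝ) else 0) := by
    intro i
    by_cases hik : i = k
    · subst hik; simp [Function.update_self]; ring
    · simp [hik]
  simp_rw [hupd, sub_smul, Finset.sum_sub_distrib, ite_smul, zero_smul, Finset.sum_ite_eq',
    Finset.mem_univ, if_true]
  rcases hw k with h | h
  · rw [h] at hk ⊢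
    push_cast at hk ⊢
    rw [one_smul]
    exact d4u_sub_mem hC1 hv hmax (he k) hx hk
  · rw [h] at hk ⊢
    push_cast at hk ⊢
    rw [neg_smul, one_smul, sub_neg_eq_add]
    exact d4u_add_mem hC1 hv hmax (he k) hx hk

/-- **All `16` half-vectors are members**, as soon as one of them is.
[cite: DeLaatLeijenhorstDeMuinckKeizer2024, proof of Theorem 5.3] -/
theorem d4u_halfvec_all {C : Finset F} (hC1 : ∀ x ∈ C, ‖x‖ = 1)
    (hv : ∀ x ∈ C, ∀ y ∈ C, x ≠ y →
      (⟪x, y⟫ = -1 ∨ ⟪x, y⟫ = -1 / 2 ∨ ⟪x, y⟫ = 0 ∨ ⟪x, y⟫ = 1 / 2))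
    (hmax : ∀ v : F, ‖v‖ = 1 → (∀ x ∈ C, x ≠ v → ⟪v, x⟫ ≤ 1 / 2) → v ∈ C)
    (e : OrthonormalBasis (Fin 4) ℝ F) (he : ∀ i, e i ∈ C) {w₀ : Fin 4 → ℤ}
    (hw₀ : ∀ i, w₀ i = 1 ∨ w₀ i = -1) (hx₀ : ∑ i, ((w₀ i : ℝ) / 2) • e i ∈ C)
    {w : Fin 4 → ℤ} (hw : ∀ i, w i = 1 ∨ w i = -1) :
    ∑ i, ((w i : ℝ) / 2) • e i ∈ C := by
  -- one update step
  have step : ∀ (u : Fin 4 → ℤ) (k : Fin 4) (v : ℤ), (∀ i, u i = 1 ∨ u i = -1) →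
      (v = 1 ∨ v = -1) → ∑ i, ((u i : ℝ) / 2) • e i ∈ C →
      (∀ i, Function.update u k v i = 1 ∨ Function.update u k v i = -1) ∧
        ∑ i, ((Function.update u k v i : ℝ) / 2) • e i ∈ C := by
    intro u k v hu hv' hmem
    refine ⟨fun i => ?_, ?_⟩
    · by_cases hik : i = k
      · subst hik; rw [Function.update_self]; exact hv'
      · rw [Function.update_of_ne hik]; exact hu i
    · by_cases hvk : v = u k
      · rw [hvk, Function.update_eq_self]; exact hmem
      · have hvk' : v = -u k := by rcases hu k with h | h <;> rcases hv' with h' | h' <;> omega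
        rw [hvk']
        exact d4u_halfvec_flip hC1 hv hmax e he hu hmem k
  obtain ⟨hu₁, hm₁⟩ := step w₀ 0 (w 0) hw₀ (hw 0) hx₀
  obtain ⟨hu₂, hm₂⟩ := step _ 1 (w 1) hu₁ (hw 1) hm₁
  obtain ⟨hu₃, hm₃⟩ := step _ 2 (w 2) hu₂ (hw 2) hm₂
  obtain ⟨-, hm₄⟩ := step _ 3 (w 3) hu₃ (hw 3) hm₃
  convert hm₄ using 4 with i
  fin_cases i <;> simp

/-- **Some half-vector is a member**: `C` has `24 > 8` members.
[cite: DeLaatLeijenhorstDeMuinckKeizer2024, proof of Theorem 5.3] -/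
theorem d4u_exists_halfvec {C : Finset F} (hC1 : ∀ x ∈ C, ‖x‖ = 1)
    (hv : ∀ x ∈ C, ∀ y ∈ C, x ≠ y →
      (⟪x, y⟫ = -1 ∨ ⟪x, y⟫ = -1 / 2 ∨ ⟪x, y⟫ = 0 ∨ ⟪x, y⟫ = 1 / 2))
    (hcard : C.card = 24) (e : OrthonormalBasis (Fin 4) ℝ F) (he : ∀ i, e i ∈ C) :
    ∃ w : Fin 4 → ℤ, (∀ i, w i = 1 ∨ w i = -1) ∧ ∑ i, ((w i : ℝ) / 2) • e i ∈ C := by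
  classical
  -- a member outside `±frame`
  have hT : ((Finset.univ.image fun i => e i) ∪ (Finset.univ.image fun i => -e i)).card < C.card := by
    rw [hcard]
    calc ((Finset.univ.image fun i => e i) ∪ (Finset.univ.image fun i => -e i)).card
        ≤ (Finset.univ.image fun i => e i).card + (Finset.univ.image fun i => -e i).card :=
          Finset.card_union_le _ _
      _ ≤ 4 + 4 := Nat.add_le_add (Finset.card_image_le.trans (by simp))
          (Finset.card_image_le.trans (by simp))
      _ < 24 := by norm_num
  obtain ⟨x, hx, hxT⟩ := Finset.exists_mem_notMem_of_card_lt_card hT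
  rcases d4u_coords hC1 hv e he hx with ⟨i, h | h⟩ | ⟨w, hw, h⟩
  · exfalso; refine hxT (Finset.mem_union_left _ ?_)
    exact Finset.mem_image.2 ⟨i, Finset.mem_univ _, h.symm⟩
  · exfalso; refine hxT (Finset.mem_union_right _ ?_)
    exact Finset.mem_image.2 ⟨i, Finset.mem_univ _, h.symm⟩
  · exact ⟨w, hw, h ▸ hx⟩


/-! ### Integer bookkeeping: `Σ wᵢ² = 4` -/

/-- The integer solutions of `w₀² + w₁² + w₂² + w₃² = 4`: all `wᵢ = ±1`, or one `wᵢ = ±2` and the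
others `0`. [folklore] -/
theorem d4u_int_sq_four (w : Fin 4 → ℤ) (h : w 0 ^ 2 + w 1 ^ 2 + w 2 ^ 2 + w 3 ^ 2 = 4) :
    (∀ k, w k = 1 ∨ w k = -1) ∨
      ∃ k, (w k = 2 ∨ w k = -2) ∧ ∀ j, j ≠ k → w j = 0 := by
  have hsum : ∑ k, w k ^ 2 = 4 := by rw [Fin.sum_univ_four]; exact h
  have hb : ∀ k, -2 ≤ w k ∧ w k ≤ 2 := by
    intro k
    have hk : w k ^ 2 ≤ 4 := by
      rw [← hsum]
      exact Finset.single_le_sum (f := fun k => w k ^ 2) (fun k _ => sq_nonneg (w k))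
        (Finset.mem_univ k)
    constructor
    · nlinarith [hk, sq_nonneg (w k + 2)]
    · nlinarith [hk, sq_nonneg (w k - 2)]
  have hcase : ∀ k, (w k = 0 ∧ w k ^ 2 = 0) ∨ ((w k = 1 ∨ w k = -1) ∧ w k ^ 2 = 1)
      ∨ ((w k = 2 ∨ w k = -2) ∧ w k ^ 2 = 4) := by
    intro k
    obtain ⟨h1, h2⟩ := hb k
    interval_cases hwk : w k <;> simp
  rcases hcase 0 with ⟨e0, a0⟩ | ⟨e0, a0⟩ | ⟨e0, a0⟩ <;>
    rcases hcase 1 with ⟨e1, a1⟩ | ⟨e1, a1⟩ | ⟨e1, a1⟩ <;>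
    rcases hcase 2 with ⟨e2, a2⟩ | ⟨e2, a2⟩ | ⟨e2, a2⟩ <;>
    rcases hcase 3 with ⟨e3, a3⟩ | ⟨e3, a3⟩ | ⟨e3, a3⟩ <;>
    rw [a0, a1, a2, a3] at h <;> norm_num at h <;>
    first
      | (left; intro k; fin_cases k <;> assumption)
      | (right; exact ⟨0, e0, fun j hj => by fin_cases j <;> first | exact absurd rfl hj | assumption⟩)
      | (right; exact ⟨1, e1, fun j hj => by fin_cases j <;> first | exact absurd rfl hj | assumption⟩)
      | (right; exact ⟨2, e2, fun j hj => by fin_cases j <;> first | exact absurd rfl hj | assumption⟩)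
      | (right; exact ⟨3, e3, fun j hj => by fin_cases j <;> first | exact absurd rfl hj | assumption⟩)

/-- **Every vector `Σ (wᵢ/2) eᵢ` with `w ∈ ℤ⁴`, `Σ wᵢ² = 4`, is a member** (these are `±eᵢ` and the
`16` half-vectors). [cite: DeLaatLeijenhorstDeMuinckKeizer2024, proof of Theorem 5.3] -/
theorem d4u_mem_of_int {C : Finset F} (hC1 : ∀ x ∈ C, ‖x‖ = 1)
    (hv : ∀ x ∈ C, ∀ y ∈ C, x ≠ y →
      (⟪x, y⟫ = -1 ∨ ⟪x, y⟫ = -1 / 2 ∨ ⟪x, y⟫ = 0 ∨ ⟪x, y⟫ = 1 / 2))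
    (hmax : ∀ v : F, ‖v‖ = 1 → (∀ x ∈ C, x ≠ v → ⟪v, x⟫ ≤ 1 / 2) → v ∈ C)
    (hcard : C.card = 24) (e : OrthonormalBasis (Fin 4) ℝ F) (he : ∀ i, e i ∈ C)
    (w : Fin 4 → ℤ) (hw : w 0 ^ 2 + w 1 ^ 2 + w 2 ^ 2 + w 3 ^ 2 = 4) :
    ∑ i, ((w i : ℝ) / 2) • e i ∈ C := by
  rcases d4u_int_sq_four w hw with hall | ⟨k, hk, hk0⟩
  · obtain ⟨w₀, hw₀, hx₀⟩ := d4u_exists_halfvec hC1 hv hcard e he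
    exact d4u_halfvec_all hC1 hv hmax e he hw₀ hx₀ hall
  · have hsum : ∑ i, ((w i : ℝ) / 2) • e i = ((w k : ℝ) / 2) • e k := by
      refine Finset.sum_eq_single k (fun j _ hj => ?_) (fun h => absurd (Finset.mem_univ k) h)
      rw [hk0 j hj]; simp
    rw [hsum]
    rcases hk with h | h <;> rw [h] <;> push_cast
    · norm_num; exact he k
    · norm_num; exact d4u_neg_mem hC1 hv hmax (he k)

/-- **Every member in integer coordinates**: each member is `Σ (wᵢ/2) eᵢ` with `w ∈ ℤ⁴` of the form
`M z = (z₀+z₁, z₀-z₁, z₂+z₃, z₂-z₃)` for some `z ∈ ℤ⁴` with `Σ zᵢ² = 2` (a `D₄` root).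
[cite: DeLaatLeijenhorstDeMuinckKeizer2024, proof of Theorem 5.3] -/
theorem d4u_mem_coords_int {C : Finset F} (hC1 : ∀ x ∈ C, ‖x‖ = 1)
    (hv : ∀ x ∈ C, ∀ y ∈ C, x ≠ y →
      (⟪x, y⟫ = -1 ∨ ⟪x, y⟫ = -1 / 2 ∨ ⟪x, y⟫ = 0 ∨ ⟪x, y⟫ = 1 / 2))
    (e : OrthonormalBasis (Fin 4) ℝ F) (he : ∀ i, e i ∈ C) {y : F} (hy : y ∈ C) :
    ∃ w z : Fin 4 → ℤ, (2 * z 0 = w 0 + w 1 ∧ 2 * z 1 = w 0 - w 1 ∧ 2 * z 2 = w 2 + w 3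
      ∧ 2 * z 3 = w 2 - w 3) ∧ (∑ k, z k ^ 2 = 2) ∧ y = ∑ i, ((w i : ℝ) / 2) • e i := by
  rcases d4u_coords hC1 hv e he hy with ⟨i, h | h⟩ | ⟨w, hw, h⟩
  · -- `y = e i`
    refine ⟨fun j => if j = i then 2 else 0, ?_⟩
    fin_cases i
    · refine ⟨![1, 1, 0, 0], ?_, ?_, ?_⟩ <;> simp [Fin.sum_univ_four, h]
    · refine ⟨![1, -1, 0, 0], ?_, ?_, ?_⟩ <;> simp [Fin.sum_univ_four, h]
    · refine ⟨![0, 0, 1, 1], ?_, ?_, ?_⟩ <;> simp [Fin.sum_univ_four, h]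
    · refine ⟨![0, 0, 1, -1], ?_, ?_, ?_⟩ <;> simp [Fin.sum_univ_four, h]
  · -- `y = -e i`
    refine ⟨fun j => if j = i then 2 * (-1) else 0, ?_⟩
    fin_cases i
    · refine ⟨![-1, -1, 0, 0], ?_, ?_, ?_⟩ <;> simp [Fin.sum_univ_four, h]
    · refine ⟨![-1, 1, 0, 0], ?_, ?_, ?_⟩ <;> simp [Fin.sum_univ_four, h]
    · refine ⟨![0, 0, -1, -1], ?_, ?_, ?_⟩ <;> simp [Fin.sum_univ_four, h]
    · refine ⟨![0, 0, -1, 1], ?_, ?_, ?_⟩ <;> simp [Fin.sum_univ_four, h]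
  · -- a half-vector
    obtain ⟨z0, hz0⟩ : ∃ z0 : ℤ, 2 * z0 = w 0 + w 1 :=
      ⟨(w 0 + w 1) / 2, by rcases hw 0 with h0 | h0 <;> rcases hw 1 with h1 | h1 <;> omega⟩
    obtain ⟨z1, hz1⟩ : ∃ z1 : ℤ, 2 * z1 = w 0 - w 1 :=
      ⟨(w 0 - w 1) / 2, by rcases hw 0 with h0 | h0 <;> rcases hw 1 with h1 | h1 <;> omega⟩
    obtain ⟨z2, hz2⟩ : ∃ z2 : ℤ, 2 * z2 = w 2 + w 3 :=
      ⟨(w 2 + w 3) / 2, by rcases hw 2 with h2 | h2 <;> rcases hw 3 with h3 | h3 <;> omega⟩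
    obtain ⟨z3, hz3⟩ : ∃ z3 : ℤ, 2 * z3 = w 2 - w 3 :=
      ⟨(w 2 - w 3) / 2, by rcases hw 2 with h2 | h2 <;> rcases hw 3 with h3 | h3 <;> omega⟩
    have hsq : ∀ i, w i ^ 2 = 1 := fun i => by rcases hw i with h | h <;> rw [h] <;> norm_num
    refine ⟨w, ![z0, z1, z2, z3], ⟨hz0, hz1, hz2, hz3⟩, ?_, h⟩
    simp only [Fin.sum_univ_four, Matrix.cons_val_zero, Matrix.cons_val_one, Matrix.head_cons,
      Matrix.cons_val_two, Matrix.tail_cons, Matrix.cons_val_three]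
    nlinarith [hsq 0, hsq 1, hsq 2, hsq 3, congrArg (· ^ 2) hz0, congrArg (· ^ 2) hz1,
      congrArg (· ^ 2) hz2, congrArg (· ^ 2) hz3]


/-! ### Assembly in `ℝ⁴`: Theorem 5.3 from Lemma 5.1 and `k(4) = 24` -/

section Assembly

/-- **Maximality from `k(4) = 24`.** If `C ⊆ 𝕊³` is a `24`-point kissing configuration, every unit
vector at angle `≥ π/3` from all members of `C` belongs to `C` ("`β'` must be in `C` by optimality
of `C`", de Laat–Leijenhorst–de Muinck Keizer 2024, proof of Theorem 5.3; optimality is Musin's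
`k(4) = 24`). [cite: DeLaatLeijenhorstDeMuinckKeizer2024, proof of Theorem 5.3] -/
theorem d4u_maximal_of_musin (h24 : musin2008_kissing_four) {C : Finset (EuclideanSpace ℝ (Fin 4))}
    (hcard : C.card = 24)
    (hC1 : ∀ x ∈ C, ‖x‖ = 1) (hle : ∀ x ∈ C, ∀ y ∈ C, x ≠ y → ⟪x, y⟫ ≤ 1 / 2) :
    ∀ v : EuclideanSpace ℝ (Fin 4), ‖v‖ = 1 → (∀ x ∈ C, x ≠ v → ⟪v, x⟫ ≤ 1 / 2) → v ∈ C := by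
  classical
  intro v hv1 hvle
  by_contra hvC
  have h := h24 (insert v C) ?_ ?_
  · rw [Finset.card_insert_of_notMem hvC, hcard] at h
    norm_num at h
  · intro x hx
    rcases Finset.mem_insert.1 hx with hxv | hx'
    · rw [hxv]; exact hv1
    · exact hC1 x hx'
  · intro x hx y hy hxy
    rcases Finset.mem_insert.1 hx with hxv | hx' <;> rcases Finset.mem_insert.1 hy with hyv | hy'
    · exact absurd (hxv.trans hyv.symm) hxy
    · rw [hxv]; exact hvle y hy' fun h => hxy (by rw [hxv, h])
    · rw [hyv, real_inner_comm v x]; exact hvle x hx' fun h => hxy (by rw [h, hyv])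
    · exact hle x hx' y hy' hxy

/-- **de Laat–Leijenhorst–de Muinck Keizer 2024, Theorem 5.3, from Lemma 5.1 and `k(4) = 24`: the
classification step, PROVED.** If every `24`-point kissing configuration in `ℝ⁴` has all inner
products of distinct members in `{-1, -1/2, 0, 1/2}` (Lemma 5.1 of the source, an exact
second-level Lasserre SDP certificate — taken here as the hypothesis `h51`) and `k(4) = 24`
(Musin 2008, the hypothesis `h24 : musin2008_kissing_four`), then every `24`-point kissing
configuration of `ℝ⁴` is an isometric image of the normalised `D₄` root shell `d4Roots`, i.e.
`dlldmk2024_kissing_four_unique` holds. The source concludes via "`C` is a root system" and the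
classification of simply-laced root systems (or, alternatively, Calderbank et al.); the proof here
is an elementary replacement: reflection-closure (`d4u_sub_mem`), the class sizes `8, 8, 6` forced
by the frame-potential inequality (`d4u_card_classes_eq`), an orthonormal frame of members
(`d4u_exists_frame`), all coordinates `±1/2` off the frame (`d4u_coords`), and the change of basis
`e₀ = (c₀+c₁)/√2, e₁ = (c₀-c₁)/√2, e₂ = (c₂+c₃)/√2, e₃ = (c₂-c₃)/√2` carrying
`{±eᵢ} ∪ {(±1/2)⁴}` onto `{(±cᵢ ± cⱼ)/√2} = c(d4Roots)`.
[cite: DeLaatLeijenhorstDeMuinckKeizer2024, Theorem 5.3 (proof), Lemma 5.1] -/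
theorem dlldmk2024_kissing_four_unique_of_rigidity (h24 : musin2008_kissing_four)
    (h51 : ∀ C : Finset (EuclideanSpace ℝ (Fin 4)), C.card = 24 → (∀ x ∈ C, ‖x‖ = 1) →
      (∀ x ∈ C, ∀ y ∈ C, x ≠ y → ⟪x, y⟫ ≤ 1 / 2) →
      ∀ x ∈ C, ∀ y ∈ C, x ≠ y →
        (⟪x, y⟫ = -1 ∨ ⟪x, y⟫ = -1 / 2 ∨ ⟪x, y⟫ = 0 ∨ ⟪x, y⟫ = 1 / 2)) :
    dlldmk2024_kissing_four_unique := by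
  classical
  intro C hcard hC1 hle
  have hv := h51 C hcard hC1 hle
  have hmax := d4u_maximal_of_musin h24 hcard hC1 hle
  obtain ⟨e, he⟩ := d4u_exists_basis hC1 hv hmax hcard (EuclideanSpace.basisFun (Fin 4) ℝ)
  -- the rotated orthonormal basis `c`: `e₀ = (c₀ + c₁)/√2`, `e₁ = (c₀ - c₁)/√2`, …
  set s : ℝ := (Real.sqrt 2)⁻¹ with hs
  have hs2 : s * s = 1 / 2 := by
    rw [hs, ← mul_inv, Real.mul_self_sqrt (by norm_num : (0 : ℝ) ≤ 2)]; norm_num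
  have hee := orthonormal_iff_ite.1 e.orthonormal
  set c : Fin 4 → EuclideanSpace ℝ (Fin 4) :=
    ![s • (e 0 + e 1), s • (e 0 - e 1), s • (e 2 + e 3), s • (e 2 - e 3)] with hc
  have hcon : Orthonormal ℝ c := by
    rw [orthonormal_iff_ite]
    intro i j
    fin_cases i <;> fin_cases j <;>
      simp [hc, inner_add_left, inner_add_right, inner_sub_left, inner_sub_right,
        real_inner_smul_left, real_inner_smul_right, hee, -inner_self_eq_norm_sq_to_K] <;> nlinarith [hs2]
  let cb : OrthonormalBasis (Fin 4) ℝ (EuclideanSpace ℝ (Fin 4)) := OrthonormalBasis.mk hcon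
    (by rw [hcon.linearIndependent.span_eq_top_of_card_eq_finrank (by simp)])
  have hcb : ∀ k, cb k = c k := fun k => by rw [OrthonormalBasis.coe_mk]
  -- the change of coordinates
  have hV : ∀ a : Fin 4 → ℝ, ∑ k, (a k * s) • c k = (((a 0 + a 1) / 2) • e 0
      + ((a 0 - a 1) / 2) • e 1 + ((a 2 + a 3) / 2) • e 2 + ((a 2 - a 3) / 2) • e 3 :
        EuclideanSpace ℝ (Fin 4)) := by
    intro a
    simp only [Fin.sum_univ_four, hc, Matrix.cons_val_zero, Matrix.cons_val_one, Matrix.head_cons,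
      Matrix.cons_val_two, Matrix.tail_cons, Matrix.cons_val_three, smul_smul, mul_assoc, hs2]
    module
  refine ⟨cb.repr.symm, Set.ext fun y => ⟨fun hy => ?_, fun hy => ?_⟩⟩
  · -- a member is the image of a root
    obtain ⟨w, z, ⟨h0, h1, h2, h3⟩, hz, hyw⟩ :=
      d4u_mem_coords_int hC1 hv e he (Finset.mem_coe.1 hy)
    refine ⟨cb.repr y, (mem_d4Roots_iff _).2 ⟨z, hz, fun k => ?_⟩, cb.repr.symm_apply_apply y⟩
    have hcoord : ∀ i, ⟪e i, y⟫ = (w i : ℝ) / 2 := fun i => by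
      rw [hyw]; exact d4u_inner_basis_sum e _ i
    have h0' : (w 0 : ℝ) + w 1 = 2 * z 0 := by exact_mod_cast h0.symm
    have h1' : (w 0 : ℝ) - w 1 = 2 * z 1 := by exact_mod_cast h1.symm
    have h2' : (w 2 : ℝ) + w 3 = 2 * z 2 := by exact_mod_cast h2.symm
    have h3' : (w 2 : ℝ) - w 3 = 2 * z 3 := by exact_mod_cast h3.symm
    rw [cb.repr_apply_apply, hcb, div_eq_mul_inv, ← hs]
    fin_cases k
    · simp [hc, inner_add_left, real_inner_smul_left, hcoord]
      linear_combination (s / 2) * h0'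
    · simp [hc, inner_sub_left, real_inner_smul_left, hcoord]
      linear_combination (s / 2) * h1'
    · simp [hc, inner_add_left, real_inner_smul_left, hcoord]
      linear_combination (s / 2) * h2'
    · simp [hc, inner_sub_left, real_inner_smul_left, hcoord]
      linear_combination (s / 2) * h3'
  · -- the image of a root is a member
    obtain ⟨x, hx, rfl⟩ := hy
    obtain ⟨z, hz, hxz⟩ := (mem_d4Roots_iff x).1 hx
    rw [Finset.mem_coe, ← cb.sum_repr_symm x,
      Finset.sum_congr rfl fun k _ => show x k • cb k = ((z k : ℝ) * s) • c k by
        rw [hxz k, hcb, div_eq_mul_inv],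
      hV fun k => (z k : ℝ)]
    have hMz : (![z 0 + z 1, z 0 - z 1, z 2 + z 3, z 2 - z 3] : Fin 4 → ℤ) 0 ^ 2
        + (![z 0 + z 1, z 0 - z 1, z 2 + z 3, z 2 - z 3] : Fin 4 → ℤ) 1 ^ 2
        + (![z 0 + z 1, z 0 - z 1, z 2 + z 3, z 2 - z 3] : Fin 4 → ℤ) 2 ^ 2
        + (![z 0 + z 1, z 0 - z 1, z 2 + z 3, z 2 - z 3] : Fin 4 → ℤ) 3 ^ 2 = 4 := by
      rw [Fin.sum_univ_four] at hz
      simp only [Matrix.cons_val_zero, Matrix.cons_val_one, Matrix.head_cons, Matrix.cons_val_two,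
        Matrix.tail_cons, Matrix.cons_val_three]
      linear_combination 2 * hz
    have hmem := d4u_mem_of_int hC1 hv hmax hcard e he _ hMz
    convert hmem using 1
    simp only [Fin.sum_univ_four, Matrix.cons_val_zero, Matrix.cons_val_one, Matrix.head_cons,
      Matrix.cons_val_two, Matrix.tail_cons, Matrix.cons_val_three]
    push_cast
    module


/-- **Lemma 5.1 back from Theorem 5.3.** Conversely, the uniqueness fact implies the rigidity
statement of Lemma 5.1: distinct normalised `D₄` roots `z/√2, z'/√2` have inner product
`(Σ zₖ z'ₖ)/2 ∈ {-1, -1/2, 0, 1/2}` ("the possible inner products between distinct roots are `0`,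
`±1/2`, and `-1`", §1 of the source), and linear isometries preserve inner products. Hence, given
`k(4) = 24`, the hypothesis `h51` of `dlldmk2024_kissing_four_unique_of_rigidity` is equivalent to
the fact `dlldmk2024_kissing_four_unique`.
[cite: DeLaatLeijenhorstDeMuinckKeizer2024, §1 and Lemma 5.1] -/
theorem dlldmk2024_rigidity_of_kissing_four_unique (h : dlldmk2024_kissing_four_unique)
    (C : Finset (EuclideanSpace ℝ (Fin 4))) (hcard : C.card = 24) (hC1 : ∀ x ∈ C, ‖x‖ = 1)
    (hle : ∀ x ∈ C, ∀ y ∈ C, x ≠ y → ⟪x, y⟫ ≤ 1 / 2) :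
    ∀ x ∈ C, ∀ y ∈ C, x ≠ y →
      (⟪x, y⟫ = -1 ∨ ⟪x, y⟫ = -1 / 2 ∨ ⟪x, y⟫ = 0 ∨ ⟪x, y⟫ = 1 / 2) := by
  obtain ⟨f, hf⟩ := h C hcard hC1 hle
  intro x hx y hy hxy
  have hx' : x ∈ f '' d4Roots := by rw [← hf]; exact hx
  have hy' : y ∈ f '' d4Roots := by rw [← hf]; exact hy
  obtain ⟨a, ha, rfl⟩ := hx'
  obtain ⟨b, hb, rfl⟩ := hy'
  rw [LinearIsometryEquiv.inner_map_map]
  have ha1 : ‖a‖ = 1 := norm_eq_one_of_mem_d4Roots ha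
  have hb1 : ‖b‖ = 1 := norm_eq_one_of_mem_d4Roots hb
  obtain ⟨z, -, haz⟩ := ha
  obtain ⟨z', -, hbz⟩ := hb
  -- `⟪a, b⟫ = (Σ zₖ z'ₖ) / 2`
  have hab : ⟪a, b⟫ = ((∑ k, z k * z' k : ℤ) : ℝ) / 2 := by
    have hsum : ⟪a, b⟫ = ∑ k, a k * b k := by simp [PiLp.inner_apply, mul_comm]
    rw [hsum]
    push_cast
    rw [Finset.sum_div]
    refine Finset.sum_congr rfl fun k _ => ?_
    rw [haz k, hbz k, div_mul_div_comm, Real.mul_self_sqrt (by norm_num : (0 : ℝ) ≤ 2)]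
  have hle1 : ⟪a, b⟫ ≤ 1 := real_inner_le_one_of_norm_eq_one ha1 hb1
  have hge1 : -1 ≤ ⟪a, b⟫ := neg_one_le_real_inner_of_norm_eq_one ha1 hb1
  have hne1 : ⟪a, b⟫ ≠ 1 := fun h1 =>
    hxy (congrArg f ((inner_eq_one_iff_of_norm_eq_one ha1 hb1).1 h1))
  rw [hab] at hle1 hge1 hne1 ⊢
  set m : ℤ := ∑ k, z k * z' k with hm
  have hm2 : m ≤ 2 := by
    have : (m : ℝ) ≤ 2 := by linarith
    exact_mod_cast this
  have hm2' : -2 ≤ m := by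
    have : (-2 : ℝ) ≤ m := by linarith
    exact_mod_cast this
  have hmne : m ≠ 2 := by
    intro h2; apply hne1; rw [h2]; norm_num
  have hm4 : m = -2 ∨ m = -1 ∨ m = 0 ∨ m = 1 := by omega
  rcases hm4 with h' | h' | h' | h' <;> rw [h'] <;> norm_num

end Assembly

/-! ### Lemma 5.1 alone implies `k(4) = 24`: the fact is equivalent to Lemma 5.1 -/

section RigidityAlone

/-- **Weighted frame-potential bound** (folklore): for vectors `v a` with real weights `w a`,
`(Σ_a w_a ‖v_a‖²)² ≤ card ι · Σ_{a,a'} w_a w_{a'} ⟪v_a, v_{a'}⟫²` — the inequality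
`(tr S)² ≤ d · tr S²` for the symmetric matrix `S = Σ_a w_a v_a v_aᵀ`. [folklore] -/
theorem d4u_frame_potential_weighted {ι : Type*} [Fintype ι] (b : OrthonormalBasis ι ℝ F)
    {α : Type*} (s : Finset α) (v : α → F) (w : α → ℝ) :
    (∑ a ∈ s, w a * ‖v a‖ ^ 2) ^ 2
      ≤ Fintype.card ι * ∑ a ∈ s, ∑ a' ∈ s, w a * w a' * ⟪v a, v a'⟫ ^ 2 := by
  obtain ⟨S, hS⟩ : ∃ S : ι → ι → ℝ, ∀ i j, S i j = ∑ a ∈ s, w a * (⟪v a, b i⟫ * ⟪v a, b j⟫) :=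
    ⟨_, fun _ _ => rfl⟩
  -- trace of `S`
  have htr : ∑ i, S i i = ∑ a ∈ s, w a * ‖v a‖ ^ 2 := by
    simp only [hS]
    rw [Finset.sum_comm]
    refine Finset.sum_congr rfl fun a _ => ?_
    rw [← Finset.mul_sum, ← real_inner_self_eq_norm_sq, ← b.sum_inner_mul_inner (v a) (v a)]
    congr 1
    refine Finset.sum_congr rfl fun i _ => ?_
    rw [real_inner_comm (v a) (b i)]
  -- the sum of squares of the entries of `S`
  have hSS : ∑ i, ∑ j, S i j ^ 2 = ∑ a ∈ s, ∑ a' ∈ s, w a * w a' * ⟪v a, v a'⟫ ^ 2 := by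
    have hL : ∑ i, ∑ j, S i j ^ 2 = ∑ i, ∑ j, ∑ a ∈ s, ∑ a' ∈ s,
        w a * (⟪v a, b i⟫ * ⟪v a, b j⟫) * (w a' * (⟪v a', b i⟫ * ⟪v a', b j⟫)) := by
      refine Finset.sum_congr rfl fun i _ => Finset.sum_congr rfl fun j _ => ?_
      rw [sq, hS, Finset.sum_mul_sum]
    have hR : ∑ a ∈ s, ∑ a' ∈ s, w a * w a' * ⟪v a, v a'⟫ ^ 2 = ∑ a ∈ s, ∑ a' ∈ s, ∑ i, ∑ j,
        w a * (⟪v a, b i⟫ * ⟪v a, b j⟫) * (w a' * (⟪v a', b i⟫ * ⟪v a', b j⟫)) := by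
      refine Finset.sum_congr rfl fun a _ => Finset.sum_congr rfl fun a' _ => ?_
      rw [← b.sum_inner_mul_inner (v a) (v a'), sq, Finset.sum_mul_sum, Finset.mul_sum]
      refine Finset.sum_congr rfl fun i _ => ?_
      rw [Finset.mul_sum]
      refine Finset.sum_congr rfl fun j _ => ?_
      rw [real_inner_comm (v a') (b i), real_inner_comm (v a') (b j)]
      ring
    rw [hL, hR, d4u_sum4_comm]
  -- diagonal part and Cauchy–Schwarz
  have hdiag : ∑ i, S i i ^ 2 ≤ ∑ i, ∑ j, S i j ^ 2 :=
    Finset.sum_le_sum fun i _ =>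
      Finset.single_le_sum (f := fun j => S i j ^ 2) (fun j _ => sq_nonneg _) (Finset.mem_univ i)
  have hcs : (∑ i, S i i) ^ 2 ≤ Fintype.card ι * ∑ i, S i i ^ 2 := by
    have h := Finset.sum_mul_sq_le_sq_mul_sq Finset.univ (fun i => S i i) (fun _ => (1 : ℝ))
    simp only [mul_one, one_pow, Finset.sum_const, nsmul_eq_mul, Finset.card_univ] at h
    linarith [h]
  have hd : (0 : ℝ) ≤ Fintype.card ι := Nat.cast_nonneg _
  calc (∑ a ∈ s, w a * ‖v a‖ ^ 2) ^ 2 = (∑ i, S i i) ^ 2 := by rw [htr]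
    _ ≤ Fintype.card ι * ∑ i, S i i ^ 2 := hcs
    _ ≤ Fintype.card ι * ∑ i, ∑ j, S i j ^ 2 := mul_le_mul_of_nonneg_left hdiag hd
    _ = Fintype.card ι * ∑ a ∈ s, ∑ a' ∈ s, w a * w a' * ⟪v a, v a'⟫ ^ 2 := by rw [hSS]

/-- **At most `8` unit vectors at inner product `1/2` from a unit vector `x`, in dimension `4`,
when their pairwise inner products lie in `{-1, -1/2, 0, 1/2}`.** (The vectors `y - x/2` lie in
`x^⊥ ≅ ℝ³`, have norm `√3/2` and pairwise inner products `⟪y, y'⟫ - 1/4 ∈ {-3/4, ± 1/4}`; the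
weighted frame-potential bound with weight `p/4` on `x` gives `p² ≤ 4 (p²/8 + p)`, i.e. `p ≤ 8` —
the bound "at most `4` lines of `ℝ³` pairwise at angle `arccos (1/3)`".) An elementary replacement,
without any maximality hypothesis, for the counting step of the source. [folklore] -/
theorem d4u_card_half_le_eight (b : OrthonormalBasis (Fin 4) ℝ F) {x : F} (hx : ‖x‖ = 1)
    {P : Finset F} (hP1 : ∀ y ∈ P, ‖y‖ = 1) (hPx : ∀ y ∈ P, ⟪x, y⟫ = 1 / 2)
    (hv : ∀ y ∈ P, ∀ y' ∈ P, y ≠ y' →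
      (⟪y, y'⟫ = -1 ∨ ⟪y, y'⟫ = -1 / 2 ∨ ⟪y, y'⟫ = 0 ∨ ⟪y, y'⟫ = 1 / 2)) :
    P.card ≤ 8 := by
  classical
  set p : ℝ := (P.card : ℝ) with hp
  have hp0 : 0 ≤ p := Nat.cast_nonneg _
  have hxx : ⟪x, x⟫ = 1 := by rw [real_inner_self_eq_norm_sq, hx, one_pow]
  -- the family: `x` with weight `p/4`, and `y - x/2` (`y ∈ P`) with weight `1`
  have key := d4u_frame_potential_weighted b (Finset.insertNone P)
    (fun o => o.elim x fun y => y - (1 / 2 : ℝ) • x) (fun o => o.elim (p / 4) fun _ => 1)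
  rw [Finset.sum_insertNone, Finset.sum_insertNone, Finset.sum_insertNone] at key
  simp only [Option.elim, Finset.sum_insertNone, Fintype.card_fin] at key
  -- norms and inner products of the family
  have hu : ∀ y ∈ P, ‖y - (1 / 2 : ℝ) • x‖ ^ 2 = 3 / 4 := by
    intro y hy
    rw [norm_sub_sq_real, norm_smul, real_inner_smul_right, real_inner_comm x y, hPx y hy,
      hP1 y hy, hx, Real.norm_eq_abs, abs_of_pos (by norm_num : (0 : ℝ) < 1 / 2)]
    norm_num
  have hxu : ∀ y ∈ P, ⟪x, y - (1 / 2 : ℝ) • x⟫ = 0 := by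
    intro y hy
    rw [inner_sub_right, real_inner_smul_right, hPx y hy, hxx]; norm_num
  have hux : ∀ y ∈ P, ⟪y - (1 / 2 : ℝ) • x, x⟫ = 0 := by
    intro y hy
    rw [real_inner_comm, hxu y hy]
  have huu : ∀ y ∈ P, ∀ y' ∈ P,
      ⟪y - (1 / 2 : ℝ) • x, y' - (1 / 2 : ℝ) • x⟫ = ⟪y, y'⟫ - 1 / 4 := by
    intro y hy y' hy'
    rw [inner_sub_left, inner_sub_right, inner_sub_right, real_inner_smul_left,
      real_inner_smul_right, real_inner_smul_left, real_inner_smul_right, hPx y' hy',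
      real_inner_comm x y, hPx y hy, hxx]
    norm_num
  -- the trace side equals `p`
  have htr : p / 4 * ‖x‖ ^ 2 + ∑ y ∈ P, 1 * ‖y - (1 / 2 : ℝ) • x‖ ^ 2 = p := by
    rw [hx, Finset.sum_congr rfl fun y hy => by rw [hu y hy], Finset.sum_const, nsmul_eq_mul,
      ← hp]
    ring
  -- pointwise bound on the Gram entries of the `y - x/2`
  have hpt : ∀ y ∈ P, ∀ y' ∈ P, (⟪y, y'⟫ - 1 / 4) ^ 2 ≤
      1 / 16 + (if y = y' then 1 / 2 else 0) + (if x - y = y' then 1 / 2 else 0) := by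
    intro y hy y' hy'
    have hy1 := hP1 y hy
    have hy'1 := hP1 y' hy'
    by_cases hyy : y = y'
    · subst hyy
      rw [real_inner_self_eq_norm_sq, hy1]
      simp only [if_true]
      split_ifs <;> norm_num
    rw [if_neg hyy]
    rcases hv y hy y' hy' hyy with h | h | h | h
    · -- `y' = -y` is impossible in the class
      exfalso
      have h' := d4u_eq_neg_of_inner_eq_neg_one hy1 hy'1 h
      have := hPx y hy
      rw [h', inner_neg_right, hPx y' hy'] at this
      norm_num at this
    · -- `⟪y, y'⟫ = -1/2` forces `y' = x - y`
      have hd : ‖y' - (x - y)‖ ^ 2 = 0 := by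
        rw [norm_sub_sq_real, norm_sub_sq_real, inner_sub_right, real_inner_comm x y',
          hPx y' hy', real_inner_comm y y', h, hx, hy1, hy'1, hPx y hy]
        norm_num
      have he : x - y = y' := by
        rw [sq_eq_zero_iff, norm_eq_zero, sub_eq_zero] at hd
        exact hd.symm
      rw [if_pos he, h]; norm_num
    all_goals rw [h]; split_ifs <;> norm_num
  -- the Frobenius side is at most `p²/8 + p`
  have hrow : ∀ y ∈ P, ∑ y' ∈ P, (⟪y, y'⟫ - 1 / 4) ^ 2 ≤ p / 16 + 1 := by
    intro y hy
    calc ∑ y' ∈ P, (⟪y, y'⟫ - 1 / 4) ^ 2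
        ≤ ∑ y' ∈ P, (1 / 16 + (if y = y' then 1 / 2 else 0)
            + (if x - y = y' then 1 / 2 else 0) : ℝ) := Finset.sum_le_sum (hpt y hy)
      _ = p / 16 + 1 / 2 + ∑ y' ∈ P, (if x - y = y' then 1 / 2 else 0 : ℝ) := by
          rw [Finset.sum_add_distrib, Finset.sum_add_distrib, Finset.sum_const, nsmul_eq_mul,
            Finset.sum_ite_eq, if_pos hy, ← hp]
          ring
      _ ≤ p / 16 + 1 / 2 + 1 / 2 := by
          gcongr
          rw [Finset.sum_ite_eq]
          split_ifs <;> norm_num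
      _ = p / 16 + 1 := by ring
  have e1 : ∑ y ∈ P, p / 4 * 1 * ⟪x, y - (1 / 2 : ℝ) • x⟫ ^ 2 = 0 :=
    Finset.sum_eq_zero fun y hy => by rw [hxu y hy]; ring
  have e2 : ∀ y ∈ P, 1 * (p / 4) * ⟪y - (1 / 2 : ℝ) • x, x⟫ ^ 2
      + ∑ y' ∈ P, 1 * 1 * ⟪y - (1 / 2 : ℝ) • x, y' - (1 / 2 : ℝ) • x⟫ ^ 2
      = ∑ y' ∈ P, (⟪y, y'⟫ - 1 / 4) ^ 2 := by
    intro y hy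
    rw [hux y hy]
    have : ∑ y' ∈ P, 1 * 1 * ⟪y - (1 / 2 : ℝ) • x, y' - (1 / 2 : ℝ) • x⟫ ^ 2
        = ∑ y' ∈ P, (⟪y, y'⟫ - 1 / 4) ^ 2 :=
      Finset.sum_congr rfl fun y' hy' => by rw [huu y hy y' hy']; ring
    rw [this]; ring
  have hfrob : p / 4 * (p / 4) * ⟪x, x⟫ ^ 2
      + ∑ y ∈ P, p / 4 * 1 * ⟪x, y - (1 / 2 : ℝ) • x⟫ ^ 2
      + ∑ y ∈ P, (1 * (p / 4) * ⟪y - (1 / 2 : ℝ) • x, x⟫ ^ 2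
        + ∑ y' ∈ P, 1 * 1 * ⟪y - (1 / 2 : ℝ) • x, y' - (1 / 2 : ℝ) • x⟫ ^ 2)
      ≤ p ^ 2 / 8 + p := by
    rw [hxx, e1, Finset.sum_congr rfl e2]
    have hs : ∑ y ∈ P, ∑ y' ∈ P, (⟪y, y'⟫ - 1 / 4) ^ 2 ≤ ∑ y ∈ P, (p / 16 + 1) :=
      Finset.sum_le_sum hrow
    rw [Finset.sum_const, nsmul_eq_mul, ← hp] at hs
    nlinarith [hs]
  have hfin : p ^ 2 ≤ 4 * (p ^ 2 / 8 + p) := by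
    have := key
    rw [htr] at this
    push_cast at this
    linarith [hfrob]
  have h8 : p ≤ 8 := by nlinarith [hfin, hp0]
  rw [hp] at h8
  exact_mod_cast h8


/-- **Second moment at most `6`.** In a rigid configuration (unit vectors, inner products of
distinct members in `{-1, -1/2, 0, 1/2}`) in dimension `4`, every member `x` has
`Σ_{y ∈ C} ⟪x, y⟫² ≤ 1 + 1 + 8/4 + 8/4 = 6` — no maximality or cardinality hypothesis needed.
[folklore] -/
theorem d4u_sum_sq_inner_le_six (b : OrthonormalBasis (Fin 4) ℝ F) {C : Finset F}
    (hC1 : ∀ x ∈ C, ‖x‖ = 1)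
    (hv : ∀ x ∈ C, ∀ y ∈ C, x ≠ y →
      (⟪x, y⟫ = -1 ∨ ⟪x, y⟫ = -1 / 2 ∨ ⟪x, y⟫ = 0 ∨ ⟪x, y⟫ = 1 / 2))
    {x : F} (hx : x ∈ C) : ∑ y ∈ C, ⟪x, y⟫ ^ 2 ≤ 6 := by
  classical
  have hx1 := hC1 x hx
  rw [Finset.sum_congr rfl fun y hy => d4u_sq_indicator (d4u_inner_cases hC1 hv hx hy)]
  rw [Finset.sum_add_distrib, Finset.sum_add_distrib, Finset.sum_add_distrib, ← Finset.sum_div,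
    ← Finset.sum_div, Finset.sum_boole, Finset.sum_boole, Finset.sum_boole, Finset.sum_boole,
    d4u_card_one hC1 hx]
  -- the class `⟪x, y⟫ = -1` has at most one member, `-x`
  have hm1 : ((C.filter fun y => ⟪x, y⟫ = -1).card : ℝ) ≤ 1 := by
    have h : (C.filter fun y => ⟪x, y⟫ = -1).card ≤ 1 := by
      refine Finset.card_le_one.2 fun y hy y' hy' => ?_
      rw [Finset.mem_filter] at hy hy'
      have h1 := d4u_eq_neg_of_inner_eq_neg_one hx1 (hC1 y hy.1) hy.2
      have h2 := d4u_eq_neg_of_inner_eq_neg_one hx1 (hC1 y' hy'.1) hy'.2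
      exact neg_injective (h1.symm.trans h2)
    exact_mod_cast h
  -- the classes `⟪x, y⟫ = ± 1/2` have at most `8` members each
  have hp : ((C.filter fun y => ⟪x, y⟫ = 1 / 2).card : ℝ) ≤ 8 := by
    have h := d4u_card_half_le_eight b hx1 (P := C.filter fun y => ⟪x, y⟫ = 1 / 2)
      (fun y hy => hC1 y (Finset.mem_filter.1 hy).1) (fun y hy => (Finset.mem_filter.1 hy).2)
      (fun y hy y' hy' hne => hv y (Finset.mem_filter.1 hy).1 y' (Finset.mem_filter.1 hy').1 hne)
    exact_mod_cast h
  have hn : ((C.filter fun y => ⟪x, y⟫ = -1 / 2).card : ℝ) ≤ 8 := by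
    rw [d4u_filter_neg_half]
    have hx1' : ‖-x‖ = 1 := by rw [norm_neg, hx1]
    have h := d4u_card_half_le_eight b hx1' (P := C.filter fun y => ⟪-x, y⟫ = 1 / 2)
      (fun y hy => hC1 y (Finset.mem_filter.1 hy).1) (fun y hy => (Finset.mem_filter.1 hy).2)
      (fun y hy y' hy' hne => hv y (Finset.mem_filter.1 hy).1 y' (Finset.mem_filter.1 hy').1 hne)
    exact_mod_cast h
  push_cast
  linarith

/-- **Rigid configurations in dimension `4` have at most `24` members**: the frame-potential
inequality `|C|² ≤ 4 Σ_{x,y} ⟪x, y⟫²` against the per-member bound `Σ_y ⟪x, y⟫² ≤ 6`.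
(For kissing configurations this is `k(4) ≤ 24` once Lemma 5.1 of the source is known; see
`musin2008_kissing_four_of_rigidity`.) [folklore] -/
theorem d4u_card_le_of_rigid (b : OrthonormalBasis (Fin 4) ℝ F) {C : Finset F}
    (hC1 : ∀ x ∈ C, ‖x‖ = 1)
    (hv : ∀ x ∈ C, ∀ y ∈ C, x ≠ y →
      (⟪x, y⟫ = -1 ∨ ⟪x, y⟫ = -1 / 2 ∨ ⟪x, y⟫ = 0 ∨ ⟪x, y⟫ = 1 / 2)) :
    C.card ≤ 24 := by
  have hpot := d4u_frame_potential b C hC1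
  rw [Fintype.card_fin] at hpot
  have h6 : ∑ x ∈ C, ∑ y ∈ C, ⟪x, y⟫ ^ 2 ≤ ∑ x ∈ C, (6 : ℝ) :=
    Finset.sum_le_sum fun x hx => d4u_sum_sq_inner_le_six b hC1 hv hx
  rw [Finset.sum_const, nsmul_eq_mul] at h6
  have hc0 : (0 : ℝ) ≤ C.card := Nat.cast_nonneg _
  have h : (C.card : ℝ) ≤ 24 := by
    push_cast at hpot
    nlinarith [hpot, h6, hc0]
  exact_mod_cast h

/-- **`k(4) = 24` from Lemma 5.1.** If every `24`-point kissing configuration of `ℝ⁴` is rigid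
(inner products of distinct members in `{-1, -1/2, 0, 1/2}`: de Laat–Leijenhorst–de Muinck Keizer
2024, Lemma 5.1, the consequence of the exact second-level Lasserre certificate), then NO kissing
configuration of `ℝ⁴` has more than `24` members, i.e. Musin's `musin2008_kissing_four` follows:
any two members of a `25`-point configuration lie in a common `24`-point sub-configuration, so the
`25` points are rigid, contradicting `d4u_card_le_of_rigid`. (In the source, `k(4) ≤ 24` is read
off the same certificate: "any feasible solution `K` provides an upper bound on `k(n)`", §1 and
the proof of Lemma 5.1; here it is derived from the statement of Lemma 5.1 itself.)
[cite: DeLaatLeijenhorstDeMuinckKeizer2024, Lemma 5.1 and its proof] -/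
theorem musin2008_kissing_four_of_rigidity
    (h51 : ∀ C : Finset (EuclideanSpace ℝ (Fin 4)), C.card = 24 → (∀ x ∈ C, ‖x‖ = 1) →
      (∀ x ∈ C, ∀ y ∈ C, x ≠ y → ⟪x, y⟫ ≤ 1 / 2) →
      ∀ x ∈ C, ∀ y ∈ C, x ≠ y →
        (⟪x, y⟫ = -1 ∨ ⟪x, y⟫ = -1 / 2 ∨ ⟪x, y⟫ = 0 ∨ ⟪x, y⟫ = 1 / 2)) :
    musin2008_kissing_four := by
  classical
  intro C hC1 hle
  by_contra hgt
  rw [not_le] at hgt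
  obtain ⟨D, hDC, hDcard⟩ := Finset.exists_subset_card_eq (show 25 ≤ C.card by omega)
  have hD1 : ∀ x ∈ D, ‖x‖ = 1 := fun x hx => hC1 x (hDC hx)
  have hDle : ∀ x ∈ D, ∀ y ∈ D, x ≠ y → ⟪x, y⟫ ≤ 1 / 2 := fun x hx y hy hxy =>
    hle x (hDC hx) y (hDC hy) hxy
  -- any two members of `D` lie in a `24`-point sub-configuration, hence `D` is rigid
  have hDv : ∀ x ∈ D, ∀ y ∈ D, x ≠ y →
      (⟪x, y⟫ = -1 ∨ ⟪x, y⟫ = -1 / 2 ∨ ⟪x, y⟫ = 0 ∨ ⟪x, y⟫ = 1 / 2) := by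
    intro x hx y hy hxy
    obtain ⟨z, hz, hzx, hzy⟩ : ∃ z ∈ D, z ≠ x ∧ z ≠ y := by
      have hpos : 0 < ((D.erase x).erase y).card := by
        rw [Finset.card_erase_of_mem (Finset.mem_erase.2 ⟨Ne.symm hxy, hy⟩),
          Finset.card_erase_of_mem hx, hDcard]
        norm_num
      obtain ⟨z, hz⟩ := Finset.card_pos.1 hpos
      simp only [Finset.mem_erase] at hz
      exact ⟨z, hz.2.2, hz.2.1, hz.1⟩
    have hE : (D.erase z).card = 24 := by rw [Finset.card_erase_of_mem hz, hDcard]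
    exact h51 (D.erase z) hE (fun a ha => hD1 a (Finset.mem_of_mem_erase ha))
      (fun a ha c hc hac => hDle a (Finset.mem_of_mem_erase ha) c (Finset.mem_of_mem_erase hc) hac)
      x (Finset.mem_erase.2 ⟨hzx.symm, hx⟩) y (Finset.mem_erase.2 ⟨hzy.symm, hy⟩) hxy
  have h24 := d4u_card_le_of_rigid (EuclideanSpace.basisFun (Fin 4) ℝ) hD1 hDv
  omega

/-- **Theorem 5.3 from Lemma 5.1 alone.** The uniqueness fact `dlldmk2024_kissing_four_unique`
follows from the statement of Lemma 5.1 of de Laat–Leijenhorst–de Muinck Keizer 2024 with no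
further input: `k(4) = 24` is itself a consequence (`musin2008_kissing_four_of_rigidity`), and then
`dlldmk2024_kissing_four_unique_of_rigidity` applies. So the named fact reduces exactly to the
paper's SDP-certified Lemma 5.1. [cite: DeLaatLeijenhorstDeMuinckKeizer2024, Lemma 5.1, Theorem 5.3] -/
theorem dlldmk2024_kissing_four_unique_of_lemma51
    (h51 : ∀ C : Finset (EuclideanSpace ℝ (Fin 4)), C.card = 24 → (∀ x ∈ C, ‖x‖ = 1) →
      (∀ x ∈ C, ∀ y ∈ C, x ≠ y → ⟪x, y⟫ ≤ 1 / 2) →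
      ∀ x ∈ C, ∀ y ∈ C, x ≠ y →
        (⟪x, y⟫ = -1 ∨ ⟪x, y⟫ = -1 / 2 ∨ ⟪x, y⟫ = 0 ∨ ⟪x, y⟫ = 1 / 2)) :
    dlldmk2024_kissing_four_unique :=
  dlldmk2024_kissing_four_unique_of_rigidity (musin2008_kissing_four_of_rigidity h51) h51

/-- **The uniqueness fact is equivalent to Lemma 5.1.** `dlldmk2024_kissing_four_unique` holds if
and only if every `24`-point kissing configuration of `ℝ⁴` has all inner products of distinct
members in `{-1, -1/2, 0, 1/2}` (de Laat–Leijenhorst–de Muinck Keizer 2024, Lemma 5.1): the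
residual unformalised content of the fact is precisely the paper's exact SDP certificate.
[cite: DeLaatLeijenhorstDeMuinckKeizer2024, Lemma 5.1, Theorem 5.3] -/
theorem dlldmk2024_kissing_four_unique_iff_lemma51 :
    dlldmk2024_kissing_four_unique ↔
      ∀ C : Finset (EuclideanSpace ℝ (Fin 4)), C.card = 24 → (∀ x ∈ C, ‖x‖ = 1) →
        (∀ x ∈ C, ∀ y ∈ C, x ≠ y → ⟪x, y⟫ ≤ 1 / 2) →
        ∀ x ∈ C, ∀ y ∈ C, x ≠ y →
          (⟪x, y⟫ = -1 ∨ ⟪x, y⟫ = -1 / 2 ∨ ⟪x, y⟫ = 0 ∨ ⟪x, y⟫ = 1 / 2) :=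
  ⟨dlldmk2024_rigidity_of_kissing_four_unique, dlldmk2024_kissing_four_unique_of_lemma51⟩

/-- **Uniqueness implies `k(4) = 24`.** The named fact `dlldmk2024_kissing_four_unique` (Theorem 5.3
of the source, at `24` points) implies the named fact `musin2008_kissing_four` (`k(4) ≤ 24`):
uniqueness gives Lemma 5.1 back (`dlldmk2024_rigidity_of_kissing_four_unique`), and Lemma 5.1
bounds every kissing configuration by `24` (`musin2008_kissing_four_of_rigidity`).
[cite: DeLaatLeijenhorstDeMuinckKeizer2024, Lemma 5.1, Theorem 5.3; Musin2008, §2 Main Theorem] -/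
theorem musin2008_kissing_four_of_kissing_four_unique (h : dlldmk2024_kissing_four_unique) :
    musin2008_kissing_four :=
  musin2008_kissing_four_of_rigidity (dlldmk2024_rigidity_of_kissing_four_unique h)

end RigidityAlone

/-! ### Theorem 5.2: `D₄` is an optimal `24`-point spherical code; `k(4) ≥ 24` -/

section OptimalCode

/-- Distinct normalised `D₄` roots `z/√2 ≠ z'/√2` have inner product `(Σ zₖ z'ₖ)/2 ∈
{-1, -1/2, 0, 1/2}` — "the possible inner products between distinct roots are `0`, `±1/2`, and
`-1`" (§1 of the source). [cite: DeLaatLeijenhorstDeMuinckKeizer2024, §1 (the D₄ root system)] -/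
theorem d4Roots_inner_cases {a b : EuclideanSpace ℝ (Fin 4)} (ha : a ∈ d4Roots)
    (hb : b ∈ d4Roots) (hab : a ≠ b) :
    ⟪a, b⟫ = -1 ∨ ⟪a, b⟫ = -1 / 2 ∨ ⟪a, b⟫ = 0 ∨ ⟪a, b⟫ = 1 / 2 := by
  have ha1 : ‖a‖ = 1 := norm_eq_one_of_mem_d4Roots ha
  have hb1 : ‖b‖ = 1 := norm_eq_one_of_mem_d4Roots hb
  obtain ⟨z, -, haz⟩ := ha
  obtain ⟨z', -, hbz⟩ := hb
  -- `⟪a, b⟫ = (Σ zₖ z'ₖ) / 2`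
  have hab' : ⟪a, b⟫ = ((∑ k, z k * z' k : ℤ) : ℝ) / 2 := by
    have hsum : ⟪a, b⟫ = ∑ k, a k * b k := by simp [PiLp.inner_apply, mul_comm]
    rw [hsum]
    push_cast
    rw [Finset.sum_div]
    refine Finset.sum_congr rfl fun k _ => ?_
    rw [haz k, hbz k, div_mul_div_comm, Real.mul_self_sqrt (by norm_num : (0 : ℝ) ≤ 2)]
  have hle1 : ⟪a, b⟫ ≤ 1 := real_inner_le_one_of_norm_eq_one ha1 hb1
  have hge1 : -1 ≤ ⟪a, b⟫ := neg_one_le_real_inner_of_norm_eq_one ha1 hb1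
  have hne1 : ⟪a, b⟫ ≠ 1 := fun h1 => hab ((inner_eq_one_iff_of_norm_eq_one ha1 hb1).1 h1)
  rw [hab'] at hle1 hge1 hne1 ⊢
  set m : ℤ := ∑ k, z k * z' k with hm
  have hm2 : m ≤ 2 := by
    have : (m : ℝ) ≤ 2 := by linarith
    exact_mod_cast this
  have hm2' : -2 ≤ m := by
    have : (-2 : ℝ) ≤ m := by linarith
    exact_mod_cast this
  have hmne : m ≠ 2 := by
    intro h2; apply hne1; rw [h2]; norm_num
  have hm4 : m = -2 ∨ m = -1 ∨ m = 0 ∨ m = 1 := by omega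
  rcases hm4 with h' | h' | h' | h' <;> rw [h'] <;> norm_num

/-- Distinct normalised `D₄` roots are at angle `≥ π/3`, i.e. `d4Roots` is a kissing configuration
("Hence `D₄` is a kissing configuration in dimension `4` of size `24`; that is, `k(4) ≥ 24`", §1 of
the source). [cite: DeLaatLeijenhorstDeMuinckKeizer2024, §1] -/
theorem d4Roots_inner_le_half {a b : EuclideanSpace ℝ (Fin 4)} (ha : a ∈ d4Roots)
    (hb : b ∈ d4Roots) (hab : a ≠ b) : ⟪a, b⟫ ≤ 1 / 2 := by
  rcases d4Roots_inner_cases ha hb hab with h | h | h | h <;> rw [h] <;> norm_num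

/-- The integer vectors `z ∈ ℤ⁴` with `Σ zₖ² = 2` lie in the box `{-1, 0, 1}⁴`. [folklore] -/
theorem d4u_intRoot_mem_box {z : Fin 4 → ℤ} (hz : ∑ k, z k ^ 2 = 2) :
    z ∈ (Fintype.piFinset fun _ : Fin 4 => ({-1, 0, 1} : Finset ℤ)).filter
      fun z => ∑ k, z k ^ 2 = 2 := by
  refine Finset.mem_filter.2 ⟨Fintype.mem_piFinset.2 fun k => ?_, hz⟩
  have h1 : z k ^ 2 ≤ 2 := by
    rw [← hz]
    exact Finset.single_le_sum (f := fun i => z i ^ 2) (fun i _ => sq_nonneg (z i))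
      (Finset.mem_univ k)
  have h2 : -1 ≤ z k := by nlinarith
  have h3 : z k ≤ 1 := by nlinarith
  simp only [Finset.mem_insert, Finset.mem_singleton]
  omega

/-- There are exactly `24` integer vectors `z ∈ ℤ⁴` with `Σ zₖ² = 2` (namely `±eᵢ ± eⱼ`,
`i < j`): "the set of all `24` vectors in `ℝ⁴` with integer coordinates and length `√2`" (§1 of
the source); a finite check (`decide`). [cite: DeLaatLeijenhorstDeMuinckKeizer2024, §1] -/
theorem d4u_intRoots_card :
    ((Fintype.piFinset fun _ : Fin 4 => ({-1, 0, 1} : Finset ℤ)).filter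
      fun z => ∑ k, z k ^ 2 = 2).card = 24 := by
  decide

/-- `d4Roots` is the image of the `24` integer roots under `z ↦ z/√2`, as a finite set.
[cite: DeLaatLeijenhorstDeMuinckKeizer2024, §1] -/
theorem d4Roots_eq_coe_image :
    d4Roots = ↑(((Fintype.piFinset fun _ : Fin 4 => ({-1, 0, 1} : Finset ℤ)).filter
      fun z => ∑ k, z k ^ 2 = 2).image fun z : Fin 4 → ℤ =>
        (WithLp.toLp 2 fun k => (z k : ℝ) / Real.sqrt 2 : EuclideanSpace ℝ (Fin 4))) := by
  ext x
  rw [mem_d4Roots_iff, Finset.coe_image, Set.mem_image]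
  constructor
  · rintro ⟨z, hz, hxz⟩
    refine ⟨z, Finset.mem_coe.2 (d4u_intRoot_mem_box hz), ?_⟩
    ext k
    rw [hxz k]
  · rintro ⟨z, hz, rfl⟩
    exact ⟨z, (Finset.mem_filter.1 (Finset.mem_coe.1 hz)).2, fun k => rfl⟩

/-- `d4Roots` is a finite set. [cite: DeLaatLeijenhorstDeMuinckKeizer2024, §1] -/
theorem d4Roots_finite : d4Roots.Finite := by
  rw [d4Roots_eq_coe_image]; exact Finset.finite_toSet _

/-- **`d4Roots` has exactly `24` elements** ("the set of all `24` vectors …", §1 of the source):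
`z ↦ z/√2` is injective on the `24` integer roots. [cite: DeLaatLeijenhorstDeMuinckKeizer2024, §1] -/
theorem d4Roots_ncard : d4Roots.ncard = 24 := by
  rw [d4Roots_eq_coe_image, Set.ncard_coe_finset, Finset.card_image_of_injective _ ?_,
    d4u_intRoots_card]
  intro z z' h
  funext k
  have hk : (z k : ℝ) / Real.sqrt 2 = (z' k : ℝ) / Real.sqrt 2 := by
    have := congrArg (fun v : EuclideanSpace ℝ (Fin 4) => v k) h
    simpa using this
  have h2 : Real.sqrt 2 ≠ 0 := (Real.sqrt_pos.2 (by norm_num)).ne'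
  exact_mod_cast (div_left_inj' h2).1 hk

/-- **`k(4) ≥ 24`: the normalised `D₄` root shell is a `24`-point kissing configuration of `ℝ⁴`**
— `24` unit vectors with pairwise inner products `≤ 1/2` (§1 of the source; Musin 2008, §1, the
`24`-cell). [cite: DeLaatLeijenhorstDeMuinckKeizer2024, §1] -/
theorem d4Roots_kissing :
    ∃ D : Finset (EuclideanSpace ℝ (Fin 4)), (D : Set (EuclideanSpace ℝ (Fin 4))) = d4Roots ∧
      D.card = 24 ∧ (∀ x ∈ D, ‖x‖ = 1) ∧ ∀ x ∈ D, ∀ y ∈ D, x ≠ y → ⟪x, y⟫ ≤ 1 / 2 := by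
  refine ⟨d4Roots_finite.toFinset, d4Roots_finite.coe_toFinset, ?_, ?_, ?_⟩
  · rw [← Set.ncard_eq_toFinset_card d4Roots d4Roots_finite, d4Roots_ncard]
  · intro x hx
    exact norm_eq_one_of_mem_d4Roots (d4Roots_finite.mem_toFinset.1 hx)
  · intro x hx y hy hxy
    exact d4Roots_inner_le_half (d4Roots_finite.mem_toFinset.1 hx)
      (d4Roots_finite.mem_toFinset.1 hy) hxy

/-- **Theorem 5.2 from Lemma 5.1: no `24`-point code of `𝕊³` beats `D₄`.** If every `24`-point
kissing configuration of `ℝ⁴` is rigid (Lemma 5.1 of the source, hypothesis `h51`), then among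
any `24` unit vectors of `ℝ⁴` two distinct ones have inner product `≥ 1/2`, i.e.
`t_max(C) ≥ 1/2 = t_max(D₄)`: otherwise `C` is a `24`-point kissing configuration with no inner
product equal to `1/2`, whereas rigidity, `k(4) = 24` (`musin2008_kissing_four_of_rigidity`) and
the frame-potential count force exactly `8` members at inner product `1/2` from each member
(`d4u_card_classes_eq`). The source argues by perturbation instead ("any small enough perturbation
of `C` would correspond to a kissing configuration of size `24`", contradicting Lemma 5.1).
[cite: DeLaatLeijenhorstDeMuinckKeizer2024, Theorem 5.2 (proof) and Lemma 5.1] -/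
theorem dlldmk2024_optimal_code_of_lemma51
    (h51 : ∀ C : Finset (EuclideanSpace ℝ (Fin 4)), C.card = 24 → (∀ x ∈ C, ‖x‖ = 1) →
      (∀ x ∈ C, ∀ y ∈ C, x ≠ y → ⟪x, y⟫ ≤ 1 / 2) →
      ∀ x ∈ C, ∀ y ∈ C, x ≠ y →
        (⟪x, y⟫ = -1 ∨ ⟪x, y⟫ = -1 / 2 ∨ ⟪x, y⟫ = 0 ∨ ⟪x, y⟫ = 1 / 2))
    (C : Finset (EuclideanSpace ℝ (Fin 4))) (hcard : C.card = 24) (hC1 : ∀ x ∈ C, ‖x‖ = 1) :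
    ∃ x ∈ C, ∃ y ∈ C, x ≠ y ∧ 1 / 2 ≤ ⟪x, y⟫ := by
  classical
  by_contra hex
  have hlt : ∀ x ∈ C, ∀ y ∈ C, x ≠ y → ⟪x, y⟫ < 1 / 2 := fun x hx y hy hxy =>
    lt_of_not_ge fun h => hex ⟨x, hx, y, hy, hxy, h⟩
  have hle : ∀ x ∈ C, ∀ y ∈ C, x ≠ y → ⟪x, y⟫ ≤ 1 / 2 := fun x hx y hy hxy =>
    (hlt x hx y hy hxy).le
  have hv := h51 C hcard hC1 hle
  have hmax := d4u_maximal_of_musin (musin2008_kissing_four_of_rigidity h51) hcard hC1 hle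
  obtain ⟨β, hβ⟩ : C.Nonempty := by rw [← Finset.card_pos, hcard]; norm_num
  have h8 := (d4u_card_classes_eq hC1 hv hmax hcard (EuclideanSpace.basisFun (Fin 4) ℝ) hβ).1
  have h0 : (C.filter fun x => ⟪β, x⟫ = 1 / 2).card = 0 := by
    rw [Finset.card_eq_zero, Finset.filter_eq_empty_iff]
    intro x hx h
    have hne : β ≠ x := by
      rintro rfl
      rw [real_inner_self_eq_norm_sq, hC1 β hβ] at h
      norm_num at h
    exact absurd h (hlt β hβ x hx hne).ne
  omega

/-- **Theorem 5.2 (the `D₄` root system is an optimal spherical code), from Lemma 5.1.** Among the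
`24`-point configurations on the unit sphere of `ℝ⁴`, the largest inner product between distinct
points, `t_max`, is minimised by the normalised `D₄` root shell: `d4Roots` consists of `24` unit
vectors all of whose inner products of distinct members are `≤ 1/2`, and every `24` unit vectors
of `ℝ⁴` contain two distinct ones at inner product `≥ 1/2`. Conditional only on Lemma 5.1 of the
source (hypothesis `h51`, the exact second-level Lasserre certificate).
[cite: DeLaatLeijenhorstDeMuinckKeizer2024, Theorem 5.2] -/
theorem dlldmk2024_theorem52_of_lemma51
    (h51 : ∀ C : Finset (EuclideanSpace ℝ (Fin 4)), C.card = 24 → (∀ x ∈ C, ‖x‖ = 1) →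
      (∀ x ∈ C, ∀ y ∈ C, x ≠ y → ⟪x, y⟫ ≤ 1 / 2) →
      ∀ x ∈ C, ∀ y ∈ C, x ≠ y →
        (⟪x, y⟫ = -1 ∨ ⟪x, y⟫ = -1 / 2 ∨ ⟪x, y⟫ = 0 ∨ ⟪x, y⟫ = 1 / 2)) :
    (∃ D : Finset (EuclideanSpace ℝ (Fin 4)), (D : Set (EuclideanSpace ℝ (Fin 4))) = d4Roots ∧
      D.card = 24 ∧ (∀ x ∈ D, ‖x‖ = 1) ∧ ∀ x ∈ D, ∀ y ∈ D, x ≠ y → ⟪x, y⟫ ≤ 1 / 2) ∧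
    ∀ C : Finset (EuclideanSpace ℝ (Fin 4)), C.card = 24 → (∀ x ∈ C, ‖x‖ = 1) →
      ∃ x ∈ C, ∃ y ∈ C, x ≠ y ∧ 1 / 2 ≤ ⟪x, y⟫ :=
  ⟨d4Roots_kissing, dlldmk2024_optimal_code_of_lemma51 h51⟩

/-- **Theorem 5.2 from Theorem 5.3**: the uniqueness fact `dlldmk2024_kissing_four_unique` implies
that the `D₄` root system is an optimal `24`-point spherical code of `𝕊³` (through Lemma 5.1,
`dlldmk2024_rigidity_of_kissing_four_unique`).
[cite: DeLaatLeijenhorstDeMuinckKeizer2024, Theorem 5.2, Theorem 5.3] -/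
theorem dlldmk2024_theorem52_of_kissing_four_unique (h : dlldmk2024_kissing_four_unique) :
    (∃ D : Finset (EuclideanSpace ℝ (Fin 4)), (D : Set (EuclideanSpace ℝ (Fin 4))) = d4Roots ∧
      D.card = 24 ∧ (∀ x ∈ D, ‖x‖ = 1) ∧ ∀ x ∈ D, ∀ y ∈ D, x ≠ y → ⟪x, y⟫ ≤ 1 / 2) ∧
    ∀ C : Finset (EuclideanSpace ℝ (Fin 4)), C.card = 24 → (∀ x ∈ C, ‖x‖ = 1) →
      ∃ x ∈ C, ∃ y ∈ C, x ≠ y ∧ 1 / 2 ≤ ⟪x, y⟫ :=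
  dlldmk2024_theorem52_of_lemma51 (dlldmk2024_rigidity_of_kissing_four_unique h)

/-- Distance form of Theorem 5.2 (from the uniqueness fact): among any `24` points of the unit
sphere of `ℝ⁴`, two distinct ones are at Euclidean distance `≤ 1` — the minimal distance of a
`24`-point code of `𝕊³` never exceeds that of `D₄`.
[cite: DeLaatLeijenhorstDeMuinckKeizer2024, Theorem 5.2] -/
theorem dlldmk2024_theorem52_dist_form (h : dlldmk2024_kissing_four_unique)
    (C : Finset (EuclideanSpace ℝ (Fin 4))) (hcard : C.card = 24) (hC1 : ∀ x ∈ C, ‖x‖ = 1) :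
    ∃ x ∈ C, ∃ y ∈ C, x ≠ y ∧ dist x y ≤ 1 := by
  obtain ⟨x, hx, y, hy, hxy, hi⟩ :=
    dlldmk2024_optimal_code_of_lemma51 (dlldmk2024_rigidity_of_kissing_four_unique h) C hcard hC1
  refine ⟨x, hx, y, hy, hxy, ?_⟩
  have hd := dist_sq_eq_two_sub_two_inner (hC1 x hx) (hC1 y hy)
  have hd0 : 0 ≤ dist x y := dist_nonneg
  nlinarith

end OptimalCode

/-! ### The proof of Lemma 5.1: weak duality for the second level of the Lasserre hierarchy -/

section LasserreDuality

variable {α : Type*} [DecidableEq α]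

/-- Regrouping the double sum over pairs of `≤ 2`-element subsets of `C` by their union: the middle
equality `Σ_{J₁,J₂ ∈ I₂, J₁,J₂ ⊆ C} K(J₁,J₂) = Σ_{Q ∈ I₄, Q ⊆ C} A₂K(Q)` in the proof of Lemma 5.1,
where `A₂K(Q) = Σ_{J₁,J₂ ∈ I₂, J₁ ∪ J₂ = Q} K(J₁,J₂)` (§1, eq. (1)). Purely combinatorial: stated
for an arbitrary function `K` on pairs of finite sets. [cite: DeLaatLeijenhorstDeMuinckKeizer2024,
§1 eq. (1) (definition of `A_t K`) and §5.1, proof of Lemma 5.1] -/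
theorem lasserre2_sum_pairs_eq_sum_union (K : Finset α → Finset α → ℝ) (C : Finset α) :
    ∑ J₁ ∈ C.powerset with J₁.card ≤ 2, ∑ J₂ ∈ C.powerset with J₂.card ≤ 2, K J₁ J₂ =
      ∑ Q ∈ C.powerset with Q.card ≤ 4, ∑ J₁ ∈ Q.powerset with J₁.card ≤ 2,
        ∑ J₂ ∈ Q.powerset with J₂.card ≤ 2 ∧ J₁ ∪ J₂ = Q, K J₁ J₂ := by
  have hmaps : ∀ p ∈ (C.powerset.filter fun J : Finset α => J.card ≤ 2) ×ˢ
      (C.powerset.filter fun J : Finset α => J.card ≤ 2),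
      p.1 ∪ p.2 ∈ C.powerset.filter fun Q : Finset α => Q.card ≤ 4 := by
    rintro ⟨J₁, J₂⟩ hp
    simp only [Finset.mem_product, Finset.mem_filter, Finset.mem_powerset] at hp ⊢
    exact ⟨Finset.union_subset hp.1.1 hp.2.1, (Finset.card_union_le _ _).trans (by omega)⟩
  rw [← Finset.sum_product', ← Finset.sum_fiberwise_of_maps_to hmaps]
  refine Finset.sum_congr rfl fun Q hQ => ?_
  have hQC : Q ⊆ C := Finset.mem_powerset.1 (Finset.mem_filter.1 hQ).1
  have hfib : ((C.powerset.filter fun J : Finset α => J.card ≤ 2) ×ˢ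
        (C.powerset.filter fun J : Finset α => J.card ≤ 2)).filter
          (fun p : Finset α × Finset α => p.1 ∪ p.2 = Q)
      = ((Q.powerset.filter fun J : Finset α => J.card ≤ 2) ×ˢ
          (Q.powerset.filter fun J : Finset α => J.card ≤ 2)).filter
            (fun p : Finset α × Finset α => p.1 ∪ p.2 = Q) := by
    ext ⟨J₁, J₂⟩
    simp only [Finset.mem_filter, Finset.mem_product, Finset.mem_powerset]
    constructor
    · rintro ⟨⟨⟨-, h₁⟩, -, h₂⟩, hU⟩
      exact ⟨⟨⟨Finset.subset_union_left.trans (Finset.subset_of_eq hU), h₁⟩,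
        Finset.subset_union_right.trans (Finset.subset_of_eq hU), h₂⟩, hU⟩
    · rintro ⟨⟨⟨h₁Q, h₁⟩, h₂Q, h₂⟩, hU⟩
      exact ⟨⟨⟨h₁Q.trans hQC, h₁⟩, h₂Q.trans hQC, h₂⟩, hU⟩
  rw [hfib, Finset.sum_filter, Finset.sum_product]
  refine Finset.sum_congr rfl fun J₁ _ => ?_
  dsimp only
  rw [← Finset.sum_filter, Finset.filter_filter]

/-- The value `A₂K(∅) = K(∅, ∅)` (the objective of the Lasserre program, §1 eq. (1)).
[cite: DeLaatLeijenhorstDeMuinckKeizer2024, §1 eq. (1)] -/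
theorem lasserre2_union_sum_empty (K : Finset α → Finset α → ℝ) :
    ∑ J₁ ∈ (∅ : Finset α).powerset with J₁.card ≤ 2,
        ∑ J₂ ∈ (∅ : Finset α).powerset with J₂.card ≤ 2 ∧ J₁ ∪ J₂ = ∅, K J₁ J₂ = K ∅ ∅ := by
  simp [Finset.filter_singleton]

/-- The one-point constraint made explicit: `A₂K({x}) = K(∅,{x}) + K({x},∅) + K({x},{x})`
(`= p₁` in §4). [cite: DeLaatLeijenhorstDeMuinckKeizer2024, §1 eq. (1), §4 (`p₁ = A₂K({x₁})`)] -/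
theorem lasserre2_union_sum_singleton (K : Finset α → Finset α → ℝ) (x : α) :
    ∑ J₁ ∈ ({x} : Finset α).powerset with J₁.card ≤ 2,
        ∑ J₂ ∈ ({x} : Finset α).powerset with J₂.card ≤ 2 ∧ J₁ ∪ J₂ = {x}, K J₁ J₂
      = K ∅ {x} + K {x} ∅ + K {x} {x} := by
  have hne : (∅ : Finset α) ≠ {x} := (Finset.singleton_ne_empty x).symm
  have hP : (({x} : Finset α).powerset.filter fun J : Finset α => J.card ≤ 2) = {∅, {x}} := by
    ext J
    simp only [Finset.mem_filter, Finset.mem_powerset, Finset.subset_singleton_iff,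
      Finset.mem_insert, Finset.mem_singleton]
    constructor
    · rintro ⟨h, -⟩; exact h
    · rintro (rfl | rfl) <;> simp
  rw [hP, Finset.sum_pair hne]
  have h1 : (({x} : Finset α).powerset.filter fun J₂ : Finset α => J₂.card ≤ 2 ∧ ∅ ∪ J₂ = {x})
      = {{x}} := by
    ext J
    simp only [Finset.mem_filter, Finset.mem_powerset, Finset.subset_singleton_iff,
      Finset.empty_union, Finset.mem_singleton]
    constructor
    · rintro ⟨-, -, rfl⟩; rfl
    · rintro rfl; simp
  have h2 : (({x} : Finset α).powerset.filter fun J₂ : Finset α => J₂.card ≤ 2 ∧ {x} ∪ J₂ = {x})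
      = {∅, {x}} := by
    ext J
    simp only [Finset.mem_filter, Finset.mem_powerset, Finset.subset_singleton_iff,
      Finset.mem_insert, Finset.mem_singleton]
    constructor
    · rintro ⟨h, -⟩; exact h
    · rintro (rfl | rfl) <;> simp
  rw [h1, h2, Finset.sum_singleton, Finset.sum_pair hne]
  ring

/-- The two-point constraint made explicit: for `x ≠ y`,
`A₂K({x,y}) = K(∅,{x,y}) + K({x,y},∅) + K({x},{y}) + K({y},{x}) + K({x},{x,y}) + K({x,y},{x})
  + K({y},{x,y}) + K({x,y},{y}) + K({x,y},{x,y})` (`= p₂(⟪x, y⟫)` in §4).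
[cite: DeLaatLeijenhorstDeMuinckKeizer2024, §1 eq. (1), §4 (`p₂(⟨x₁,x₂⟩) = A₂K({x₁, x₂})`)] -/
theorem lasserre2_union_sum_pair (K : Finset α → Finset α → ℝ) {x y : α} (hxy : x ≠ y) :
    ∑ J₁ ∈ ({x, y} : Finset α).powerset with J₁.card ≤ 2,
        ∑ J₂ ∈ ({x, y} : Finset α).powerset with J₂.card ≤ 2 ∧ J₁ ∪ J₂ = {x, y}, K J₁ J₂
      = K ∅ {x, y} + K {x, y} ∅ + (K {x} {y} + K {y} {x}) + (K {x} {x, y} + K {x, y} {x})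
        + (K {y} {x, y} + K {x, y} {y}) + K {x, y} {x, y} := by
  -- the `≤ 2`-element subsets of `{x, y}` are all four subsets
  have hP : (({x, y} : Finset α).powerset.filter fun J : Finset α => J.card ≤ 2)
      = ({x, y} : Finset α).powerset := by
    refine Finset.filter_true_of_mem fun J hJ => ?_
    exact (Finset.card_le_card (Finset.mem_powerset.1 hJ)).trans (Finset.card_le_two)
  rw [hP]
  have hin : ∀ J₁ ∈ ({x, y} : Finset α).powerset,
      (∑ J₂ ∈ ({x, y} : Finset α).powerset with J₂.card ≤ 2 ∧ J₁ ∪ J₂ = {x, y}, K J₁ J₂)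
        = ∑ J₂ ∈ ({x, y} : Finset α).powerset, if J₁ ∪ J₂ = {x, y} then K J₁ J₂ else 0 := by
    intro J₁ hJ₁
    rw [Finset.sum_filter]
    refine Finset.sum_congr rfl fun J₂ hJ₂ => ?_
    have : J₂.card ≤ 2 :=
      (Finset.card_le_card (Finset.mem_powerset.1 hJ₂)).trans Finset.card_le_two
    simp [this]
  rw [Finset.sum_congr rfl hin]
  have hpow : ({x, y} : Finset α).powerset = {∅, {x}, {y}, {x, y}} := by
    have hs : ({y} : Finset α).powerset = {∅, {y}} := by
      ext J
      simp only [Finset.mem_powerset, Finset.subset_singleton_iff, Finset.mem_insert,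
        Finset.mem_singleton]
    rw [Finset.powerset_insert, hs]
    ext J
    simp only [Finset.mem_union, Finset.mem_insert, Finset.mem_singleton, Finset.mem_image,
      exists_eq_or_imp, exists_eq_left, Finset.insert_empty]
    tauto
  rw [hpow]
  have h1 : (∅ : Finset α) ∉ ({{x}, {y}, {x, y}} : Finset (Finset α)) := by
    simp only [Finset.mem_insert, Finset.mem_singleton, not_or]
    exact ⟨(Finset.singleton_ne_empty x).symm, (Finset.singleton_ne_empty y).symm,
      (Finset.insert_ne_empty x {y}).symm⟩
  have h2 : ({x} : Finset α) ∉ ({{y}, {x, y}} : Finset (Finset α)) := by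
    simp only [Finset.mem_insert, Finset.mem_singleton, not_or, Finset.singleton_inj]
    refine ⟨hxy, fun h => hxy ?_⟩
    have : y ∈ ({x} : Finset α) := h ▸ Finset.mem_insert_of_mem (Finset.mem_singleton_self y)
    exact (Finset.mem_singleton.1 this).symm
  have h3 : ({y} : Finset α) ≠ {x, y} := by
    intro h
    have : x ∈ ({y} : Finset α) := h ▸ Finset.mem_insert_self x {y}
    exact hxy (Finset.mem_singleton.1 this)
  have hxy' : ({x} : Finset α) ∪ {y} = {x, y} := by ext; simp
  have hyx' : ({y} : Finset α) ∪ {x} = {x, y} := by rw [Finset.union_comm]; exact hxy'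
  have hxx : ({x} : Finset α) ∪ {x, y} = {x, y} := by ext; simp
  have hyy : ({y} : Finset α) ∪ {x, y} = {x, y} := by ext; simp
  have hxyx : ({x, y} : Finset α) ∪ {x} = {x, y} := by rw [Finset.union_comm]; exact hxx
  have hxyy : ({x, y} : Finset α) ∪ {y} = {x, y} := by rw [Finset.union_comm]; exact hyy
  have hx_ne : ({x} : Finset α) ≠ {x, y} := by
    intro h
    have : y ∈ ({x} : Finset α) := h ▸ Finset.mem_insert_of_mem (Finset.mem_singleton_self y)
    exact hxy (Finset.mem_singleton.1 this).symm
  simp only [Finset.sum_insert h1, Finset.sum_insert h2, Finset.sum_pair h3,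
    Finset.empty_union, Finset.union_empty, Finset.union_self, hxy', hyx', hxx, hyy, hxyx, hxyy,
    if_true]
  simp only [(Finset.insert_ne_empty x {y}).symm, hx_ne, h3, if_false]
  ring

/-- Splitting a sum over the subsets of `C` with at most `4` elements according to `|Q| = 0`,
`|Q| = 1`, `2 ≤ |Q| ≤ 4` (the three kinds of constraints of the Lasserre program: objective,
`A₂K({x}) ≤ -1`, `A₂K(Q) ≤ 0`). [folklore] -/
theorem d4u_sum_card_le_four_split (C : Finset α) (f : Finset α → ℝ) :
    ∑ Q ∈ C.powerset with Q.card ≤ 4, f Q =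
      f ∅ + ∑ x ∈ C, f {x} + ∑ Q ∈ C.powerset with 2 ≤ Q.card ∧ Q.card ≤ 4, f Q := by
  rw [← Finset.sum_filter_add_sum_filter_not (C.powerset.filter fun Q : Finset α => Q.card ≤ 4)
      (fun Q : Finset α => Q.card = 0),
    ← Finset.sum_filter_add_sum_filter_not
      ((C.powerset.filter fun Q : Finset α => Q.card ≤ 4).filter fun Q : Finset α => ¬Q.card = 0)
      (fun Q : Finset α => Q.card = 1)]
  have h0 : (C.powerset.filter fun Q : Finset α => Q.card ≤ 4).filter
      (fun Q : Finset α => Q.card = 0) = {∅} := by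
    ext Q
    simp only [Finset.mem_filter, Finset.mem_powerset, Finset.card_eq_zero, Finset.mem_singleton]
    constructor
    · rintro ⟨-, rfl⟩; rfl
    · rintro rfl; exact ⟨⟨Finset.empty_subset _, by simp⟩, rfl⟩
  have h1 : ((C.powerset.filter fun Q : Finset α => Q.card ≤ 4).filter
      fun Q : Finset α => ¬Q.card = 0).filter (fun Q : Finset α => Q.card = 1)
        = C.powersetCard 1 := by
    ext Q
    simp only [Finset.mem_filter, Finset.mem_powerset, Finset.mem_powersetCard]
    constructor
    · rintro ⟨⟨⟨hQC, -⟩, -⟩, h1⟩; exact ⟨hQC, h1⟩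
    · rintro ⟨hQC, h1⟩; exact ⟨⟨⟨hQC, by omega⟩, by omega⟩, h1⟩
  have h2 : ((C.powerset.filter fun Q : Finset α => Q.card ≤ 4).filter
      fun Q : Finset α => ¬Q.card = 0).filter (fun Q : Finset α => ¬Q.card = 1)
        = C.powerset.filter fun Q : Finset α => 2 ≤ Q.card ∧ Q.card ≤ 4 := by
    ext Q
    simp only [Finset.mem_filter, Finset.mem_powerset]
    constructor
    · rintro ⟨⟨⟨hQC, h4⟩, h0⟩, h1⟩; exact ⟨hQC, by omega, h4⟩
    · rintro ⟨hQC, h2, h4⟩; exact ⟨⟨⟨hQC, h4⟩, by omega⟩, by omega⟩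
  rw [h0, h1, h2, Finset.sum_singleton, Finset.powersetCard_one, Finset.sum_map, add_assoc]
  simp only [Function.Embedding.coeFn_mk]

/-- **Weak duality for the second level of the Lasserre hierarchy** ("any feasible solution `K`
provides an upper bound on `k(n)`", §1, with the argument at the start of the proof of Lemma 5.1),
in abstract counting form: if the double sum `Σ_{J₁,J₂ ⊆ C, |Jᵢ| ≤ 2} K(J₁,J₂)` is nonnegative
(positivity of the kernel `K` tested against the sub-configurations of `C`), `A₂K({x}) ≤ -1` for
`x ∈ C` and `A₂K(Q) ≤ 0` for `Q ⊆ C` with `2 ≤ |Q| ≤ 4`, then `|C| ≤ K(∅, ∅)`: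
`0 ≤ Σ K(J₁,J₂) = Σ_Q A₂K(Q) ≤ K(∅,∅) - |C|`.
[cite: DeLaatLeijenhorstDeMuinckKeizer2024, §1 (eq. (1)) and §5.1, proof of Lemma 5.1] -/
theorem lasserre2_card_le (K : Finset α → Finset α → ℝ) (C : Finset α)
    (hpos : 0 ≤ ∑ J₁ ∈ C.powerset with J₁.card ≤ 2, ∑ J₂ ∈ C.powerset with J₂.card ≤ 2, K J₁ J₂)
    (h1 : ∀ x ∈ C, ∑ J₁ ∈ ({x} : Finset α).powerset with J₁.card ≤ 2,
      ∑ J₂ ∈ ({x} : Finset α).powerset with J₂.card ≤ 2 ∧ J₁ ∪ J₂ = {x}, K J₁ J₂ ≤ -1)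
    (h234 : ∀ Q ⊆ C, 2 ≤ Q.card → Q.card ≤ 4 → ∑ J₁ ∈ Q.powerset with J₁.card ≤ 2,
      ∑ J₂ ∈ Q.powerset with J₂.card ≤ 2 ∧ J₁ ∪ J₂ = Q, K J₁ J₂ ≤ 0) :
    (C.card : ℝ) ≤ K ∅ ∅ := by
  rw [lasserre2_sum_pairs_eq_sum_union, d4u_sum_card_le_four_split, lasserre2_union_sum_empty]
    at hpos
  have hS1 : ∑ x ∈ C, ∑ J₁ ∈ ({x} : Finset α).powerset with J₁.card ≤ 2,
      ∑ J₂ ∈ ({x} : Finset α).powerset with J₂.card ≤ 2 ∧ J₁ ∪ J₂ = {x}, K J₁ J₂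
        ≤ ∑ x ∈ C, (-1 : ℝ) := Finset.sum_le_sum h1
  have hS2 : ∑ Q ∈ C.powerset with 2 ≤ Q.card ∧ Q.card ≤ 4, ∑ J₁ ∈ Q.powerset with J₁.card ≤ 2,
      ∑ J₂ ∈ Q.powerset with J₂.card ≤ 2 ∧ J₁ ∪ J₂ = Q, K J₁ J₂ ≤ 0 :=
    Finset.sum_nonpos fun Q hQ => by
      simp only [Finset.mem_filter, Finset.mem_powerset] at hQ
      exact h234 Q hQ.1 hQ.2.1 hQ.2.2
  simp only [Finset.sum_const, smul_neg, nsmul_eq_mul, mul_one] at hS1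
  linarith

/-- **Complementary slackness at a sharp bound.** If moreover `K(∅, ∅) ≤ |C|` (so the bound of
`lasserre2_card_le` is attained), then "equality holds throughout, so in particular
`A₂K(Q) = 0` for all `Q ⊆ C`" with `2 ≤ |Q| ≤ 4` (proof of Lemma 5.1).
[cite: DeLaatLeijenhorstDeMuinckKeizer2024, §5.1, proof of Lemma 5.1] -/
theorem lasserre2_union_sum_eq_zero_of_sharp (K : Finset α → Finset α → ℝ) (C : Finset α)
    (hpos : 0 ≤ ∑ J₁ ∈ C.powerset with J₁.card ≤ 2, ∑ J₂ ∈ C.powerset with J₂.card ≤ 2, K J₁ J₂)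
    (h1 : ∀ x ∈ C, ∑ J₁ ∈ ({x} : Finset α).powerset with J₁.card ≤ 2,
      ∑ J₂ ∈ ({x} : Finset α).powerset with J₂.card ≤ 2 ∧ J₁ ∪ J₂ = {x}, K J₁ J₂ ≤ -1)
    (h234 : ∀ Q ⊆ C, 2 ≤ Q.card → Q.card ≤ 4 → ∑ J₁ ∈ Q.powerset with J₁.card ≤ 2,
      ∑ J₂ ∈ Q.powerset with J₂.card ≤ 2 ∧ J₁ ∪ J₂ = Q, K J₁ J₂ ≤ 0)
    (hsharp : K ∅ ∅ ≤ C.card) {Q : Finset α} (hQC : Q ⊆ C) (h2 : 2 ≤ Q.card) (h4 : Q.card ≤ 4) :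
    ∑ J₁ ∈ Q.powerset with J₁.card ≤ 2,
      ∑ J₂ ∈ Q.powerset with J₂.card ≤ 2 ∧ J₁ ∪ J₂ = Q, K J₁ J₂ = 0 := by
  rw [lasserre2_sum_pairs_eq_sum_union, d4u_sum_card_le_four_split, lasserre2_union_sum_empty]
    at hpos
  have hS1 : ∑ x ∈ C, ∑ J₁ ∈ ({x} : Finset α).powerset with J₁.card ≤ 2,
      ∑ J₂ ∈ ({x} : Finset α).powerset with J₂.card ≤ 2 ∧ J₁ ∪ J₂ = {x}, K J₁ J₂
        ≤ ∑ x ∈ C, (-1 : ℝ) := Finset.sum_le_sum h1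
  have hle : ∀ Q ∈ C.powerset.filter (fun Q : Finset α => 2 ≤ Q.card ∧ Q.card ≤ 4),
      ∑ J₁ ∈ Q.powerset with J₁.card ≤ 2,
        ∑ J₂ ∈ Q.powerset with J₂.card ≤ 2 ∧ J₁ ∪ J₂ = Q, K J₁ J₂ ≤ 0 := fun Q hQ => by
    simp only [Finset.mem_filter, Finset.mem_powerset] at hQ
    exact h234 Q hQ.1 hQ.2.1 hQ.2.2
  have hS2 := Finset.sum_nonpos hle
  simp only [Finset.sum_const, smul_neg, nsmul_eq_mul, mul_one] at hS1
  have hzero : ∑ Q ∈ C.powerset with 2 ≤ Q.card ∧ Q.card ≤ 4, ∑ J₁ ∈ Q.powerset with J₁.card ≤ 2,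
      ∑ J₂ ∈ Q.powerset with J₂.card ≤ 2 ∧ J₁ ∪ J₂ = Q, K J₁ J₂ = 0 := by
    linarith
  exact (Finset.sum_eq_zero_iff_of_nonpos hle).1 hzero Q
    (Finset.mem_filter.2 ⟨Finset.mem_powerset.2 hQC, h2, h4⟩)

omit [DecidableEq α] in
/-- A positive semidefinite kernel on finite sets (the hypothesis `K ∈ 𝒞(I₂ × I₂)_{⪰ 0}` of the
Lasserre program, tested on finitely supported vectors) has nonnegative double sum over the
`≤ 2`-element subsets of any `C` — the only consequence of positivity used in the proof of
Lemma 5.1 (take the indicator vector of `{J ⊆ C : |J| ≤ 2}`).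
[cite: DeLaatLeijenhorstDeMuinckKeizer2024, §1 eq. (1) and §5.1, proof of Lemma 5.1] -/
theorem lasserre2_sum_pairs_nonneg_of_posSemidef (K : Finset α → Finset α → ℝ)
    (hK : ∀ (s : Finset (Finset α)) (a : Finset α → ℝ),
      0 ≤ ∑ J₁ ∈ s, ∑ J₂ ∈ s, a J₁ * a J₂ * K J₁ J₂)
    (C : Finset α) :
    0 ≤ ∑ J₁ ∈ C.powerset with J₁.card ≤ 2, ∑ J₂ ∈ C.powerset with J₂.card ≤ 2, K J₁ J₂ := by
  simpa using hK (C.powerset.filter fun J : Finset α => J.card ≤ 2) (fun _ => 1)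

variable [DecidableEq F]

/-- **Any feasible solution of the second Lasserre level bounds every kissing configuration**
("Any feasible solution `K` provides an upper bound on `k(n)`", §1): if `K` is a kernel on finite
subsets of the sphere whose double sum over the `≤ 2`-element sub-configurations of every
`θ`-code is nonnegative (positivity), with `A₂K({x}) ≤ -1` for unit `x` and `A₂K(Q) ≤ 0` for every
code `Q` with `2 ≤ |Q| ≤ 4` (the constraints of program (1) for `t = 2`), then every finite code
`C` (unit vectors with pairwise inner products `≤ c = cos θ`) has `|C| ≤ K(∅, ∅)`. Any real inner
product space, any `c`. [cite: DeLaatLeijenhorstDeMuinckKeizer2024, §1 (program (1), t = 2) and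
§5.1, proof of Lemma 5.1] -/
theorem lasserre2_code_card_le (K : Finset F → Finset F → ℝ) (c : ℝ)
    (hpos : ∀ C : Finset F, (∀ x ∈ C, ‖x‖ = 1) → (∀ x ∈ C, ∀ y ∈ C, x ≠ y → ⟪x, y⟫ ≤ c) →
      0 ≤ ∑ J₁ ∈ C.powerset with J₁.card ≤ 2, ∑ J₂ ∈ C.powerset with J₂.card ≤ 2, K J₁ J₂)
    (h1 : ∀ x : F, ‖x‖ = 1 → ∑ J₁ ∈ ({x} : Finset F).powerset with J₁.card ≤ 2,
      ∑ J₂ ∈ ({x} : Finset F).powerset with J₂.card ≤ 2 ∧ J₁ ∪ J₂ = {x}, K J₁ J₂ ≤ -1)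
    (h234 : ∀ Q : Finset F, (∀ x ∈ Q, ‖x‖ = 1) → (∀ x ∈ Q, ∀ y ∈ Q, x ≠ y → ⟪x, y⟫ ≤ c) →
      2 ≤ Q.card → Q.card ≤ 4 → ∑ J₁ ∈ Q.powerset with J₁.card ≤ 2,
        ∑ J₂ ∈ Q.powerset with J₂.card ≤ 2 ∧ J₁ ∪ J₂ = Q, K J₁ J₂ ≤ 0)
    (C : Finset F) (hC1 : ∀ x ∈ C, ‖x‖ = 1) (hCc : ∀ x ∈ C, ∀ y ∈ C, x ≠ y → ⟪x, y⟫ ≤ c) :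
    (C.card : ℝ) ≤ K ∅ ∅ :=
  lasserre2_card_le K C (hpos C hC1 hCc) (fun x hx => h1 x (hC1 x hx))
    fun Q hQC h2 h4 => h234 Q (fun x hx => hC1 x (hQC hx))
      (fun x hx y hy hxy => hCc x (hQC hx) y (hQC hy) hxy) h2 h4

/-- **Lemma 5.1 from the certificate (the printed proof of Lemma 5.1).** Let `K` be a kernel on
finite subsets of `𝕊³` (here: of the unit sphere of any real inner product space) which is
feasible for the second level of the Lasserre hierarchy for the kissing number problem —
positivity (tested on the sub-configurations of every `π/3`-code), `A₂K({x}) ≤ -1`, `A₂K(Q) ≤ 0`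
for codes `Q` with `2 ≤ |Q| ≤ 4` — with objective `K(∅, ∅) ≤ 24` (the exact solution has
`K(∅, ∅) = 24`), and such that for distinct unit `x, y` with `⟪x, y⟫ ≤ 1/2`, `A₂K({x, y}) = 0` only
if `⟪x, y⟫ ∈ {-1, ±1/2, 0}` (the Sturm-sequence fact about `p₂`). Then every `24`-point `π/3`-code
has all inner products of distinct members in `{-1, -1/2, 0, 1/2}`: "`0 ≤ Σ K(J₁,J₂) = Σ A₂K(Q) ≤
K(∅,∅) - |C|`; since `|C| = K(∅,∅) = 24`, equality holds throughout, so `A₂K(Q) = 0` for all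
`Q ⊆ C` … which proves the lemma." The existence of such a `K` is the paper's exact SDP
certificate (§2–§4, data doi:10.4121/74ce1c25-6fca-4680-8a36-e9c18e7e9594) and is NOT formalised.
[cite: DeLaatLeijenhorstDeMuinckKeizer2024, §5.1, Lemma 5.1 and its proof] -/
theorem dlldmk2024_lemma51_of_lasserre2_certificate (K : Finset F → Finset F → ℝ)
    (hpos : ∀ C : Finset F, (∀ x ∈ C, ‖x‖ = 1) → (∀ x ∈ C, ∀ y ∈ C, x ≠ y → ⟪x, y⟫ ≤ 1 / 2) →
      0 ≤ ∑ J₁ ∈ C.powerset with J₁.card ≤ 2, ∑ J₂ ∈ C.powerset with J₂.card ≤ 2, K J₁ J₂)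
    (hobj : K ∅ ∅ ≤ 24)
    (h1 : ∀ x : F, ‖x‖ = 1 → ∑ J₁ ∈ ({x} : Finset F).powerset with J₁.card ≤ 2,
      ∑ J₂ ∈ ({x} : Finset F).powerset with J₂.card ≤ 2 ∧ J₁ ∪ J₂ = {x}, K J₁ J₂ ≤ -1)
    (h234 : ∀ Q : Finset F, (∀ x ∈ Q, ‖x‖ = 1) → (∀ x ∈ Q, ∀ y ∈ Q, x ≠ y → ⟪x, y⟫ ≤ 1 / 2) →
      2 ≤ Q.card → Q.card ≤ 4 → ∑ J₁ ∈ Q.powerset with J₁.card ≤ 2,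
        ∑ J₂ ∈ Q.powerset with J₂.card ≤ 2 ∧ J₁ ∪ J₂ = Q, K J₁ J₂ ≤ 0)
    (hroots : ∀ x y : F, ‖x‖ = 1 → ‖y‖ = 1 → x ≠ y → ⟪x, y⟫ ≤ 1 / 2 →
      ∑ J₁ ∈ ({x, y} : Finset F).powerset with J₁.card ≤ 2,
        ∑ J₂ ∈ ({x, y} : Finset F).powerset with J₂.card ≤ 2 ∧ J₁ ∪ J₂ = {x, y}, K J₁ J₂ = 0 →
      (⟪x, y⟫ = -1 ∨ ⟪x, y⟫ = -1 / 2 ∨ ⟪x, y⟫ = 0 ∨ ⟪x, y⟫ = 1 / 2))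
    (C : Finset F) (hC : C.card = 24) (hC1 : ∀ x ∈ C, ‖x‖ = 1)
    (hCle : ∀ x ∈ C, ∀ y ∈ C, x ≠ y → ⟪x, y⟫ ≤ 1 / 2) :
    ∀ x ∈ C, ∀ y ∈ C, x ≠ y → (⟪x, y⟫ = -1 ∨ ⟪x, y⟫ = -1 / 2 ∨ ⟪x, y⟫ = 0 ∨ ⟪x, y⟫ = 1 / 2) := by
  intro x hx y hy hxy
  refine hroots x y (hC1 x hx) (hC1 y hy) hxy (hCle x hx y hy hxy) ?_
  have hsharp : K ∅ ∅ ≤ C.card := by rw [hC]; exact_mod_cast hobj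
  have hQC : ({x, y} : Finset F) ⊆ C := Finset.insert_subset hx (Finset.singleton_subset_iff.2 hy)
  have hQ2 : ({x, y} : Finset F).card = 2 := Finset.card_pair hxy
  exact lasserre2_union_sum_eq_zero_of_sharp K C (hpos C hC1 hCle) (fun z hz => h1 z (hC1 z hz))
    (fun Q hQ h2 h4 => h234 Q (fun z hz => hC1 z (hQ hz))
      (fun a ha b hb hab => hCle a (hQ ha) b (hQ hb) hab) h2 h4)
    hsharp hQC (by omega) (by omega)

end LasserreDuality

section LasserrePositivity

variable {α : Type*}

/-- Moving a finite sum out of a double sum: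
`Σ_{x∈s} Σ_{y∈s} Σ_{k∈t} f = Σ_{k∈t} Σ_{x∈s} Σ_{y∈s} f`. [folklore] -/
theorem d4u_sum3_comm {κ : Type*} (s : Finset α) (t : Finset κ) (f : κ → α → α → ℝ) :
    ∑ x ∈ s, ∑ y ∈ s, ∑ k ∈ t, f k x y = ∑ k ∈ t, ∑ x ∈ s, ∑ y ∈ s, f k x y :=
  calc ∑ x ∈ s, ∑ y ∈ s, ∑ k ∈ t, f k x y
      = ∑ x ∈ s, ∑ k ∈ t, ∑ y ∈ s, f k x y := Finset.sum_congr rfl fun _ _ => Finset.sum_comm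
    _ = ∑ k ∈ t, ∑ x ∈ s, ∑ y ∈ s, f k x y := Finset.sum_comm

/-- Expanding `⟪Σ_J c_J φ(J), Σ_J c_J φ'(J)⟫`. [folklore] -/
theorem d4u_inner_sum_smul (s : Finset α) (c : α → ℝ) (φ φ' : α → F) :
    (⟪∑ J ∈ s, c J • φ J, ∑ J ∈ s, c J • φ' J⟫ : ℝ)
      = ∑ J₁ ∈ s, ∑ J₂ ∈ s, c J₁ * c J₂ * (⟪φ J₁, φ' J₂⟫ : ℝ) := by
  rw [sum_inner]
  refine Finset.sum_congr rfl fun J₁ _ => ?_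
  rw [inner_sum]
  refine Finset.sum_congr rfl fun J₂ _ => ?_
  rw [real_inner_smul_left, real_inner_smul_right]
  ring

/-- **Gram kernels are positive.** A kernel of the form `K(J₁, J₂) = Σ_{k ∈ t} ⟪φ_k(J₁), φ_k(J₂)⟫`
(finitely many feature maps `φ_k` into a real inner product space) is positive semidefinite on
finitely supported vectors: `Σ_{J₁,J₂ ∈ s} c_{J₁} c_{J₂} K(J₁,J₂) = Σ_k ‖Σ_J c_J φ_k(J)‖² ≥ 0`.
This is the positivity mechanism of the certificate: `K = Σ_λ ⟨K̂_λ, Z_λ⟩` with `K̂_λ ⪰ 0` and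
`Z_λ(J₁,J₂)_{ℓ₁ℓ₂} = ⟪ψ_{λ,ℓ₁}(J₁), ψ_{λ,ℓ₂}(J₂)⟫` (§1; §2.4, definition of the zonal matrices) is
of this form (`lasserre2_inner_factor_gram`). [cite: DeLaatLeijenhorstDeMuinckKeizer2024, §1
("the kernel `K` … is continuous, positive, and `O(n)`-invariant") and §2.4] -/
theorem lasserre2_posSemidef_of_features {κ : Type*} (t : Finset κ) (φ : κ → α → F)
    (s : Finset α) (c : α → ℝ) :
    0 ≤ ∑ J₁ ∈ s, ∑ J₂ ∈ s, c J₁ * c J₂ * ∑ k ∈ t, (⟪φ k J₁, φ k J₂⟫ : ℝ) := by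
  have hre : ∑ J₁ ∈ s, ∑ J₂ ∈ s, c J₁ * c J₂ * ∑ k ∈ t, (⟪φ k J₁, φ k J₂⟫ : ℝ)
      = ∑ k ∈ t, ∑ J₁ ∈ s, ∑ J₂ ∈ s, c J₁ * c J₂ * (⟪φ k J₁, φ k J₂⟫ : ℝ) := by
    rw [← d4u_sum3_comm]
    exact Finset.sum_congr rfl fun J₁ _ => Finset.sum_congr rfl fun J₂ _ => Finset.mul_sum _ _ _
  rw [hre]
  refine Finset.sum_nonneg fun k _ => ?_
  rw [← d4u_inner_sum_smul s c (φ k) (φ k)]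
  exact real_inner_self_nonneg

/-- `⟨BᵀB, Z⟩` for a Gram matrix `Z_{ab} = ⟪ψ_a, ψ'_b⟫` is a sum of inner products of the combined
features `Σ_a B_{ka} ψ_a`: the trace pairing of a factored positive semidefinite matrix
`K̂ = BᵀB` (the rounded solution matrices are certified in the form `B X Bᵀ` with `X = LLᵀ` by a
Cholesky decomposition, §5.1) with a zonal (Gram) matrix.
[cite: DeLaatLeijenhorstDeMuinckKeizer2024, §1, §2.4, §5.1 (verification procedure)] -/
theorem lasserre2_inner_factor_gram {ι κ : Type*} [Fintype ι] [Fintype κ] (B : Matrix κ ι ℝ)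
    (ψ ψ' : ι → F) :
    ∑ a, ∑ b, (B.transpose * B) a b * (⟪ψ a, ψ' b⟫ : ℝ)
      = ∑ k, (⟪∑ a, B k a • ψ a, ∑ b, B k b • ψ' b⟫ : ℝ) := by
  have hR : ∀ k, (⟪∑ a, B k a • ψ a, ∑ b, B k b • ψ' b⟫ : ℝ)
      = ∑ a, ∑ b, B k a * B k b * (⟪ψ a, ψ' b⟫ : ℝ) := fun k =>
    d4u_inner_sum_smul Finset.univ (fun a => B k a) ψ ψ'
  simp_rw [hR, Matrix.mul_apply, Matrix.transpose_apply, Finset.sum_mul]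
  exact d4u_sum3_comm Finset.univ Finset.univ fun k a b => B k a * B k b * (⟪ψ a, ψ' b⟫ : ℝ)

/-- **The certificate's kernel is positive.** For a matrix `K̂ = BᵀB` (positive semidefinite, in
factored form) and feature maps `ψ_a : I → F`, the kernel
`K(J₁, J₂) = ⟨K̂, Z(J₁, J₂)⟩ = Σ_{a,b} K̂_{ab} ⟪ψ_a(J₁), ψ_b(J₂)⟫` built from the Gram ("zonal")
matrices `Z(J₁,J₂)_{ab} = ⟪ψ_a(J₁), ψ_b(J₂)⟫` is positive semidefinite on finitely supported
vectors; hence (`lasserre2_sum_pairs_nonneg_of_posSemidef`) it satisfies the positivity hypothesis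
of `dlldmk2024_lemma51_of_lasserre2_certificate`. A finite sum over `λ` of such kernels is again of
this form (block-diagonal `B`). [cite: DeLaatLeijenhorstDeMuinckKeizer2024, §1 ("Then the kernel
`K` defined by `K(J₁,J₂) = Σ_λ ⟨K̂_λ, Z_λ(J₁,J₂)⟩` is continuous, positive, and `O(n)`-invariant"),
§2.4 (zonal matrices), §5.1 (verification procedure)] -/
theorem lasserre2_posSemidef_of_factor_gram {ι κ : Type*} [Fintype ι] [Fintype κ]
    (B : Matrix κ ι ℝ) (ψ : ι → α → F) (s : Finset α) (c : α → ℝ) :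
    0 ≤ ∑ J₁ ∈ s, ∑ J₂ ∈ s,
      c J₁ * c J₂ * ∑ a, ∑ b, (B.transpose * B) a b * (⟪ψ a J₁, ψ b J₂⟫ : ℝ) := by
  simp_rw [lasserre2_inner_factor_gram]
  exact lasserre2_posSemidef_of_features Finset.univ (fun k J => ∑ a, B k a • ψ a J) s c

/-- Positive semidefinite kernels (on finitely supported vectors) form a convex cone: a finite sum
`K = Σ_{λ ∈ L} K_λ` of such kernels is again one — the passage from the blocks `⟨K̂_λ, Z_λ⟩` to
`K = Σ_{|λ| ≤ d₁} ⟨K̂_λ, Z_λ⟩`. [cite: DeLaatLeijenhorstDeMuinckKeizer2024, §1, §4] -/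
theorem lasserre2_posSemidef_sum {Λ : Type*} (L : Finset Λ) (K : Λ → α → α → ℝ)
    (hK : ∀ l ∈ L, ∀ (s : Finset α) (c : α → ℝ),
      0 ≤ ∑ J₁ ∈ s, ∑ J₂ ∈ s, c J₁ * c J₂ * K l J₁ J₂)
    (s : Finset α) (c : α → ℝ) :
    0 ≤ ∑ J₁ ∈ s, ∑ J₂ ∈ s, c J₁ * c J₂ * ∑ l ∈ L, K l J₁ J₂ := by
  simp_rw [Finset.mul_sum]
  rw [d4u_sum3_comm]
  exact Finset.sum_nonneg fun l hl => hK l hl s c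

end LasserrePositivity

section LasserreDualityE4

/-- **`k(4) ≤ K(∅, ∅)` for every feasible `K`; in particular the exact solution with
`K(∅, ∅) = 24` gives `k(4) ≤ 24` (`musin2008_kissing_four`).** "Any feasible solution `K`
provides an upper bound on `k(n)`" (§1), here for `n = 4`, `θ = π/3`, objective `≤ 24`.
[cite: DeLaatLeijenhorstDeMuinckKeizer2024, §1 and §5.1 ("an exact feasible solution `K` with
objective value `K(∅, ∅) = 24`")] -/
theorem musin2008_kissing_four_of_lasserre2_certificate
    (K : Finset (EuclideanSpace ℝ (Fin 4)) → Finset (EuclideanSpace ℝ (Fin 4)) → ℝ)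
    (hpos : ∀ C : Finset (EuclideanSpace ℝ (Fin 4)), (∀ x ∈ C, ‖x‖ = 1) →
      (∀ x ∈ C, ∀ y ∈ C, x ≠ y → ⟪x, y⟫ ≤ 1 / 2) →
      0 ≤ ∑ J₁ ∈ C.powerset with J₁.card ≤ 2, ∑ J₂ ∈ C.powerset with J₂.card ≤ 2, K J₁ J₂)
    (hobj : K ∅ ∅ ≤ 24)
    (h1 : ∀ x : EuclideanSpace ℝ (Fin 4), ‖x‖ = 1 →
      ∑ J₁ ∈ ({x} : Finset (EuclideanSpace ℝ (Fin 4))).powerset with J₁.card ≤ 2,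
        ∑ J₂ ∈ ({x} : Finset (EuclideanSpace ℝ (Fin 4))).powerset with
          J₂.card ≤ 2 ∧ J₁ ∪ J₂ = {x}, K J₁ J₂ ≤ -1)
    (h234 : ∀ Q : Finset (EuclideanSpace ℝ (Fin 4)), (∀ x ∈ Q, ‖x‖ = 1) →
      (∀ x ∈ Q, ∀ y ∈ Q, x ≠ y → ⟪x, y⟫ ≤ 1 / 2) → 2 ≤ Q.card → Q.card ≤ 4 →
      ∑ J₁ ∈ Q.powerset with J₁.card ≤ 2,
        ∑ J₂ ∈ Q.powerset with J₂.card ≤ 2 ∧ J₁ ∪ J₂ = Q, K J₁ J₂ ≤ 0) :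
    musin2008_kissing_four := by
  intro C hC1 hCle
  have h := lasserre2_code_card_le K (1 / 2) hpos h1 h234 C hC1 hCle
  exact_mod_cast h.trans hobj

/-- **Theorem 5.3 from the certificate.** The named fact `dlldmk2024_kissing_four_unique` follows
from the existence of a kernel `K` feasible for the second Lasserre level with `K(∅, ∅) ≤ 24` whose
pair constraint `A₂K({x, y})` vanishes on `[-1, 1/2]` only at `⟪x, y⟫ ∈ {-1, ±1/2, 0}`: Lemma 5.1
(`dlldmk2024_lemma51_of_lasserre2_certificate`) and then
`dlldmk2024_kissing_four_unique_of_lemma51`.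
What remains unformalised of the fact is thus exactly the verification of the paper's rational
certificate `K = Σ_λ ⟨K̂_λ, Z_λ⟩` (positivity via `K̂_λ ⪰ 0` and the zonal matrices of §2–§3; the
sums-of-squares identities for `p₁, …, p₄` of §4; the Sturm sequence for `p₂`).
[cite: DeLaatLeijenhorstDeMuinckKeizer2024, §5.1, Lemma 5.1, Theorem 5.3] -/
theorem dlldmk2024_kissing_four_unique_of_lasserre2_certificate
    (K : Finset (EuclideanSpace ℝ (Fin 4)) → Finset (EuclideanSpace ℝ (Fin 4)) → ℝ)
    (hpos : ∀ C : Finset (EuclideanSpace ℝ (Fin 4)), (∀ x ∈ C, ‖x‖ = 1) →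
      (∀ x ∈ C, ∀ y ∈ C, x ≠ y → ⟪x, y⟫ ≤ 1 / 2) →
      0 ≤ ∑ J₁ ∈ C.powerset with J₁.card ≤ 2, ∑ J₂ ∈ C.powerset with J₂.card ≤ 2, K J₁ J₂)
    (hobj : K ∅ ∅ ≤ 24)
    (h1 : ∀ x : EuclideanSpace ℝ (Fin 4), ‖x‖ = 1 →
      ∑ J₁ ∈ ({x} : Finset (EuclideanSpace ℝ (Fin 4))).powerset with J₁.card ≤ 2,
        ∑ J₂ ∈ ({x} : Finset (EuclideanSpace ℝ (Fin 4))).powerset with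
          J₂.card ≤ 2 ∧ J₁ ∪ J₂ = {x}, K J₁ J₂ ≤ -1)
    (h234 : ∀ Q : Finset (EuclideanSpace ℝ (Fin 4)), (∀ x ∈ Q, ‖x‖ = 1) →
      (∀ x ∈ Q, ∀ y ∈ Q, x ≠ y → ⟪x, y⟫ ≤ 1 / 2) → 2 ≤ Q.card → Q.card ≤ 4 →
      ∑ J₁ ∈ Q.powerset with J₁.card ≤ 2,
        ∑ J₂ ∈ Q.powerset with J₂.card ≤ 2 ∧ J₁ ∪ J₂ = Q, K J₁ J₂ ≤ 0)
    (hroots : ∀ x y : EuclideanSpace ℝ (Fin 4), ‖x‖ = 1 → ‖y‖ = 1 → x ≠ y → ⟪x, y⟫ ≤ 1 / 2 →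
      ∑ J₁ ∈ ({x, y} : Finset (EuclideanSpace ℝ (Fin 4))).powerset with J₁.card ≤ 2,
        ∑ J₂ ∈ ({x, y} : Finset (EuclideanSpace ℝ (Fin 4))).powerset with
          J₂.card ≤ 2 ∧ J₁ ∪ J₂ = {x, y}, K J₁ J₂ = 0 →
      (⟪x, y⟫ = -1 ∨ ⟪x, y⟫ = -1 / 2 ∨ ⟪x, y⟫ = 0 ∨ ⟪x, y⟫ = 1 / 2)) :
    dlldmk2024_kissing_four_unique :=
  dlldmk2024_kissing_four_unique_of_lemma51
    (dlldmk2024_lemma51_of_lasserre2_certificate K hpos hobj h1 h234 hroots)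

end LasserreDualityE4

/-! ### §4: the polynomial constraints `p₁ ≤ -1`, `p₂ ≤ 0` on `[-1, cos θ]`, `pᵢ ≤ 0` on `Δᵢ` -/

section SemialgebraicConstraints

/-- **Soundness of the sums-of-squares relaxation (§4).** If a constraint function `p` satisfies
an identity `p + Σ_k r_k g_k ≡ 0` on `Δ` in which every multiplier `r_k` is nonnegative (in §4: a
sum-of-squares polynomial; `g₀ = 1`) and every `g_k` is nonnegative on `Δ` (in §4: the polynomials
describing the semialgebraic set `Δᵢ`, resp. `(u + 1)(cos θ - u)` on `[-1, cos θ]`, eq. (lukacs)),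
then `p ≤ 0` on `Δ` — the (easy) direction of the Lukács/Putinar representation that makes program
(pr:semialgebraic) with sum-of-squares certificates a relaxation of the constraints `pᵢ ≤ 0` on `Δᵢ`.
Stated for arbitrary real functions. [cite: DeLaatLeijenhorstDeMuinckKeizer2024, §4 ("we relax the
polynomial inequality constraint to the identity `pᵢ(u) + Σ_k r_k(u) g_k(u) ≡ 0`")] -/
theorem lasserre2_nonpos_of_sos_certificate {X ι : Type*} (Δ : Set X) (p : X → ℝ) (s : Finset ι)
    (r g : ι → X → ℝ) (hr : ∀ k ∈ s, ∀ u ∈ Δ, 0 ≤ r k u) (hg : ∀ k ∈ s, ∀ u ∈ Δ, 0 ≤ g k u)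
    (hid : ∀ u ∈ Δ, p u + ∑ k ∈ s, r k u * g k u = 0) {u : X} (hu : u ∈ Δ) : p u ≤ 0 := by
  have h := hid u hu
  have hs : 0 ≤ ∑ k ∈ s, r k u * g k u :=
    Finset.sum_nonneg fun k hk => mul_nonneg (hr k hk u hu) (hg k hk u hu)
  linarith

/-- A sum-of-squares multiplier written through its Gram matrix, `s(u) = ⟨m(u) m(u)ᵀ, M⟩ =
m(u)ᵀ M m(u)` with `M ⪰ 0` ("we can write `s_k(u) = ⟨m_{δ/2-k}(u) m_{δ/2-k}(u)ᵀ, M_k⟩`, where `M_k`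
is a positive semidefinite matrix", §4), is nonnegative at every point.
[cite: DeLaatLeijenhorstDeMuinckKeizer2024, §4] -/
theorem lasserre2_sos_nonneg_of_posSemidef {X n : Type*} [Fintype n] {M : Matrix n n ℝ}
    (hM : M.PosSemidef) (m : X → n → ℝ) (u : X) : 0 ≤ dotProduct (m u) (M.mulVec (m u)) := by
  simpa using hM.dotProduct_mulVec_nonneg (m u)

/-- For unit vectors `-1 ≤ ⟪x, y⟫` (Cauchy–Schwarz), the lower end of the interval `[-1, cos θ]`
of §4. [folklore] -/
theorem d4u_neg_one_le_inner {x y : F} (hx : ‖x‖ = 1) (hy : ‖y‖ = 1) : -1 ≤ ⟪x, y⟫ := by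
  have h := abs_real_inner_le_norm x y
  rw [hx, hy, mul_one] at h
  exact (abs_le.1 h).1

/-- The box constraint of `Δᵢ` (§4: "`(u_j + 1)(cos θ - u_j) ≥ 0`") holds for the inner product of
two unit vectors at inner product `≤ cos θ`. [cite: DeLaatLeijenhorstDeMuinckKeizer2024, §4 (the
set `Δᵢ`)] -/
theorem d4u_box_nonneg {x y : F} (hx : ‖x‖ = 1) (hy : ‖y‖ = 1) {c : ℝ} (hxy : ⟪x, y⟫ ≤ c) :
    0 ≤ (⟪x, y⟫ + 1) * (c - ⟪x, y⟫) :=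
  mul_nonneg (by linarith [d4u_neg_one_le_inner hx hy]) (by linarith)

/-- The matrix `G₃` of §4 at `u = (⟪x, y⟫, ⟪x, z⟫, ⟪y, z⟫)` is the Gram matrix of the unit vectors
`x, y, z`. [cite: DeLaatLeijenhorstDeMuinckKeizer2024, §4 (the matrix `G₃`)] -/
theorem d4u_gram_three_eq {x y z : F} (hx : ‖x‖ = 1) (hy : ‖y‖ = 1) (hz : ‖z‖ = 1) :
    Matrix.gram ℝ ![x, y, z] =
      !![1, ⟪x, y⟫, ⟪x, z⟫; ⟪x, y⟫, 1, ⟪y, z⟫; ⟪x, z⟫, ⟪y, z⟫, 1] := by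
  ext i j
  fin_cases i <;> fin_cases j <;>
    simp [Matrix.gram_apply, hx, hy, hz, real_inner_comm]

/-- `det G₃ ≥ 0` at the inner products of three unit vectors (a Gram determinant): the
determinant constraint of `Δ₃` (§4) is satisfied by every sub-configuration.
[cite: DeLaatLeijenhorstDeMuinckKeizer2024, §4 (the set `Δ₃`)] -/
theorem d4u_det_gram_three_nonneg {x y z : F} (hx : ‖x‖ = 1) (hy : ‖y‖ = 1) (hz : ‖z‖ = 1) :
    0 ≤ Matrix.det !![1, ⟪x, y⟫, ⟪x, z⟫; ⟪x, y⟫, 1, ⟪y, z⟫; ⟪x, z⟫, ⟪y, z⟫, 1] := by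
  rw [← d4u_gram_three_eq hx hy hz]
  exact (Matrix.posSemidef_gram ℝ _).det_nonneg

/-- The determinant constraint of `Δ₃` written out:
`det G₃ = 1 + 2 u₁ u₂ u₃ - u₁² - u₂² - u₃²`. [folklore] -/
theorem d4u_det_three_eq (a b c : ℝ) :
    Matrix.det !![1, a, b; a, 1, c; b, c, 1] = 1 + 2 * a * b * c - a ^ 2 - b ^ 2 - c ^ 2 := by
  rw [Matrix.det_fin_three]
  simp
  ring

/-- The matrix `G₄` of §4 at `u = (⟪x, y⟫, ⟪x, z⟫, ⟪x, w⟫, ⟪y, z⟫, ⟪y, w⟫, ⟪z, w⟫)` is the Gram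
matrix of the unit vectors `x, y, z, w`. [cite: DeLaatLeijenhorstDeMuinckKeizer2024, §4 (the matrix
`G₄`)] -/
theorem d4u_gram_four_eq {x y z w : F} (hx : ‖x‖ = 1) (hy : ‖y‖ = 1) (hz : ‖z‖ = 1)
    (hw : ‖w‖ = 1) :
    Matrix.gram ℝ ![x, y, z, w] =
      !![1, ⟪x, y⟫, ⟪x, z⟫, ⟪x, w⟫; ⟪x, y⟫, 1, ⟪y, z⟫, ⟪y, w⟫; ⟪x, z⟫, ⟪y, z⟫, 1, ⟪z, w⟫;
        ⟪x, w⟫, ⟪y, w⟫, ⟪z, w⟫, 1] := by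
  ext i j
  fin_cases i <;> fin_cases j <;>
    simp [Matrix.gram_apply, hx, hy, hz, hw, real_inner_comm]

/-- `det G₄ ≥ 0` at the inner products of four unit vectors (a Gram determinant): the `4 × 4`
determinant constraint of `Δ₄` (§4) is satisfied by every sub-configuration.
[cite: DeLaatLeijenhorstDeMuinckKeizer2024, §4 (the set `Δ₄`)] -/
theorem d4u_det_gram_four_nonneg {x y z w : F} (hx : ‖x‖ = 1) (hy : ‖y‖ = 1) (hz : ‖z‖ = 1)
    (hw : ‖w‖ = 1) :
    0 ≤ Matrix.det !![1, ⟪x, y⟫, ⟪x, z⟫, ⟪x, w⟫; ⟪x, y⟫, 1, ⟪y, z⟫, ⟪y, w⟫;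
      ⟪x, z⟫, ⟪y, z⟫, 1, ⟪z, w⟫; ⟪x, w⟫, ⟪y, w⟫, ⟪z, w⟫, 1] := by
  rw [← d4u_gram_four_eq hx hy hz hw]
  exact (Matrix.posSemidef_gram ℝ _).det_nonneg

variable [DecidableEq F]

/-- **The constraints `A₂K(Q) ≤ 0` (`2 ≤ |Q| ≤ 4`) of program (1) from the polynomial constraints of
program (pr:semialgebraic) (§4).** Suppose the two-, three- and four-point values of `A₂K` on codes
are given by functions `p₂, p₃, p₄` of the inner products ("we can find polynomials `p₁, …, p₄` in
`0`, `1`, `3`, and `6` variables such that `p₂(⟨x₁,x₂⟩) = A₂K({x₁,x₂})`,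
`p₃(⟨x₁,x₂⟩, ⟨x₁,x₃⟩, ⟨x₂,x₃⟩) = A₂K({x₁,x₂,x₃})`, `p₄(⟨x₁,x₂⟩, …, ⟨x₃,x₄⟩) = A₂K({x₁,…,x₄})`")
and that `p₂ ≤ 0` on `[-1, cos θ]`, `p₃ ≤ 0` on `Δ₃` and `p₄ ≤ 0` on `Δ₄`, where `Δᵢ` is the set of
`u` with `(u_j + 1)(cos θ - u_j) ≥ 0` for all `j` and all principal minors of size `≥ 3` of `Gᵢ`
nonnegative (`G₃ = [[1,u₁,u₂],[u₁,1,u₃],[u₂,u₃,1]]`,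
`G₄ = [[1,u₁,u₂,u₃],[u₁,1,u₄,u₅],[u₂,u₄,1,u₆],[u₃,u₅,u₆,1]]`). Then `A₂K(Q) ≤ 0` for every code
`Q` (unit vectors, pairwise inner products `≤ cos θ`) with `2 ≤ |Q| ≤ 4`: the inner products of a
code lie in `[-1, cos θ]` and its Gram minors are nonnegative. Any real inner product space, any
`cos θ = c`. [cite: DeLaatLeijenhorstDeMuinckKeizer2024, §4 (program (pr:semialgebraic), the sets
`Δ₃`, `Δ₄`)] -/
theorem lasserre2_union_sum_nonpos_of_polynomials (K : Finset F → Finset F → ℝ) (c : ℝ)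
    (p₂ : ℝ → ℝ) (p₃ : ℝ → ℝ → ℝ → ℝ) (p₄ : ℝ → ℝ → ℝ → ℝ → ℝ → ℝ → ℝ)
    (hK2 : ∀ x y : F, ‖x‖ = 1 → ‖y‖ = 1 → x ≠ y → ⟪x, y⟫ ≤ c →
      ∑ J₁ ∈ ({x, y} : Finset F).powerset with J₁.card ≤ 2,
        ∑ J₂ ∈ ({x, y} : Finset F).powerset with J₂.card ≤ 2 ∧ J₁ ∪ J₂ = {x, y}, K J₁ J₂
          = p₂ ⟪x, y⟫)
    (hK3 : ∀ x y z : F, ‖x‖ = 1 → ‖y‖ = 1 → ‖z‖ = 1 → x ≠ y → x ≠ z → y ≠ z →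
      ⟪x, y⟫ ≤ c → ⟪x, z⟫ ≤ c → ⟪y, z⟫ ≤ c →
      ∑ J₁ ∈ ({x, y, z} : Finset F).powerset with J₁.card ≤ 2,
        ∑ J₂ ∈ ({x, y, z} : Finset F).powerset with J₂.card ≤ 2 ∧ J₁ ∪ J₂ = {x, y, z}, K J₁ J₂
          = p₃ ⟪x, y⟫ ⟪x, z⟫ ⟪y, z⟫)
    (hK4 : ∀ x y z w : F, ‖x‖ = 1 → ‖y‖ = 1 → ‖z‖ = 1 → ‖w‖ = 1 → x ≠ y → x ≠ z → x ≠ w →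
      y ≠ z → y ≠ w → z ≠ w → ⟪x, y⟫ ≤ c → ⟪x, z⟫ ≤ c → ⟪x, w⟫ ≤ c → ⟪y, z⟫ ≤ c →
      ⟪y, w⟫ ≤ c → ⟪z, w⟫ ≤ c →
      ∑ J₁ ∈ ({x, y, z, w} : Finset F).powerset with J₁.card ≤ 2,
        ∑ J₂ ∈ ({x, y, z, w} : Finset F).powerset with J₂.card ≤ 2 ∧ J₁ ∪ J₂ = {x, y, z, w},
          K J₁ J₂ = p₄ ⟪x, y⟫ ⟪x, z⟫ ⟪x, w⟫ ⟪y, z⟫ ⟪y, w⟫ ⟪z, w⟫)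
    (hp2 : ∀ u : ℝ, -1 ≤ u → u ≤ c → p₂ u ≤ 0)
    (hp3 : ∀ u₁ u₂ u₃ : ℝ, 0 ≤ (u₁ + 1) * (c - u₁) → 0 ≤ (u₂ + 1) * (c - u₂) →
      0 ≤ (u₃ + 1) * (c - u₃) → 0 ≤ Matrix.det !![1, u₁, u₂; u₁, 1, u₃; u₂, u₃, 1] →
      p₃ u₁ u₂ u₃ ≤ 0)
    (hp4 : ∀ u₁ u₂ u₃ u₄ u₅ u₆ : ℝ, 0 ≤ (u₁ + 1) * (c - u₁) → 0 ≤ (u₂ + 1) * (c - u₂) →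
      0 ≤ (u₃ + 1) * (c - u₃) → 0 ≤ (u₄ + 1) * (c - u₄) → 0 ≤ (u₅ + 1) * (c - u₅) →
      0 ≤ (u₆ + 1) * (c - u₆) →
      0 ≤ Matrix.det !![1, u₁, u₂; u₁, 1, u₄; u₂, u₄, 1] →
      0 ≤ Matrix.det !![1, u₁, u₃; u₁, 1, u₅; u₃, u₅, 1] →
      0 ≤ Matrix.det !![1, u₂, u₃; u₂, 1, u₆; u₃, u₆, 1] →
      0 ≤ Matrix.det !![1, u₄, u₅; u₄, 1, u₆; u₅, u₆, 1] →
      0 ≤ Matrix.det !![1, u₁, u₂, u₃; u₁, 1, u₄, u₅; u₂, u₄, 1, u₆; u₃, u₅, u₆, 1] →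
      p₄ u₁ u₂ u₃ u₄ u₅ u₆ ≤ 0)
    (Q : Finset F) (hQ1 : ∀ x ∈ Q, ‖x‖ = 1) (hQc : ∀ x ∈ Q, ∀ y ∈ Q, x ≠ y → ⟪x, y⟫ ≤ c)
    (h2 : 2 ≤ Q.card) (h4 : Q.card ≤ 4) :
    ∑ J₁ ∈ Q.powerset with J₁.card ≤ 2,
      ∑ J₂ ∈ Q.powerset with J₂.card ≤ 2 ∧ J₁ ∪ J₂ = Q, K J₁ J₂ ≤ 0 := by
  have hcard : Q.card = 2 ∨ Q.card = 3 ∨ Q.card = 4 := by omega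
  rcases hcard with hc | hc | hc
  · obtain ⟨x, y, hxy, rfl⟩ := Finset.card_eq_two.1 hc
    have hx : ‖x‖ = 1 := hQ1 x (by simp)
    have hy : ‖y‖ = 1 := hQ1 y (by simp)
    have hxyc : ⟪x, y⟫ ≤ c := hQc x (by simp) y (by simp) hxy
    rw [hK2 x y hx hy hxy hxyc]
    exact hp2 _ (d4u_neg_one_le_inner hx hy) hxyc
  · obtain ⟨x, y, z, hxy, hxz, hyz, rfl⟩ := Finset.card_eq_three.1 hc
    have hx : ‖x‖ = 1 := hQ1 x (by simp)
    have hy : ‖y‖ = 1 := hQ1 y (by simp)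
    have hz : ‖z‖ = 1 := hQ1 z (by simp)
    have hxyc : ⟪x, y⟫ ≤ c := hQc x (by simp) y (by simp) hxy
    have hxzc : ⟪x, z⟫ ≤ c := hQc x (by simp) z (by simp) hxz
    have hyzc : ⟪y, z⟫ ≤ c := hQc y (by simp) z (by simp) hyz
    rw [hK3 x y z hx hy hz hxy hxz hyz hxyc hxzc hyzc]
    exact hp3 _ _ _ (d4u_box_nonneg hx hy hxyc) (d4u_box_nonneg hx hz hxzc)
      (d4u_box_nonneg hy hz hyzc) (d4u_det_gram_three_nonneg hx hy hz)
  · obtain ⟨x, y, z, w, hxy, hxz, hxw, hyz, hyw, hzw, rfl⟩ := Finset.card_eq_four.1 hc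
    have hx : ‖x‖ = 1 := hQ1 x (by simp)
    have hy : ‖y‖ = 1 := hQ1 y (by simp)
    have hz : ‖z‖ = 1 := hQ1 z (by simp)
    have hw : ‖w‖ = 1 := hQ1 w (by simp)
    have hxyc : ⟪x, y⟫ ≤ c := hQc x (by simp) y (by simp) hxy
    have hxzc : ⟪x, z⟫ ≤ c := hQc x (by simp) z (by simp) hxz
    have hxwc : ⟪x, w⟫ ≤ c := hQc x (by simp) w (by simp) hxw
    have hyzc : ⟪y, z⟫ ≤ c := hQc y (by simp) z (by simp) hyz
    have hywc : ⟪y, w⟫ ≤ c := hQc y (by simp) w (by simp) hyw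
    have hzwc : ⟪z, w⟫ ≤ c := hQc z (by simp) w (by simp) hzw
    rw [hK4 x y z w hx hy hz hw hxy hxz hxw hyz hyw hzw hxyc hxzc hxwc hyzc hywc hzwc]
    exact hp4 _ _ _ _ _ _ (d4u_box_nonneg hx hy hxyc) (d4u_box_nonneg hx hz hxzc)
      (d4u_box_nonneg hx hw hxwc) (d4u_box_nonneg hy hz hyzc) (d4u_box_nonneg hy hw hywc)
      (d4u_box_nonneg hz hw hzwc) (d4u_det_gram_three_nonneg hx hy hz)
      (d4u_det_gram_three_nonneg hx hy hw) (d4u_det_gram_three_nonneg hx hz hw)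
      (d4u_det_gram_three_nonneg hy hz hw) (d4u_det_gram_four_nonneg hx hy hz hw)


/-- **Any solution of program (pr:semialgebraic) bounds every code: `|C| ≤ K(∅, ∅)`** (§4 with §1,
"any feasible solution `K` provides an upper bound on `k(n)`"). Hypotheses: positivity of `K`
(tested on the sub-configurations of codes), the identification of `A₂K` on codes of sizes
`1, 2, 3, 4` with `p₁, p₂(u), p₃(u₁,u₂,u₃), p₄(u₁,…,u₆)`, and the constraints of program
(pr:semialgebraic): `p₁ ≤ -1`, `p₂ ≤ 0` on `[-1, cos θ]`, `p₃ ≤ 0` on `Δ₃`, `p₄ ≤ 0` on `Δ₄`.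
Any real inner product space (so any dimension `n`), any `cos θ = c`; e.g. §5.2 uses `n = 6`,
`cos θ = 1/2` and a strictly feasible solution with `K(∅, ∅) = 77.85` to get `k(6) ≤ 77`.
[cite: DeLaatLeijenhorstDeMuinckKeizer2024, §4 (program (pr:semialgebraic)), §1, §5.2] -/
theorem lasserre2_code_card_le_of_polynomials (K : Finset F → Finset F → ℝ) (c : ℝ)
    (hpos : ∀ C : Finset F, (∀ x ∈ C, ‖x‖ = 1) → (∀ x ∈ C, ∀ y ∈ C, x ≠ y → ⟪x, y⟫ ≤ c) →
      0 ≤ ∑ J₁ ∈ C.powerset with J₁.card ≤ 2, ∑ J₂ ∈ C.powerset with J₂.card ≤ 2, K J₁ J₂)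
    (p₁ : ℝ) (p₂ : ℝ → ℝ) (p₃ : ℝ → ℝ → ℝ → ℝ) (p₄ : ℝ → ℝ → ℝ → ℝ → ℝ → ℝ → ℝ)
    (hK1 : ∀ x : F, ‖x‖ = 1 →
      ∑ J₁ ∈ ({x} : Finset F).powerset with J₁.card ≤ 2,
        ∑ J₂ ∈ ({x} : Finset F).powerset with J₂.card ≤ 2 ∧ J₁ ∪ J₂ = {x}, K J₁ J₂ = p₁)
    (hK2 : ∀ x y : F, ‖x‖ = 1 → ‖y‖ = 1 → x ≠ y → ⟪x, y⟫ ≤ c →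
      ∑ J₁ ∈ ({x, y} : Finset F).powerset with J₁.card ≤ 2,
        ∑ J₂ ∈ ({x, y} : Finset F).powerset with J₂.card ≤ 2 ∧ J₁ ∪ J₂ = {x, y}, K J₁ J₂
          = p₂ ⟪x, y⟫)
    (hK3 : ∀ x y z : F, ‖x‖ = 1 → ‖y‖ = 1 → ‖z‖ = 1 → x ≠ y → x ≠ z → y ≠ z →
      ⟪x, y⟫ ≤ c → ⟪x, z⟫ ≤ c → ⟪y, z⟫ ≤ c →
      ∑ J₁ ∈ ({x, y, z} : Finset F).powerset with J₁.card ≤ 2,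
        ∑ J₂ ∈ ({x, y, z} : Finset F).powerset with J₂.card ≤ 2 ∧ J₁ ∪ J₂ = {x, y, z}, K J₁ J₂
          = p₃ ⟪x, y⟫ ⟪x, z⟫ ⟪y, z⟫)
    (hK4 : ∀ x y z w : F, ‖x‖ = 1 → ‖y‖ = 1 → ‖z‖ = 1 → ‖w‖ = 1 → x ≠ y → x ≠ z → x ≠ w →
      y ≠ z → y ≠ w → z ≠ w → ⟪x, y⟫ ≤ c → ⟪x, z⟫ ≤ c → ⟪x, w⟫ ≤ c → ⟪y, z⟫ ≤ c →
      ⟪y, w⟫ ≤ c → ⟪z, w⟫ ≤ c →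
      ∑ J₁ ∈ ({x, y, z, w} : Finset F).powerset with J₁.card ≤ 2,
        ∑ J₂ ∈ ({x, y, z, w} : Finset F).powerset with J₂.card ≤ 2 ∧ J₁ ∪ J₂ = {x, y, z, w},
          K J₁ J₂ = p₄ ⟪x, y⟫ ⟪x, z⟫ ⟪x, w⟫ ⟪y, z⟫ ⟪y, w⟫ ⟪z, w⟫)
    (hp1 : p₁ ≤ -1) (hp2 : ∀ u : ℝ, -1 ≤ u → u ≤ c → p₂ u ≤ 0)
    (hp3 : ∀ u₁ u₂ u₃ : ℝ, 0 ≤ (u₁ + 1) * (c - u₁) → 0 ≤ (u₂ + 1) * (c - u₂) →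
      0 ≤ (u₃ + 1) * (c - u₃) → 0 ≤ Matrix.det !![1, u₁, u₂; u₁, 1, u₃; u₂, u₃, 1] →
      p₃ u₁ u₂ u₃ ≤ 0)
    (hp4 : ∀ u₁ u₂ u₃ u₄ u₅ u₆ : ℝ, 0 ≤ (u₁ + 1) * (c - u₁) → 0 ≤ (u₂ + 1) * (c - u₂) →
      0 ≤ (u₃ + 1) * (c - u₃) → 0 ≤ (u₄ + 1) * (c - u₄) → 0 ≤ (u₅ + 1) * (c - u₅) →
      0 ≤ (u₆ + 1) * (c - u₆) →
      0 ≤ Matrix.det !![1, u₁, u₂; u₁, 1, u₄; u₂, u₄, 1] →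
      0 ≤ Matrix.det !![1, u₁, u₃; u₁, 1, u₅; u₃, u₅, 1] →
      0 ≤ Matrix.det !![1, u₂, u₃; u₂, 1, u₆; u₃, u₆, 1] →
      0 ≤ Matrix.det !![1, u₄, u₅; u₄, 1, u₆; u₅, u₆, 1] →
      0 ≤ Matrix.det !![1, u₁, u₂, u₃; u₁, 1, u₄, u₅; u₂, u₄, 1, u₆; u₃, u₅, u₆, 1] →
      p₄ u₁ u₂ u₃ u₄ u₅ u₆ ≤ 0)
    (C : Finset F) (hC1 : ∀ x ∈ C, ‖x‖ = 1) (hCc : ∀ x ∈ C, ∀ y ∈ C, x ≠ y → ⟪x, y⟫ ≤ c) :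
    (C.card : ℝ) ≤ K ∅ ∅ :=
  lasserre2_code_card_le K c hpos (fun x hx => by rw [hK1 x hx]; exact hp1)
    (lasserre2_union_sum_nonpos_of_polynomials K c p₂ p₃ p₄ hK2 hK3 hK4 hp2 hp3 hp4) C hC1 hCc

end SemialgebraicConstraints

section SemialgebraicE4

/-- **`k(4) ≤ K(∅, ∅) ≤ 24` from a solution of program (pr:semialgebraic)** for `n = 4`,
`θ = π/3` (`cos θ = 1/2`) with objective `≤ 24`, i.e. `musin2008_kissing_four` from the finite
semidefinite program of §4: positivity of `K`, `A₂K = p₁, p₂, p₃, p₄` on codes of sizes `1–4`,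
`p₁ ≤ -1`, `p₂ ≤ 0` on `[-1, 1/2]`, `p₃ ≤ 0` on `Δ₃`, `p₄ ≤ 0` on `Δ₄`.
[cite: DeLaatLeijenhorstDeMuinckKeizer2024, §4 (program (pr:semialgebraic)) and §5.1 ("an exact
feasible solution `K` with objective value `K(∅, ∅) = 24`")] -/
theorem musin2008_kissing_four_of_semialgebraic_certificate
    (K : Finset (EuclideanSpace ℝ (Fin 4)) → Finset (EuclideanSpace ℝ (Fin 4)) → ℝ)
    (hpos : ∀ C : Finset (EuclideanSpace ℝ (Fin 4)), (∀ x ∈ C, ‖x‖ = 1) →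
      (∀ x ∈ C, ∀ y ∈ C, x ≠ y → ⟪x, y⟫ ≤ 1 / 2) →
      0 ≤ ∑ J₁ ∈ C.powerset with J₁.card ≤ 2, ∑ J₂ ∈ C.powerset with J₂.card ≤ 2, K J₁ J₂)
    (hobj : K ∅ ∅ ≤ 24)
    (p₁ : ℝ) (p₂ : ℝ → ℝ) (p₃ : ℝ → ℝ → ℝ → ℝ) (p₄ : ℝ → ℝ → ℝ → ℝ → ℝ → ℝ → ℝ)
    (hK1 : ∀ x : EuclideanSpace ℝ (Fin 4), ‖x‖ = 1 →
      ∑ J₁ ∈ ({x} : Finset (EuclideanSpace ℝ (Fin 4))).powerset with J₁.card ≤ 2,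
        ∑ J₂ ∈ ({x} : Finset (EuclideanSpace ℝ (Fin 4))).powerset with
          J₂.card ≤ 2 ∧ J₁ ∪ J₂ = {x}, K J₁ J₂ = p₁)
    (hK2 : ∀ x y : EuclideanSpace ℝ (Fin 4), ‖x‖ = 1 → ‖y‖ = 1 → x ≠ y → ⟪x, y⟫ ≤ 1 / 2 →
      ∑ J₁ ∈ ({x, y} : Finset (EuclideanSpace ℝ (Fin 4))).powerset with J₁.card ≤ 2,
        ∑ J₂ ∈ ({x, y} : Finset (EuclideanSpace ℝ (Fin 4))).powerset with
          J₂.card ≤ 2 ∧ J₁ ∪ J₂ = {x, y}, K J₁ J₂ = p₂ ⟪x, y⟫)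
    (hK3 : ∀ x y z : EuclideanSpace ℝ (Fin 4), ‖x‖ = 1 → ‖y‖ = 1 → ‖z‖ = 1 → x ≠ y → x ≠ z →
      y ≠ z → ⟪x, y⟫ ≤ 1 / 2 → ⟪x, z⟫ ≤ 1 / 2 → ⟪y, z⟫ ≤ 1 / 2 →
      ∑ J₁ ∈ ({x, y, z} : Finset (EuclideanSpace ℝ (Fin 4))).powerset with J₁.card ≤ 2,
        ∑ J₂ ∈ ({x, y, z} : Finset (EuclideanSpace ℝ (Fin 4))).powerset with
          J₂.card ≤ 2 ∧ J₁ ∪ J₂ = {x, y, z}, K J₁ J₂ = p₃ ⟪x, y⟫ ⟪x, z⟫ ⟪y, z⟫)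
    (hK4 : ∀ x y z w : EuclideanSpace ℝ (Fin 4), ‖x‖ = 1 → ‖y‖ = 1 → ‖z‖ = 1 → ‖w‖ = 1 →
      x ≠ y → x ≠ z → x ≠ w → y ≠ z → y ≠ w → z ≠ w → ⟪x, y⟫ ≤ 1 / 2 → ⟪x, z⟫ ≤ 1 / 2 →
      ⟪x, w⟫ ≤ 1 / 2 → ⟪y, z⟫ ≤ 1 / 2 → ⟪y, w⟫ ≤ 1 / 2 → ⟪z, w⟫ ≤ 1 / 2 →
      ∑ J₁ ∈ ({x, y, z, w} : Finset (EuclideanSpace ℝ (Fin 4))).powerset with J₁.card ≤ 2,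
        ∑ J₂ ∈ ({x, y, z, w} : Finset (EuclideanSpace ℝ (Fin 4))).powerset with
          J₂.card ≤ 2 ∧ J₁ ∪ J₂ = {x, y, z, w}, K J₁ J₂
            = p₄ ⟪x, y⟫ ⟪x, z⟫ ⟪x, w⟫ ⟪y, z⟫ ⟪y, w⟫ ⟪z, w⟫)
    (hp1 : p₁ ≤ -1) (hp2 : ∀ u : ℝ, -1 ≤ u → u ≤ 1 / 2 → p₂ u ≤ 0)
    (hp3 : ∀ u₁ u₂ u₃ : ℝ, 0 ≤ (u₁ + 1) * (1 / 2 - u₁) → 0 ≤ (u₂ + 1) * (1 / 2 - u₂) →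
      0 ≤ (u₃ + 1) * (1 / 2 - u₃) → 0 ≤ Matrix.det !![1, u₁, u₂; u₁, 1, u₃; u₂, u₃, 1] →
      p₃ u₁ u₂ u₃ ≤ 0)
    (hp4 : ∀ u₁ u₂ u₃ u₄ u₅ u₆ : ℝ, 0 ≤ (u₁ + 1) * (1 / 2 - u₁) → 0 ≤ (u₂ + 1) * (1 / 2 - u₂) →
      0 ≤ (u₃ + 1) * (1 / 2 - u₃) → 0 ≤ (u₄ + 1) * (1 / 2 - u₄) → 0 ≤ (u₅ + 1) * (1 / 2 - u₅) →
      0 ≤ (u₆ + 1) * (1 / 2 - u₆) →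
      0 ≤ Matrix.det !![1, u₁, u₂; u₁, 1, u₄; u₂, u₄, 1] →
      0 ≤ Matrix.det !![1, u₁, u₃; u₁, 1, u₅; u₃, u₅, 1] →
      0 ≤ Matrix.det !![1, u₂, u₃; u₂, 1, u₆; u₃, u₆, 1] →
      0 ≤ Matrix.det !![1, u₄, u₅; u₄, 1, u₆; u₅, u₆, 1] →
      0 ≤ Matrix.det !![1, u₁, u₂, u₃; u₁, 1, u₄, u₅; u₂, u₄, 1, u₆; u₃, u₅, u₆, 1] →
      p₄ u₁ u₂ u₃ u₄ u₅ u₆ ≤ 0) :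
    musin2008_kissing_four :=
  musin2008_kissing_four_of_lasserre2_certificate K hpos hobj
    (fun x hx => by rw [hK1 x hx]; exact hp1)
    (lasserre2_union_sum_nonpos_of_polynomials K (1 / 2) p₂ p₃ p₄ hK2 hK3 hK4 hp2 hp3 hp4)

/-- **Theorem 5.3 (the fact `dlldmk2024_kissing_four_unique`) from a solution of program
(pr:semialgebraic)** for `n = 4`, `cos θ = 1/2` with objective `≤ 24` whose two-point polynomial
`p₂` vanishes on `[-1, 1/2]` only at `-1, ±1/2, 0` ("Using Sturm sequences we verify that the
polynomial `p₂` … has roots `-1`, `±1/2`, and `0` in the interval `[-1, 1/2]`", §5.1): the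
constraints of §4 give feasibility for program (1) (`lasserre2_union_sum_nonpos_of_polynomials`),
and `dlldmk2024_kissing_four_unique_of_lasserre2_certificate` applies. After this theorem the
unformalised residue of the fact is precisely: the rational data (`K̂_λ ⪰ 0`, the polynomials
`p₁, …, p₄` with their sums-of-squares identities, the roots of `p₂`) and the positivity of the
kernel `K = Σ_λ ⟨K̂_λ, Z_λ⟩` (the zonal matrices of §2–§3).
[cite: DeLaatLeijenhorstDeMuinckKeizer2024, §4 (program (pr:semialgebraic)), §5.1 (Lemma 5.1,
Theorem 5.3)] -/
theorem dlldmk2024_kissing_four_unique_of_semialgebraic_certificate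
    (K : Finset (EuclideanSpace ℝ (Fin 4)) → Finset (EuclideanSpace ℝ (Fin 4)) → ℝ)
    (hpos : ∀ C : Finset (EuclideanSpace ℝ (Fin 4)), (∀ x ∈ C, ‖x‖ = 1) →
      (∀ x ∈ C, ∀ y ∈ C, x ≠ y → ⟪x, y⟫ ≤ 1 / 2) →
      0 ≤ ∑ J₁ ∈ C.powerset with J₁.card ≤ 2, ∑ J₂ ∈ C.powerset with J₂.card ≤ 2, K J₁ J₂)
    (hobj : K ∅ ∅ ≤ 24)
    (p₁ : ℝ) (p₂ : ℝ → ℝ) (p₃ : ℝ → ℝ → ℝ → ℝ) (p₄ : ℝ → ℝ → ℝ → ℝ → ℝ → ℝ → ℝ)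
    (hK1 : ∀ x : EuclideanSpace ℝ (Fin 4), ‖x‖ = 1 →
      ∑ J₁ ∈ ({x} : Finset (EuclideanSpace ℝ (Fin 4))).powerset with J₁.card ≤ 2,
        ∑ J₂ ∈ ({x} : Finset (EuclideanSpace ℝ (Fin 4))).powerset with
          J₂.card ≤ 2 ∧ J₁ ∪ J₂ = {x}, K J₁ J₂ = p₁)
    (hK2 : ∀ x y : EuclideanSpace ℝ (Fin 4), ‖x‖ = 1 → ‖y‖ = 1 → x ≠ y → ⟪x, y⟫ ≤ 1 / 2 →
      ∑ J₁ ∈ ({x, y} : Finset (EuclideanSpace ℝ (Fin 4))).powerset with J₁.card ≤ 2,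
        ∑ J₂ ∈ ({x, y} : Finset (EuclideanSpace ℝ (Fin 4))).powerset with
          J₂.card ≤ 2 ∧ J₁ ∪ J₂ = {x, y}, K J₁ J₂ = p₂ ⟪x, y⟫)
    (hK3 : ∀ x y z : EuclideanSpace ℝ (Fin 4), ‖x‖ = 1 → ‖y‖ = 1 → ‖z‖ = 1 → x ≠ y → x ≠ z →
      y ≠ z → ⟪x, y⟫ ≤ 1 / 2 → ⟪x, z⟫ ≤ 1 / 2 → ⟪y, z⟫ ≤ 1 / 2 →
      ∑ J₁ ∈ ({x, y, z} : Finset (EuclideanSpace ℝ (Fin 4))).powerset with J₁.card ≤ 2,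
        ∑ J₂ ∈ ({x, y, z} : Finset (EuclideanSpace ℝ (Fin 4))).powerset with
          J₂.card ≤ 2 ∧ J₁ ∪ J₂ = {x, y, z}, K J₁ J₂ = p₃ ⟪x, y⟫ ⟪x, z⟫ ⟪y, z⟫)
    (hK4 : ∀ x y z w : EuclideanSpace ℝ (Fin 4), ‖x‖ = 1 → ‖y‖ = 1 → ‖z‖ = 1 → ‖w‖ = 1 →
      x ≠ y → x ≠ z → x ≠ w → y ≠ z → y ≠ w → z ≠ w → ⟪x, y⟫ ≤ 1 / 2 → ⟪x, z⟫ ≤ 1 / 2 →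
      ⟪x, w⟫ ≤ 1 / 2 → ⟪y, z⟫ ≤ 1 / 2 → ⟪y, w⟫ ≤ 1 / 2 → ⟪z, w⟫ ≤ 1 / 2 →
      ∑ J₁ ∈ ({x, y, z, w} : Finset (EuclideanSpace ℝ (Fin 4))).powerset with J₁.card ≤ 2,
        ∑ J₂ ∈ ({x, y, z, w} : Finset (EuclideanSpace ℝ (Fin 4))).powerset with
          J₂.card ≤ 2 ∧ J₁ ∪ J₂ = {x, y, z, w}, K J₁ J₂
            = p₄ ⟪x, y⟫ ⟪x, z⟫ ⟪x, w⟫ ⟪y, z⟫ ⟪y, w⟫ ⟪z, w⟫)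
    (hp1 : p₁ ≤ -1) (hp2 : ∀ u : ℝ, -1 ≤ u → u ≤ 1 / 2 → p₂ u ≤ 0)
    (hp3 : ∀ u₁ u₂ u₃ : ℝ, 0 ≤ (u₁ + 1) * (1 / 2 - u₁) → 0 ≤ (u₂ + 1) * (1 / 2 - u₂) →
      0 ≤ (u₃ + 1) * (1 / 2 - u₃) → 0 ≤ Matrix.det !![1, u₁, u₂; u₁, 1, u₃; u₂, u₃, 1] →
      p₃ u₁ u₂ u₃ ≤ 0)
    (hp4 : ∀ u₁ u₂ u₃ u₄ u₅ u₆ : ℝ, 0 ≤ (u₁ + 1) * (1 / 2 - u₁) → 0 ≤ (u₂ + 1) * (1 / 2 - u₂) →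
      0 ≤ (u₃ + 1) * (1 / 2 - u₃) → 0 ≤ (u₄ + 1) * (1 / 2 - u₄) → 0 ≤ (u₅ + 1) * (1 / 2 - u₅) →
      0 ≤ (u₆ + 1) * (1 / 2 - u₆) →
      0 ≤ Matrix.det !![1, u₁, u₂; u₁, 1, u₄; u₂, u₄, 1] →
      0 ≤ Matrix.det !![1, u₁, u₃; u₁, 1, u₅; u₃, u₅, 1] →
      0 ≤ Matrix.det !![1, u₂, u₃; u₂, 1, u₆; u₃, u₆, 1] →
      0 ≤ Matrix.det !![1, u₄, u₅; u₄, 1, u₆; u₅, u₆, 1] →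
      0 ≤ Matrix.det !![1, u₁, u₂, u₃; u₁, 1, u₄, u₅; u₂, u₄, 1, u₆; u₃, u₅, u₆, 1] →
      p₄ u₁ u₂ u₃ u₄ u₅ u₆ ≤ 0)
    (hroots : ∀ u : ℝ, -1 ≤ u → u ≤ 1 / 2 → p₂ u = 0 →
      (u = -1 ∨ u = -1 / 2 ∨ u = 0 ∨ u = 1 / 2)) :
    dlldmk2024_kissing_four_unique :=
  dlldmk2024_kissing_four_unique_of_lasserre2_certificate K hpos hobj
    (fun x hx => by rw [hK1 x hx]; exact hp1)
    (lasserre2_union_sum_nonpos_of_polynomials K (1 / 2) p₂ p₃ p₄ hK2 hK3 hK4 hp2 hp3 hp4)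
    (fun x y hx hy hxy hle h0 => by
      rw [hK2 x y hx hy hxy hle] at h0
      exact hroots _ (d4u_neg_one_le_inner hx hy) hle h0)

end SemialgebraicE4

end Literature.Geometry.DiscreteGeometry

end
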